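import Summits.QuantumFields.YangMills.Theses.PencilRigidity
import Summits.QuantumFields.YangMills.Theorems.PencilRigidityCurvatureKernelBoundKernelPinning
import Literature.Analysis.UnboundedOperators.HeatKernel
import Literature.MathematicalPhysics.QuantumFieldTheory.OSAxiomsFreeFieldKernelProofs
import Literature.MathematicalPhysics.QuantumLattice.FreeCovarianceProofs

/-!
# Disproof of `PencilRigidity.CurvatureKernelBound` (stmt-QuantumFields-11687) — PART III
# (cdisprove cycle 3, seat refuter-cdisprove-…-11687-g3-0). Companion of `Disproof.lean` (Parts I–II index,
# §A–§I, §D, §E); self-contained (own namespace `…DisproofIII`, repeats the §F/§I free-kernel helpers it needs).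

ALL THEOREMS BELOW ARE SORRY-FREE (axioms `propext`, `Classical.choice`, `Quot.sound`).

* §J `L1Witness.not_axialGrowthOfTwoPointPackage` — ORDER-INSUFFICIENCY WITH REGULARITY: a two-point CLM with the
  two-point shadow of `W₁ ∖ lattice` (translations + proper signed permutations on `⁰𝒮`, swap, hermiticity, E2 on
  positive-time one-point families, exponential clustering) represented on `⁰𝒮` by a kernel CONTINUOUS OFF `0` need
  not obey Stub E's `‖K(s e₀)‖ ≤ C s^(η−10)`, `η > 0`: `K = k₁(‖·‖₁)`, `k₁(r) = ∫_{λ>1} λ⁹e^{-λr}dλ`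
  (`e⁻² s⁻¹⁰ ≤ K(s e₀)`), `T` = Hahn–Banach extension of `∫ K F` from `⁰𝒮` (flat-decay lemma
  `norm_le_flat_of_isOffDiagonal` = core of Stub A4), E2 by an explicit sum of squares. Also `KwC_axisEnvelope`: the
  witness passes every conclusion of Stub B. (Landing in the Negative lane as `…/Negative/L1*.lean`.)
* §K `GFF.not_axialGrowthOfEuclideanPackage` — ORDER-INSUFFICIENCY WITH FULL EUCLIDEAN STRUCTURE: even invariance
  under EVERY linear isometry of `ℝ⁴` on `⁰𝒮` and E2 IN EVERY FRAME (all 16 lattice mirrors incl. the diagonal ones of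
  `DiagonalMirrorRPR`, and every other hyperplane) do not bound the order: the dimension-5 generalised free field
  `K₅ = ∫_{μ>2} μ⁷ G_μ dμ` (Källén–Lehmann superposition of the tree's free propagators; E2 inherited mass by mass
  from the tree theorem `freeCovariance_reflectionPositive_holds`; `e⁻²/(4π²) s⁻¹⁰ ≤ K₅(s e₀)` for `s ≤ 1/2`), through
  the GENERIC pipeline `KernelWitness` (`AdmissibleKernel` ⇒ Hahn–Banach two-point functional with translations,
  kernel symmetries, swap, hermiticity, clustering, and E2 from a one-function core `rp_core`).

MORAL for the picked line `sixteen-charts-analytic-kernel` and for every model-blind route: the ORDER of the `tr F²`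
two-point singularity is pure UV input. Stubs A1–A4 (regularity), B (envelope), `DiagonalMirrorRPR`, full E1, E2 in
any set of frames, E0/E3/E4 at the two-point level — none of it constrains the order; Stub E / the crux's `η > 0`
can only come from the lattice tie `W₁.1` (asymptotic freedom of Wilson's action), i.e. from the open UV construction.
-/

open scoped BigOperators Topology SchwartzMap
open MeasureTheory Filter Set Real
open Literature.MathematicalPhysics.QuantumLattice Literature.MathematicalPhysics.AQFT

noncomputable section

namespace Summit.QuantumFields.YangMills.Cruxes.CurvatureKernelBound.DisproofIII

/-- `ℝ⁴`. -/
abbrev E4 : Type := EuclideanSpace ℝ (Fin 4)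

/-- Lebesgue measure on `(ℝ⁴)²` has temperate growth (instance supplied by name). -/
instance hasTemperateGrowth_config₂ : (volume : Measure (Fin 2 → E4)).HasTemperateGrowth :=
  Measure.IsAddHaarMeasure.instHasTemperateGrowth

namespace L1Witness

/-! ### The radial profile -/

/-- The Euler-type integrand `λ⁹ e^{-rλ}`. -/
def kint (r t : ℝ) : ℝ := t ^ (9 : ℕ) * exp (-(r * t))

/-- The radial profile `k₁(r) = ∫_{λ>1} λ⁹ e^{-λ r} dλ` (a Laplace transform of the positive
measure `1_{λ>1} λ⁹ dλ`: completely monotone, `≍ 9!/r¹⁰` at `0⁺`, `≲ e^{-r}` at infinity). -/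
def kfun (r : ℝ) : ℝ := ∫ t in Ioi (1 : ℝ), kint r t

theorem kint_nonneg (r : ℝ) {t : ℝ} (ht : 0 ≤ t) : 0 ≤ kint r t :=
  mul_nonneg (pow_nonneg ht 9) (exp_pos _).le

theorem kint_eq_rpow (r t : ℝ) :
    kint r t = t ^ ((10 : ℝ) - 1) * exp (-(r * t)) := by
  rw [kint, ← Real.rpow_natCast t 9]
  norm_num

theorem continuous_kint_uncurry : Continuous fun p : ℝ × ℝ => kint p.1 p.2 := by
  unfold kint; fun_prop

theorem continuous_kint (r : ℝ) : Continuous (kint r) := by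
  unfold kint; fun_prop

/-- Integrability of the Euler integrand on `(0, ∞)` for `r > 0`. -/
theorem integrableOn_kint_Ioi_zero {r : ℝ} (hr : 0 < r) : IntegrableOn (kint r) (Ioi 0) := by
  have h : IntegrableOn (fun t : ℝ => t ^ ((10 : ℝ) - 1) * exp (-(r * t))) (Ioi 0) := by
    refine Integrable.of_integral_ne_zero ?_
    rw [Real.integral_rpow_mul_exp_neg_mul_Ioi (by norm_num : (0 : ℝ) < 10) hr]
    exact (mul_pos (by positivity) (Real.Gamma_pos_of_pos (by norm_num))).ne'
  exact h.congr_fun (fun t _ => (kint_eq_rpow r t).symm) measurableSet_Ioi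

theorem integrableOn_kint {r : ℝ} (hr : 0 < r) : IntegrableOn (kint r) (Ioi 1) :=
  (integrableOn_kint_Ioi_zero hr).mono_set (Ioi_subset_Ioi zero_le_one)

theorem kfun_nonneg (r : ℝ) : 0 ≤ kfun r :=
  setIntegral_nonneg measurableSet_Ioi fun _ ht => kint_nonneg r (zero_le_one.trans (le_of_lt ht))

/-- `Γ(10) = 9!`. -/
theorem Gamma_ten : Real.Gamma 10 = Nat.factorial 9 := by
  rw [show (10 : ℝ) = (9 : ℕ) + 1 by norm_num, Real.Gamma_nat_eq_factorial]

/-- Upper bound `k₁(r) ≤ 9! / r¹⁰` (the full Euler integral). -/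
theorem kfun_le {r : ℝ} (hr : 0 < r) : kfun r ≤ Nat.factorial 9 * r⁻¹ ^ 10 := by
  calc kfun r ≤ ∫ t in Ioi (0 : ℝ), kint r t :=
        setIntegral_mono_set (integrableOn_kint_Ioi_zero hr)
          (ae_restrict_of_forall_mem measurableSet_Ioi fun t ht => kint_nonneg r (le_of_lt ht))
          (Eventually.of_forall (Ioi_subset_Ioi zero_le_one))
    _ = ∫ t in Ioi (0 : ℝ), t ^ ((10 : ℝ) - 1) * exp (-(r * t)) :=
        setIntegral_congr_fun measurableSet_Ioi fun t _ => kint_eq_rpow r t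
    _ = (1 / r) ^ (10 : ℝ) * Real.Gamma 10 :=
        Real.integral_rpow_mul_exp_neg_mul_Ioi (by norm_num) hr
    _ = Nat.factorial 9 * r⁻¹ ^ 10 := by
        rw [Gamma_ten, one_div, show (10 : ℝ) = ((10 : ℕ) : ℝ) by norm_num, Real.rpow_natCast]
        ring

/-- Lower bound `e⁻² / r¹⁰ ≤ k₁(r)` for `0 < r ≤ 1` (the window `λ ∈ (1/r, 2/r]`). -/
theorem kfun_ge {r : ℝ} (hr : 0 < r) (hr1 : r ≤ 1) : exp (-2) * r⁻¹ ^ 10 ≤ kfun r := by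
  have hri : 1 ≤ r⁻¹ := one_le_inv_iff₀.2 ⟨hr, hr1⟩
  have hsub : Ioc r⁻¹ (2 * r⁻¹) ⊆ Ioi (1 : ℝ) := fun t ht =>
    mem_Ioi.2 (lt_of_le_of_lt hri (mem_Ioc.1 ht).1)
  have hconst : ∀ t ∈ Ioc r⁻¹ (2 * r⁻¹), exp (-2) * r⁻¹ ^ 9 ≤ kint r t := by
    intro t ht
    have ht1 : r⁻¹ ≤ t := ht.1.le
    have ht0 : 0 ≤ t := le_trans (by positivity) ht1
    have hrt : r * t ≤ 2 := by
      have := mul_le_mul_of_nonneg_left ht.2 hr.le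
      rwa [show r * (2 * r⁻¹) = 2 by field_simp] at this
    calc exp (-2) * r⁻¹ ^ 9 = r⁻¹ ^ 9 * exp (-2) := mul_comm _ _
      _ ≤ t ^ 9 * exp (-(r * t)) :=
          mul_le_mul (pow_le_pow_left₀ (by positivity) ht1 9) (exp_le_exp.2 (by linarith))
            (exp_pos _).le (pow_nonneg ht0 9)
  calc exp (-2) * r⁻¹ ^ 10 = (exp (-2) * r⁻¹ ^ 9) * (2 * r⁻¹ - r⁻¹) := by ring
    _ = ∫ _ in Ioc r⁻¹ (2 * r⁻¹), exp (-2) * r⁻¹ ^ 9 := by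
        rw [setIntegral_const, Real.volume_real_Ioc_of_le (by linarith), smul_eq_mul]
        ring
    _ ≤ ∫ t in Ioc r⁻¹ (2 * r⁻¹), kint r t :=
        setIntegral_mono_on (integrableOn_const (by simp [Real.volume_Ioc]))
          ((integrableOn_kint hr).mono_set hsub) measurableSet_Ioc hconst
    _ ≤ kfun r :=
        setIntegral_mono_set (integrableOn_kint hr)
          (ae_restrict_of_forall_mem measurableSet_Ioi fun t ht =>
            kint_nonneg r (zero_le_one.trans (le_of_lt ht)))
          (Eventually.of_forall hsub)

/-- Exponential bound `k₁(r) ≤ e^{1-r} k₁(1)` for `r ≥ 1`. -/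
theorem kfun_le_exp {r : ℝ} (hr : 1 ≤ r) : kfun r ≤ exp (1 - r) * kfun 1 := by
  have hpt : ∀ t ∈ Ioi (1 : ℝ), kint r t ≤ exp (1 - r) * kint 1 t := by
    intro t ht
    have ht1 : 1 ≤ t := le_of_lt ht
    unfold kint
    rw [mul_left_comm, ← Real.exp_add]
    gcongr
    nlinarith
  calc kfun r ≤ ∫ t in Ioi (1 : ℝ), exp (1 - r) * kint 1 t :=
        setIntegral_mono_on (integrableOn_kint (by linarith)) ((integrableOn_kint one_pos).const_mul _)
          measurableSet_Ioi hpt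
    _ = exp (1 - r) * kfun 1 := by rw [integral_const_mul]; rfl

/-- Monotonicity in `r` of the integrand. -/
theorem kint_antitone {r r' : ℝ} (h : r ≤ r') {t : ℝ} (ht : 0 ≤ t) : kint r' t ≤ kint r t := by
  unfold kint
  gcongr

/-- `k₁` is continuous on `(0, ∞)`. -/
theorem continuousOn_kfun : ContinuousOn kfun (Ioi 0) := by
  intro r hr
  have hr2 : 0 < r / 2 := by simpa using half_pos (mem_Ioi.1 hr)
  have hcont : ContinuousOn kfun (Ici (r / 2)) := by
    refine continuousOn_of_dominated (F := fun r' t => kint r' t) (bound := kint (r / 2))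
      (μ := volume.restrict (Ioi (1 : ℝ))) (fun r' _ => (continuous_kint r').aestronglyMeasurable)
      (fun r' hr' => ae_restrict_of_forall_mem measurableSet_Ioi fun t ht => ?_)
      (integrableOn_kint hr2) (ae_of_all _ fun t => ?_)
    · rw [Real.norm_of_nonneg (kint_nonneg _ (zero_le_one.trans (le_of_lt ht)))]
      exact kint_antitone hr' (zero_le_one.trans (le_of_lt ht))
    · exact (continuous_kint_uncurry.comp (continuous_id.prodMk continuous_const)).continuousOn
  exact (hcont.continuousAt (Ici_mem_nhds (by linarith [mem_Ioi.1 hr]))).continuousWithinAt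

/-- `k₁` is strongly measurable (as a parametric integral of a continuous integrand). -/
theorem stronglyMeasurable_kfun : StronglyMeasurable kfun :=
  continuous_kint_uncurry.measurable.stronglyMeasurable.integral_prod_right'
    (ν := volume.restrict (Ioi (1 : ℝ)))

theorem measurable_kfun : Measurable kfun := stronglyMeasurable_kfun.measurable

/-! ### The `ℓ¹` norm on `ℝ⁴` and the kernel -/

/-- `‖x‖₁ = Σ_μ |x^μ|`. -/
def l1 (x : E4) : ℝ := ∑ μ, |x μ|

theorem l1_nonneg (x : E4) : 0 ≤ l1 x := Finset.sum_nonneg fun _ _ => abs_nonneg _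

theorem continuous_l1 : Continuous l1 := by unfold l1; fun_prop

theorem l1_neg (x : E4) : l1 (-x) = l1 x := by simp [l1]

/-- The Euclidean norm is dominated by the `ℓ¹` norm. -/
theorem norm_le_l1 (x : E4) : ‖x‖ ≤ l1 x := by
  have h2 : ‖x‖ ^ 2 ≤ l1 x ^ 2 := by
    rw [EuclideanSpace.real_norm_sq_eq, l1, sq, Finset.sum_mul_sum]
    refine Finset.sum_le_sum fun i _ => ?_
    rw [← Finset.mul_sum]
    calc x i ^ 2 = |x i| * |x i| := by rw [sq]; exact (abs_mul_abs_self _).symm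
      _ ≤ |x i| * ∑ j, |x j| :=
          mul_le_mul_of_nonneg_left (Finset.single_le_sum (fun j _ => abs_nonneg (x j))
            (Finset.mem_univ i)) (abs_nonneg _)
  exact (sq_le_sq₀ (norm_nonneg x) (l1_nonneg x)).1 h2

theorem l1_pos {x : E4} (hx : x ≠ 0) : 0 < l1 x :=
  lt_of_lt_of_le (norm_pos_iff.2 hx) (norm_le_l1 x)

/-- `‖s e₀‖₁ = |s|`. -/
theorem l1_single (i : Fin 4) (s : ℝ) : l1 (EuclideanSpace.single i s) = |s| := by
  simp [l1, Finset.sum_ite_eq', apply_ite]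

/-- **The kernel** `K(x) = k₁(‖x‖₁)`. -/
def Kw (x : E4) : ℝ := kfun (l1 x)

theorem Kw_nonneg (x : E4) : 0 ≤ Kw x := kfun_nonneg _

theorem measurable_Kw : Measurable Kw := measurable_kfun.comp continuous_l1.measurable

theorem continuousOn_Kw : ContinuousOn Kw {x : E4 | x ≠ 0} :=
  continuousOn_kfun.comp continuous_l1.continuousOn fun _ hx => l1_pos hx

theorem Kw_neg (x : E4) : Kw (-x) = Kw x := by rw [Kw, l1_neg, Kw]

/-- Polynomial bound `K(x) ≤ 9! ‖x‖⁻¹⁰` off `0`. -/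
theorem Kw_le {x : E4} (hx : x ≠ 0) : Kw x ≤ Nat.factorial 9 * ‖x‖⁻¹ ^ 10 := by
  have h1 := kfun_le (l1_pos hx)
  have h2 : (l1 x)⁻¹ ≤ ‖x‖⁻¹ := inv_anti₀ (norm_pos_iff.2 hx) (norm_le_l1 x)
  have h3 : (l1 x)⁻¹ ^ 10 ≤ ‖x‖⁻¹ ^ 10 := pow_le_pow_left₀ (inv_nonneg.2 (l1_nonneg x)) h2 10
  calc Kw x ≤ Nat.factorial 9 * (l1 x)⁻¹ ^ 10 := h1
    _ ≤ Nat.factorial 9 * ‖x‖⁻¹ ^ 10 := by gcongr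

/-- Exponential bound `K(x) ≤ e^{1-‖x‖} k₁(1)` for `‖x‖ ≥ 1`. -/
theorem Kw_le_exp {x : E4} (hx : 1 ≤ ‖x‖) : Kw x ≤ exp (1 - ‖x‖) * kfun 1 := by
  have h1 : 1 ≤ l1 x := hx.trans (norm_le_l1 x)
  calc Kw x ≤ exp (1 - l1 x) * kfun 1 := kfun_le_exp h1
    _ ≤ exp (1 - ‖x‖) * kfun 1 := by
        gcongr
        · exact kfun_nonneg 1
        · exact norm_le_l1 x

/-- **Order ten on the axis**: `e⁻² s⁻¹⁰ ≤ K(s e₀)` for `0 < s ≤ 1`. -/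
theorem Kw_axis_ge {s : ℝ} (hs : 0 < s) (hs1 : s ≤ 1) :
    exp (-2) * s⁻¹ ^ 10 ≤ Kw (EuclideanSpace.single 0 s) := by
  rw [Kw, l1_single, abs_of_pos hs]
  exact kfun_ge hs hs1


/-! ### Flatness of off-diagonal test functions at the diagonal -/

section Flat

variable (x : Fin 2 → E4)

/-- The nearest diagonal configuration `((x₀+x₁)/2, (x₀+x₁)/2)`. -/
def diagPt : Fin 2 → E4 := fun _ => (1 / 2 : ℝ) • (x 0 + x 1)

/-- The offset `x - diagPt x = ((x₀-x₁)/2, (x₁-x₀)/2)`. -/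
def offV : Fin 2 → E4 := x - diagPt x

theorem diagPt_mem : diagPt x ∈ coincidenceLocus 2 E4 := ⟨0, 1, by decide, rfl⟩

theorem diagPt_add_offV : diagPt x + offV x = x := by simp [offV]

theorem offV_apply_zero : offV x 0 = (1 / 2 : ℝ) • (x 0 - x 1) := by
  simp only [offV, diagPt, Pi.sub_apply]; module

theorem offV_apply_one : offV x 1 = -((1 / 2 : ℝ) • (x 0 - x 1)) := by
  simp only [offV, diagPt, Pi.sub_apply]; module

theorem norm_offV_le : ‖offV x‖ ≤ ‖x 0 - x 1‖ / 2 := by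
  refine (pi_norm_le_iff_of_nonneg (by positivity)).2 fun i => ?_
  fin_cases i
  · show ‖offV x 0‖ ≤ _
    rw [offV_apply_zero, norm_smul]; norm_num
    exact le_of_eq (by ring)
  · show ‖offV x 1‖ ≤ _
    rw [offV_apply_one, norm_neg, norm_smul]; norm_num
    exact le_of_eq (by ring)

variable {x}

/-- Iterated derivatives of the restriction of a test function to a line. -/
theorem iteratedDeriv_lineAt (n : ℕ) (F : 𝓢((Fin 2 → E4), ℂ)) (y v : Fin 2 → E4) (t : ℝ) :
    iteratedDeriv n (fun s : ℝ => F (y + s • v)) t = iteratedFDeriv ℝ n F (y + t • v) (fun _ => v) := by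
  rw [iteratedDeriv_eq_iteratedFDeriv]
  let g : ℝ →L[ℝ] (Fin 2 → E4) := ContinuousLinearMap.toSpanSingleton ℝ v
  have hfun : (fun s : ℝ => F (y + s • v)) = (fun z : Fin 2 → E4 => F (z + y)) ∘ g := by
    funext s
    simp [g, ContinuousLinearMap.toSpanSingleton_apply, add_comm]
  have hF : ContDiff ℝ n (fun z : Fin 2 → E4 => F (z + y)) :=
    (F.smooth n).comp (contDiff_id.add contDiff_const)
  rw [hfun, ContinuousLinearMap.iteratedFDeriv_comp_right g hF t le_rfl]
  simp only [ContinuousMultilinearMap.compContinuousLinearMap_apply]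
  rw [iteratedFDeriv_comp_add_right' n y]
  simp [g, ContinuousLinearMap.toSpanSingleton_apply, add_comm]

/-- One-variable flatness: if all derivatives of order `< N` of a smooth `g` vanish at `0` and the
`N`-th is bounded by `B` on `[0,1]`, then all derivatives of order `≤ N` are bounded by `B` there. -/
theorem norm_iteratedDeriv_le_of_flat {g : ℝ → ℂ} {N : ℕ} {B : ℝ} (hB : 0 ≤ B)
    (hdiff : ∀ j < N, Differentiable ℝ (iteratedDeriv j g))
    (h0 : ∀ j < N, iteratedDeriv j g 0 = 0)
    (hN : ∀ t ∈ Icc (0 : ℝ) 1, ‖iteratedDeriv N g t‖ ≤ B) :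
    ∀ j ≤ N, ∀ t ∈ Icc (0 : ℝ) 1, ‖iteratedDeriv j g t‖ ≤ B := by
  intro j hj
  induction hdist : N - j generalizing j with
  | zero =>
    have : j = N := by omega
    subst this; exact hN
  | succ d ih =>
    have hjN : j < N := by omega
    have hsucc := ih (j + 1) (by omega) (by omega)
    intro t ht
    have hderiv : ∀ s ∈ Icc (0 : ℝ) 1,
        HasDerivWithinAt (iteratedDeriv j g) (iteratedDeriv (j + 1) g s) (Icc 0 1) s := by
      intro s _
      have h := ((hdiff j hjN) s).hasDerivAt
      rw [iteratedDeriv_succ]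
      exact h.hasDerivWithinAt
    have hmvt := norm_image_sub_le_of_norm_deriv_le_segment' hderiv
      (fun s hs => hsucc s (Ico_subset_Icc_self hs)) t ht
    rw [h0 j hjN, sub_zero] at hmvt
    calc ‖iteratedDeriv j g t‖ ≤ B * (t - 0) := hmvt
      _ ≤ B * 1 := by gcongr; linarith [ht.2]
      _ = B := mul_one B

/-- The finite family of Schwartz seminorms of orders `≤ (k, n)`. -/
abbrev SN (k n : ℕ) (F : 𝓢((Fin 2 → E4), ℂ)) : ℝ :=
  (Finset.Iic (k, n)).sup (fun m => SchwartzMap.seminorm ℂ m.1 m.2) F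

theorem SN_nonneg (k n : ℕ) (F : 𝓢((Fin 2 → E4), ℂ)) : 0 ≤ SN k n F := apply_nonneg _ _

/-- **Flat decay at the diagonal.** An off-diagonal test function vanishes to order `N` at the
diagonal, with Schwartz decay: for `‖x₀ - x₁‖ ≤ 1`,
`‖F x‖ ≤ 3ᵏ (‖x₀-x₁‖/2)ᴺ (1+‖x‖)⁻ᵏ · SN k N F`. -/
theorem norm_le_flat_of_isOffDiagonal {F : 𝓢((Fin 2 → E4), ℂ)} (hF : IsOffDiagonal F) (k N : ℕ)
    (x : Fin 2 → E4) (hx : ‖x 0 - x 1‖ ≤ 1) :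
    ‖F x‖ ≤ 3 ^ k * (‖x 0 - x 1‖ / 2) ^ N * (1 + ‖x‖)⁻¹ ^ k * SN k N F := by
  set y := diagPt x with hy
  set v := offV x with hv
  have hvn : ‖v‖ ≤ ‖x 0 - x 1‖ / 2 := norm_offV_le x
  have hv2 : ‖v‖ ≤ 1 / 2 := hvn.trans (by linarith)
  set g : ℝ → ℂ := fun s => F (y + s • v) with hg
  -- weight comparison along the segment
  have hweight : ∀ t ∈ Icc (0 : ℝ) 1, (1 + ‖y + t • v‖)⁻¹ ≤ 3 / 2 * (1 + ‖x‖)⁻¹ := by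
    intro t ht
    have hxz : ‖x‖ ≤ ‖y + t • v‖ + 1 / 2 := by
      have : x = (y + t • v) + (1 - t) • v := by
        rw [← diagPt_add_offV x, ← hy, ← hv]; module
      calc ‖x‖ = ‖(y + t • v) + (1 - t) • v‖ := by rw [← this]
        _ ≤ ‖y + t • v‖ + ‖(1 - t) • v‖ := norm_add_le _ _
        _ ≤ ‖y + t • v‖ + 1 / 2 := by
            rw [norm_smul, Real.norm_of_nonneg (by linarith [ht.2])]
            nlinarith [ht.1, ht.2, norm_nonneg v]
    have hxz' : 1 + ‖x‖ ≤ 3 / 2 * (1 + ‖y + t • v‖) := by nlinarith [norm_nonneg (y + t • v)]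
    calc (1 + ‖y + t • v‖)⁻¹ = 3 / 2 * (3 / 2 * (1 + ‖y + t • v‖))⁻¹ := by
          field_simp
      _ ≤ 3 / 2 * (1 + ‖x‖)⁻¹ := by
          gcongr 3 / 2 * ?_
          exact inv_anti₀ (by positivity) hxz'
  -- the bound on the N-th derivative along the segment
  set B := 3 ^ k * (‖x 0 - x 1‖ / 2) ^ N * (1 + ‖x‖)⁻¹ ^ k * SN k N F with hB
  have hB0 : 0 ≤ B := by positivity
  have hN : ∀ t ∈ Icc (0 : ℝ) 1, ‖iteratedDeriv N g t‖ ≤ B := by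
    intro t ht
    rw [hg, iteratedDeriv_lineAt]
    have h1 : ‖iteratedFDeriv ℝ N F (y + t • v) (fun _ => v)‖ ≤
        ‖iteratedFDeriv ℝ N F (y + t • v)‖ * ‖v‖ ^ N := by
      have := (iteratedFDeriv ℝ N F (y + t • v)).le_opNorm (fun _ => v)
      simpa [Finset.prod_const] using this
    have h2 : (1 + ‖y + t • v‖) ^ k * ‖iteratedFDeriv ℝ N F (y + t • v)‖ ≤ 2 ^ k * SN k N F :=
      SchwartzMap.one_add_le_sup_seminorm_apply (m := (k, N)) le_rfl le_rfl F _
    have hpos : 0 < (1 + ‖y + t • v‖) ^ k := by positivity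
    have h3 : ‖iteratedFDeriv ℝ N F (y + t • v)‖ ≤ 2 ^ k * SN k N F * (1 + ‖y + t • v‖)⁻¹ ^ k := by
      rw [inv_pow, ← div_eq_mul_inv, le_div_iff₀ hpos, mul_comm]
      exact h2
    have h4 : (1 + ‖y + t • v‖)⁻¹ ^ k ≤ (3 / 2) ^ k * (1 + ‖x‖)⁻¹ ^ k := by
      rw [← mul_pow]
      exact pow_le_pow_left₀ (by positivity) (hweight t ht) k
    have h5 : ‖v‖ ^ N ≤ (‖x 0 - x 1‖ / 2) ^ N := pow_le_pow_left₀ (norm_nonneg _) hvn N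
    calc ‖iteratedFDeriv ℝ N F (y + t • v) (fun _ => v)‖
        ≤ ‖iteratedFDeriv ℝ N F (y + t • v)‖ * ‖v‖ ^ N := h1
      _ ≤ (2 ^ k * SN k N F * (1 + ‖y + t • v‖)⁻¹ ^ k) * (‖x 0 - x 1‖ / 2) ^ N := by
          gcongr
      _ ≤ (2 ^ k * SN k N F * ((3 / 2) ^ k * (1 + ‖x‖)⁻¹ ^ k)) * (‖x 0 - x 1‖ / 2) ^ N := by
          gcongr
      _ = B := by
          rw [hB, show (3 : ℝ) ^ k = 2 ^ k * (3 / 2) ^ k by rw [← mul_pow]; norm_num]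
          ring
  -- vanishing of the low derivatives at the diagonal point
  have h0 : ∀ j < N, iteratedDeriv j g 0 = 0 := by
    intro j _
    rw [hg, iteratedDeriv_lineAt, zero_smul, add_zero, hF y (diagPt_mem x) j]
    rfl
  have hdiff : ∀ j < N, Differentiable ℝ (iteratedDeriv j g) := by
    intro j hj
    have hsmooth : ContDiff ℝ N g :=
      (F.smooth N).comp ((contDiff_const.add (contDiff_id.smul contDiff_const)))
    exact hsmooth.differentiable_iteratedDeriv j (by exact_mod_cast hj)
  have := norm_iteratedDeriv_le_of_flat hB0 hdiff h0 hN 0 (Nat.zero_le N) 1 ⟨zero_le_one, le_rfl⟩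
  rw [iteratedDeriv_zero, hg] at this
  simp only [one_smul] at this
  rwa [hy, hv, diagPt_add_offV] at this

/-- Plain Schwartz decay `‖F x‖ ≤ 2ᵏ (1+‖x‖)⁻ᵏ SN k 0 F`. -/
theorem norm_le_SN (F : 𝓢((Fin 2 → E4), ℂ)) (k : ℕ) (x : Fin 2 → E4) :
    ‖F x‖ ≤ 2 ^ k * (1 + ‖x‖)⁻¹ ^ k * SN k 0 F := by
  have h : (1 + ‖x‖) ^ k * ‖F x‖ ≤ 2 ^ k * SN k 0 F := by
    simpa [norm_iteratedFDeriv_zero] using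
      SchwartzMap.one_add_le_sup_seminorm_apply (𝕜 := ℂ) (m := (k, 0)) le_rfl le_rfl F x
  have hpos : 0 < (1 + ‖x‖) ^ k := by positivity
  have h' : ‖F x‖ ≤ (2 ^ k * SN k 0 F) / (1 + ‖x‖) ^ k := by
    rw [le_div_iff₀ hpos, mul_comm]; exact h
  calc ‖F x‖ ≤ (2 ^ k * SN k 0 F) / (1 + ‖x‖) ^ k := h'
    _ = 2 ^ k * (1 + ‖x‖)⁻¹ ^ k * SN k 0 F := by rw [inv_pow]; ring

theorem SN_mono_right {k n n' : ℕ} (h : n ≤ n') (F : 𝓢((Fin 2 → E4), ℂ)) : SN k n F ≤ SN k n' F :=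
  Seminorm.le_def.1 (Finset.sup_mono (Finset.Iic_subset_Iic.2
    (show ((k, n) : ℕ × ℕ) ≤ (k, n') from Prod.mk_le_mk.2 ⟨le_rfl, h⟩))) F

end Flat


/-! ### The two-point integrand `K(x₀−x₁) F(x)`: domination, integrability, seminorm bound -/

section Integrand

/-- The kernel on configurations, complex-valued: `KC x = K(x₀ − x₁)`. -/
def KC (x : Fin 2 → E4) : ℂ := (Kw (x 0 - x 1) : ℂ)

theorem KC_apply (x : Fin 2 → E4) : KC x = (Kw (x 0 - x 1) : ℂ) := rfl

theorem measurable_KC : Measurable KC :=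
  Complex.measurable_ofReal.comp (measurable_Kw.comp ((measurable_pi_apply 0).sub (measurable_pi_apply 1)))

theorem norm_KC (x : Fin 2 → E4) : ‖KC x‖ = Kw (x 0 - x 1) := by
  rw [KC, Complex.norm_real, Real.norm_of_nonneg (Kw_nonneg _)]

/-- The integrable dominator `(1 + ‖x‖)⁻⁹` on `(ℝ⁴)²`. -/
def wt (x : Fin 2 → E4) : ℝ := (1 + ‖x‖)⁻¹ ^ 9

theorem wt_nonneg (x : Fin 2 → E4) : 0 ≤ wt x := by unfold wt; positivity

theorem finrank_config : Module.finrank ℝ (Fin 2 → E4) = 8 := by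
  simp [Module.finrank_pi_fintype]

theorem integrable_wt : Integrable wt := by
  have h := integrable_one_add_norm (E := Fin 2 → E4) (μ := volume) (r := 9)
    (by rw [finrank_config]; norm_num)
  refine h.congr (ae_of_all _ fun x => ?_)
  show (1 + ‖x‖) ^ (-(9 : ℝ)) = (1 + ‖x‖)⁻¹ ^ 9
  rw [Real.rpow_neg (by positivity), show (9 : ℝ) = ((9 : ℕ) : ℝ) by norm_num,
    Real.rpow_natCast, inv_pow]

/-- The domination constant `9! · 3⁹`. -/
def Cdom : ℝ := Nat.factorial 9 * 3 ^ 9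

theorem Cdom_pos : 0 < Cdom := by unfold Cdom; positivity

/-- **Domination**: for an off-diagonal `F`, `‖K(x₀−x₁) F(x)‖ ≤ 9!·3⁹ (1+‖x‖)⁻⁹ SN 9 10 F`
(near the diagonal the `‖x₀−x₁‖⁻¹⁰` of the kernel is paid by ten orders of flatness). -/
theorem norm_KC_mul_le {F : 𝓢((Fin 2 → E4), ℂ)} (hF : IsOffDiagonal F) (x : Fin 2 → E4) :
    ‖KC x * F x‖ ≤ Cdom * wt x * SN 9 10 F := by
  have hrhs : 0 ≤ Cdom * wt x * SN 9 10 F :=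
    mul_nonneg (mul_nonneg Cdom_pos.le (wt_nonneg x)) (SN_nonneg _ _ _)
  by_cases hw : x 0 - x 1 = 0
  · have hx : x ∈ coincidenceLocus 2 E4 := ⟨0, 1, by decide, sub_eq_zero.1 hw⟩
    rw [hF.apply_eq_zero hx, mul_zero, norm_zero]
    exact hrhs
  rw [norm_mul, norm_KC]
  have hK := Kw_le hw
  have hwpos : 0 < ‖x 0 - x 1‖ := norm_pos_iff.2 hw
  by_cases h1 : ‖x 0 - x 1‖ ≤ 1
  · have hFx := norm_le_flat_of_isOffDiagonal hF 9 10 x h1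
    have hprod : ‖x 0 - x 1‖⁻¹ ^ 10 * (‖x 0 - x 1‖ / 2) ^ 10 = (1 / 2) ^ 10 := by
      rw [← mul_pow]; congr 1; field_simp
    calc Kw (x 0 - x 1) * ‖F x‖
        ≤ (Nat.factorial 9 * ‖x 0 - x 1‖⁻¹ ^ 10) *
            (3 ^ 9 * (‖x 0 - x 1‖ / 2) ^ 10 * (1 + ‖x‖)⁻¹ ^ 9 * SN 9 10 F) :=
          mul_le_mul hK hFx (norm_nonneg _) (by positivity)
      _ = Nat.factorial 9 * 3 ^ 9 * (‖x 0 - x 1‖⁻¹ ^ 10 * (‖x 0 - x 1‖ / 2) ^ 10) *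
            (1 + ‖x‖)⁻¹ ^ 9 * SN 9 10 F := by ring
      _ = Nat.factorial 9 * 3 ^ 9 * (1 / 2) ^ 10 * (1 + ‖x‖)⁻¹ ^ 9 * SN 9 10 F := by rw [hprod]
      _ ≤ Nat.factorial 9 * 3 ^ 9 * 1 * (1 + ‖x‖)⁻¹ ^ 9 * SN 9 10 F := by
          gcongr; norm_num
      _ = Cdom * wt x * SN 9 10 F := by rw [Cdom, wt]; ring
  · have h1' : 1 < ‖x 0 - x 1‖ := lt_of_not_ge h1
    have hinv : ‖x 0 - x 1‖⁻¹ ^ 10 ≤ 1 := pow_le_one₀ (by positivity) (inv_le_one_of_one_le₀ h1'.le)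
    have hK' : Kw (x 0 - x 1) ≤ Nat.factorial 9 := by
      calc Kw (x 0 - x 1) ≤ Nat.factorial 9 * ‖x 0 - x 1‖⁻¹ ^ 10 := hK
        _ ≤ Nat.factorial 9 * 1 := by gcongr
        _ = Nat.factorial 9 := mul_one _
    have hFx : ‖F x‖ ≤ 2 ^ 9 * (1 + ‖x‖)⁻¹ ^ 9 * SN 9 10 F :=
      (norm_le_SN F 9 x).trans (by
        gcongr
        exact SN_mono_right (Nat.zero_le 10) F)
    calc Kw (x 0 - x 1) * ‖F x‖ ≤ Nat.factorial 9 * (2 ^ 9 * (1 + ‖x‖)⁻¹ ^ 9 * SN 9 10 F) :=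
          mul_le_mul hK' hFx (norm_nonneg _) (by positivity)
      _ ≤ Nat.factorial 9 * (3 ^ 9 * (1 + ‖x‖)⁻¹ ^ 9 * SN 9 10 F) := by
          gcongr; norm_num
      _ = Cdom * wt x * SN 9 10 F := by rw [Cdom, wt]; ring

theorem aestronglyMeasurable_KC_mul (F : 𝓢((Fin 2 → E4), ℂ)) :
    AEStronglyMeasurable (fun x => KC x * F x) volume :=
  (measurable_KC.aestronglyMeasurable).mul F.continuous.aestronglyMeasurable

/-- **Integrability** of `K(x₀−x₁) F(x)` for off-diagonal `F`. -/
theorem integrable_KC_mul {F : 𝓢((Fin 2 → E4), ℂ)} (hF : IsOffDiagonal F) :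
    Integrable (fun x => KC x * F x) :=
  Integrable.mono' ((integrable_wt.const_mul Cdom).mul_const (SN 9 10 F))
    (aestronglyMeasurable_KC_mul F) (ae_of_all _ (norm_KC_mul_le hF))

/-- The constant of the seminorm bound. -/
def Cbd : ℝ := Cdom * ∫ x, wt x

theorem Cbd_nonneg : 0 ≤ Cbd := mul_nonneg Cdom_pos.le (integral_nonneg wt_nonneg)

/-- **Seminorm bound** `‖∫ K F‖ ≤ Cbd · SN 9 10 F` on `⁰𝒮`. -/
theorem norm_integral_KC_mul_le {F : 𝓢((Fin 2 → E4), ℂ)} (hF : IsOffDiagonal F) :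
    ‖∫ x, KC x * F x‖ ≤ Cbd * SN 9 10 F := by
  calc ‖∫ x, KC x * F x‖ ≤ ∫ x, Cdom * wt x * SN 9 10 F :=
        norm_integral_le_of_norm_le ((integrable_wt.const_mul Cdom).mul_const (SN 9 10 F))
          (ae_of_all _ (norm_KC_mul_le hF))
    _ = Cbd * SN 9 10 F := by
        rw [integral_mul_const, integral_const_mul, Cbd]

end Integrand

/-! ### `⁰𝒮` as a subspace, the functional `ℓ F = ∫ K F`, and a continuous extension `T` -/

section Extension

/-- `⁰𝒮((ℝ⁴)²)` as a `ℂ`-submodule of the Schwartz space. -/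
def offDiag : Submodule ℂ 𝓢((Fin 2 → E4), ℂ) where
  carrier := {F | IsOffDiagonal F}
  add_mem' hF hG := hF.add hG
  zero_mem' := isOffDiagonal_zero
  smul_mem' c _ hF := hF.smul c

theorem mem_offDiag {F : 𝓢((Fin 2 → E4), ℂ)} : F ∈ offDiag ↔ IsOffDiagonal F := Iff.rfl

/-- The functional `ℓ F = ∫ K(x₀−x₁) F(x) dx` (meaningful on `⁰𝒮`). -/
def ell (F : 𝓢((Fin 2 → E4), ℂ)) : ℂ := ∫ x, KC x * F x

theorem ell_add {F G : 𝓢((Fin 2 → E4), ℂ)} (hF : IsOffDiagonal F) (hG : IsOffDiagonal G) :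
    ell (F + G) = ell F + ell G := by
  have h : ∀ x, (F + G) x = F x + G x := fun _ => rfl
  simp only [ell, h, mul_add]
  exact integral_add (integrable_KC_mul hF) (integrable_KC_mul hG)

theorem ell_smul (c : ℂ) (F : 𝓢((Fin 2 → E4), ℂ)) : ell (c • F) = c * ell F := by
  have h : ∀ x, (c • F) x = c * F x := fun _ => rfl
  simp only [ell, h, ← integral_const_mul]
  congr 1; funext x; ring

theorem norm_ell_le {F : 𝓢((Fin 2 → E4), ℂ)} (hF : IsOffDiagonal F) : ‖ell F‖ ≤ Cbd * SN 9 10 F :=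
  norm_integral_KC_mul_le hF

theorem real_smul_eq (c : ℝ) (F : 𝓢((Fin 2 → E4), ℂ)) : c • F = (c : ℂ) • F := by
  ext x; simp

/-- The dominating seminorm `N F = Cbd · SN 9 10 F`. -/
def Nsem (F : 𝓢((Fin 2 → E4), ℂ)) : ℝ := Cbd * SN 9 10 F

theorem Nsem_smul (c : ℂ) (F : 𝓢((Fin 2 → E4), ℂ)) : Nsem (c • F) = ‖c‖ * Nsem F := by
  simp only [Nsem, SN, map_smul_eq_mul]; ring

theorem Nsem_add (F G : 𝓢((Fin 2 → E4), ℂ)) : Nsem (F + G) ≤ Nsem F + Nsem G := by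
  simp only [Nsem, SN]
  rw [← mul_add]
  exact mul_le_mul_of_nonneg_left (map_add_le_add _ F G) Cbd_nonneg

/-- The real part of `ℓ` on `⁰𝒮` as a partially defined `ℝ`-linear functional. -/
def ellR : 𝓢((Fin 2 → E4), ℂ) →ₗ.[ℝ] ℝ where
  domain := offDiag.restrictScalars ℝ
  toFun :=
    { toFun := fun F => (ell F.1).re
      map_add' := fun F G => by
        have hF : IsOffDiagonal F.1 := F.2
        have hG : IsOffDiagonal G.1 := G.2
        simp only [Submodule.coe_add, ell_add hF hG, Complex.add_re]
      map_smul' := fun c F => by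
        simp only [Submodule.coe_smul_of_tower, RingHom.id_apply, smul_eq_mul]
        rw [real_smul_eq, ell_smul, Complex.re_ofReal_mul] }

theorem ellR_apply (F : ellR.domain) : ellR F = (ell F.1).re := rfl

/-- A real-linear extension of `re ∘ ℓ` to the whole Schwartz space, dominated by `N`. -/
theorem exists_extension : ∃ g : 𝓢((Fin 2 → E4), ℂ) →ₗ[ℝ] ℝ,
    (∀ F : 𝓢((Fin 2 → E4), ℂ), IsOffDiagonal F → g F = (ell F).re) ∧ ∀ F, g F ≤ Nsem F := by
  obtain ⟨g, hg1, hg2⟩ := exists_extension_of_le_sublinear ellR Nsem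
    (fun c hc F => by rw [real_smul_eq, Nsem_smul, Complex.norm_real, Real.norm_of_nonneg hc.le])
    Nsem_add (fun F => by
      rw [ellR_apply]
      exact (Complex.re_le_norm _).trans (norm_ell_le F.2))
  exact ⟨g, fun F hF => hg1 ⟨F, hF⟩, hg2⟩

/-- The chosen real extension. -/
def gR : 𝓢((Fin 2 → E4), ℂ) →ₗ[ℝ] ℝ := exists_extension.choose

theorem gR_eq {F : 𝓢((Fin 2 → E4), ℂ)} (hF : IsOffDiagonal F) : gR F = (ell F).re :=
  exists_extension.choose_spec.1 F hF

theorem gR_le (F : 𝓢((Fin 2 → E4), ℂ)) : gR F ≤ Nsem F := exists_extension.choose_spec.2 F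

theorem Nsem_neg (F : 𝓢((Fin 2 → E4), ℂ)) : Nsem (-F) = Nsem F := by
  rw [← neg_one_smul ℂ F, Nsem_smul]; simp

theorem abs_gR_le (F : 𝓢((Fin 2 → E4), ℂ)) : |gR F| ≤ Nsem F := by
  refine abs_le.2 ⟨?_, gR_le F⟩
  have h := gR_le (-F)
  rw [map_neg, Nsem_neg] at h
  linarith

/-- The complex-linear extension (algebraic). -/
def Tlin : 𝓢((Fin 2 → E4), ℂ) →ₗ[ℂ] ℂ := Module.Dual.extendRCLike (𝕜 := ℂ) gR

theorem norm_Tlin_le (F : 𝓢((Fin 2 → E4), ℂ)) : ‖Tlin F‖ ≤ Nsem F := by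
  have hsq := Module.Dual.norm_extendRCLike_apply_sq (𝕜 := ℂ) gR F
  have h1 : ‖Tlin F‖ ^ 2 ≤ ‖Tlin F‖ * Nsem F := by
    calc ‖Tlin F‖ ^ 2 = gR ((starRingEnd ℂ) (Tlin F) • F) := hsq
      _ ≤ Nsem ((starRingEnd ℂ) (Tlin F) • F) := gR_le _
      _ = ‖Tlin F‖ * Nsem F := by rw [Nsem_smul, RCLike.norm_conj]
  by_cases h0 : ‖Tlin F‖ = 0
  · rw [h0]; exact mul_nonneg Cbd_nonneg (SN_nonneg _ _ _)
  · have hpos : 0 < ‖Tlin F‖ := lt_of_le_of_ne (norm_nonneg _) (Ne.symm h0)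
    rw [sq] at h1
    exact le_of_mul_le_mul_left h1 hpos

theorem Tlin_eq {F : 𝓢((Fin 2 → E4), ℂ)} (hF : IsOffDiagonal F) : Tlin F = ell F := by
  have hIF : IsOffDiagonal ((RCLike.I : ℂ) • F) := hF.smul _
  rw [Tlin, Module.Dual.extendRCLike_apply, gR_eq hF, gR_eq hIF, ell_smul]
  have hI : (RCLike.I : ℂ) = Complex.I := rfl
  rw [hI]
  apply Complex.ext
  · simp
  · simp

/-- The Schwartz seminorm family, unfolded (syntactic bridge to `SN`). -/
theorem seminormFamily_eq :
    schwartzSeminormFamily ℂ (Fin 2 → E4) ℂ = fun m => SchwartzMap.seminorm ℂ m.1 m.2 := rfl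

/-- Comparison of `SN 9 10` with the `Finset.sup` spelling expected by `mkCLMtoNormedSpace` (the body of
Mathlib's `schwartzSeminormFamily` is not unfolded by the elaborator from here, so we rewrite it first). -/
theorem SN_le_sup (F : 𝓢((Fin 2 → E4), ℂ)) :
    SN 9 10 F ≤ (Finset.Iic ((9 : ℕ), (10 : ℕ))).sup (schwartzSeminormFamily ℂ (Fin 2 → E4) ℂ) F := by
  rw [seminormFamily_eq]

set_option maxRecDepth 20000 in
/-- **The two-point functional** `T`: a continuous linear functional on `𝓢((ℝ⁴)², ℂ)` which on
`⁰𝒮` is integration against the kernel `K(x₀ − x₁)` (a Hahn–Banach extension of `ℓ`; the unification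
of the seminorm bound with `mkCLMtoNormedSpace` unfolds `Finset.Iic (9,10)`, whence the recursion depth). -/
def T : 𝓢((Fin 2 → E4), ℂ) →L[ℂ] ℂ :=
  SchwartzMap.mkCLMtoNormedSpace (𝕜 := ℂ) (σ := RingHom.id ℂ) Tlin (fun F G => map_add Tlin F G)
    (fun c F => by rw [map_smul]; rfl)
    ⟨_, Cbd, Cbd_nonneg, fun F =>
      (norm_Tlin_le F).trans (mul_le_mul_of_nonneg_left (SN_le_sup F) Cbd_nonneg)⟩

theorem T_apply (F : 𝓢((Fin 2 → E4), ℂ)) : T F = Tlin F := rfl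

/-- **Representation on `⁰𝒮`.** -/
theorem T_eq_integral {F : 𝓢((Fin 2 → E4), ℂ)} (hF : IsOffDiagonal F) :
    T F = ∫ x, KC x * F x := by
  rw [T_apply, Tlin_eq hF, ell]

end Extension


/-! ### Stability of `⁰𝒮` and changes of variables -/

section Symmetry

/-- `⁰𝒮` is stable under precomposition with a continuous linear equivalence preserving the
coincidence locus. -/
theorem isOffDiagonal_precomp {F G : 𝓢((Fin 2 → E4), ℂ)} (hF : IsOffDiagonal F)
    (g : (Fin 2 → E4) ≃L[ℝ] (Fin 2 → E4))
    (hg : ∀ x ∈ coincidenceLocus 2 E4, g x ∈ coincidenceLocus 2 E4)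
    (hG : ∀ x, G x = F (g x)) : IsOffDiagonal G := by
  intro x hx k
  have hfun : (G : (Fin 2 → E4) → ℂ) = (F : (Fin 2 → E4) → ℂ) ∘ g := funext hG
  have key := (g : (Fin 2 → E4) →L[ℝ] (Fin 2 → E4)).iteratedFDeriv_comp_right (F.smooth k) x
    (i := k) le_rfl
  simp only [ContinuousLinearEquiv.coe_coe] at key
  rw [hfun, key, hF _ (hg x hx) k]
  ext m
  simp

theorem isOffDiagonal_translateMulti {F : 𝓢((Fin 2 → E4), ℂ)} (hF : IsOffDiagonal F) (a : E4) :
    IsOffDiagonal (translateMulti a F) := by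
  intro x hx k
  have hfun : ((translateMulti a F : 𝓢((Fin 2 → E4), ℂ)) : (Fin 2 → E4) → ℂ) =
      fun y => F (y + fun _ => -a) := by
    funext y
    rw [translateMulti_apply]
    congr 1
  rw [hfun, iteratedFDeriv_comp_add_right' k]
  have hmem : (x + fun _ => -a) ∈ coincidenceLocus 2 E4 := by
    obtain ⟨i, j, hij, hxij⟩ := hx
    exact ⟨i, j, hij, by simp [hxij]⟩
  exact hF _ hmem k

theorem isOffDiagonal_linActMulti {F : 𝓢((Fin 2 → E4), ℂ)} (hF : IsOffDiagonal F)
    (R : E4 ≃ₗᵢ[ℝ] E4) : IsOffDiagonal (linActMulti R F) :=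
  isOffDiagonal_precomp hF
    (ContinuousLinearEquiv.piCongrRight fun _ : Fin 2 => R.symm.toContinuousLinearEquiv)
    (fun x hx => by
      obtain ⟨i, j, hij, hxij⟩ := hx
      exact ⟨i, j, hij, by simp [hxij]⟩)
    (fun x => rfl)

/-- The coordinate permutation `x ↦ x ∘ σ` as a continuous linear equivalence. -/
def permCLE (σ : Equiv.Perm (Fin 2)) : (Fin 2 → E4) ≃L[ℝ] (Fin 2 → E4) :=
  (LinearEquiv.funCongrLeft ℝ E4 σ).toContinuousLinearEquiv

theorem permCLE_apply (σ : Equiv.Perm (Fin 2)) (x : Fin 2 → E4) : permCLE σ x = x ∘ σ := rfl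

theorem isOffDiagonal_permTest {F : 𝓢((Fin 2 → E4), ℂ)} (hF : IsOffDiagonal F)
    (σ : Equiv.Perm (Fin 2)) : IsOffDiagonal (permTest σ F) :=
  isOffDiagonal_precomp hF (permCLE σ)
    (fun x hx => by
      obtain ⟨i, j, hij, hxij⟩ := hx
      refine ⟨σ.symm i, σ.symm j, fun h => hij (σ.symm.injective h), ?_⟩
      simp [permCLE_apply, hxij])
    (fun x => by rw [permTest_apply, permCLE_apply])

/-- Pointwise complex conjugation preserves `⁰𝒮`. -/
theorem isOffDiagonal_starTest {F : 𝓢((Fin 2 → E4), ℂ)} (hF : IsOffDiagonal F) :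
    IsOffDiagonal (starTest F) := by
  intro x hx k
  have hfun : ((starTest F : 𝓢((Fin 2 → E4), ℂ)) : (Fin 2 → E4) → ℂ) =
      (Complex.conjCLE : ℂ →L[ℝ] ℂ) ∘ (F : (Fin 2 → E4) → ℂ) := by
    funext y; simp
  rw [hfun, (Complex.conjCLE : ℂ →L[ℝ] ℂ).iteratedFDeriv_comp_left (F.smooth k).contDiffAt
    (i := k) le_rfl, hF x hx k]
  ext m
  simp

theorem isOffDiagonal_osAdjoint {F : 𝓢((Fin 2 → E4), ℂ)} (hF : IsOffDiagonal F) :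
    IsOffDiagonal (osAdjoint F) :=
  isOffDiagonal_starTest (isOffDiagonal_linActMulti (isOffDiagonal_permTest hF _) _)

/-- Change of variables under the diagonal action of a linear isometry. -/
theorem integral_comp_isometry (R : E4 ≃ₗᵢ[ℝ] E4) (G : (Fin 2 → E4) → ℂ) :
    ∫ x : Fin 2 → E4, G (fun i => R (x i)) = ∫ x, G x := by
  have h : MeasurePreserving (fun (x : Fin 2 → E4) (i : Fin 2) => R (x i)) :=
    volume_preserving_pi fun _ => R.measurePreserving
  let e : (Fin 2 → E4) ≃ᵐ (Fin 2 → E4) :=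
    MeasurableEquiv.piCongrRight fun _ => R.toHomeomorph.toMeasurableEquiv
  have he : (e : (Fin 2 → E4) → (Fin 2 → E4)) = fun x i => R (x i) := rfl
  have h' : MeasurePreserving e := by rw [he]; exact h
  exact h'.integral_comp' G

/-- Change of variables under a permutation of the two points. -/
theorem integral_comp_perm (σ : Equiv.Perm (Fin 2)) (G : (Fin 2 → E4) → ℂ) :
    ∫ x : Fin 2 → E4, G (x ∘ σ) = ∫ x, G x := by
  have h := volume_measurePreserving_piCongrLeft (fun _ : Fin 2 => E4) σ.symm
  have he : ∀ x : Fin 2 → E4, (MeasurableEquiv.piCongrLeft (fun _ : Fin 2 => E4) σ.symm) x = x ∘ σ := by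
    intro x; funext i
    simp [MeasurableEquiv.coe_piCongrLeft, Equiv.piCongrLeft_apply_eq_cast]
  have := h.integral_comp' G
  simpa only [he] using this

end Symmetry

/-! ### The package of `T` on `⁰𝒮`: translations, signed permutations, swap symmetry, hermiticity -/

section Package

theorem T_translateMulti (a : E4) {F : 𝓢((Fin 2 → E4), ℂ)} (hF : IsOffDiagonal F) :
    T (translateMulti a F) = T F := by
  rw [T_eq_integral (isOffDiagonal_translateMulti hF a), T_eq_integral hF]
  have h := integral_sub_right_eq_self (μ := volume) (fun x : Fin 2 → E4 => KC x * F x) (fun _ => a)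
  refine Eq.trans (integral_congr_ae (ae_of_all _ fun x => ?_)) h
  simp only [translateMulti_apply, KC_apply, Pi.sub_apply, sub_sub_sub_cancel_right]
  rfl

/-- A signed permutation of the coordinates (`R e_i = ± e_j` for all `i`) preserves the `ℓ¹` norm. -/
theorem l1_signedPerm (R : E4 ≃ₗᵢ[ℝ] E4)
    (hR : ∀ i : Fin 4, ∃ j : Fin 4, R (EuclideanSpace.single i 1) = EuclideanSpace.single j 1 ∨
      R (EuclideanSpace.single i 1) = -EuclideanSpace.single j 1) (x : E4) :
    l1 (R x) = l1 x := by
  classical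
  choose σ hσ using hR
  have hε : ∀ i, ∃ ε : ℝ, (ε = 1 ∨ ε = -1) ∧
      R (EuclideanSpace.single i 1) = ε • EuclideanSpace.single (σ i) 1 := by
    intro i
    rcases hσ i with h | h
    · exact ⟨1, Or.inl rfl, by rw [h, one_smul]⟩
    · exact ⟨-1, Or.inr rfl, by rw [h, neg_one_smul]⟩
  choose ε hε1 hεR using hε
  have hεsq : ∀ i, ε i * ε i = 1 := fun i => by rcases hε1 i with h | h <;> simp [h]
  have hεabs : ∀ i, |ε i| = 1 := fun i => by rcases hε1 i with h | h <;> simp [h]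
  -- coordinates as inner products with the standard basis
  have hcoord : ∀ (v : E4) (j : Fin 4), v j = inner ℝ v (EuclideanSpace.single j (1 : ℝ)) := by
    intro v j
    rw [EuclideanSpace.inner_single_right]
    simp
  -- σ is injective, hence bijective
  have hσinj : Function.Injective σ := by
    intro i i' h
    by_contra hne
    have h2 : R (EuclideanSpace.single i' 1) = ε i' • EuclideanSpace.single (σ i) 1 := by
      rw [hεR i', h]
    have key : R ((ε i * ε i') • EuclideanSpace.single i' 1 - EuclideanSpace.single i 1) = 0 := by
      rw [map_sub, map_smul, hεR i, h2, smul_smul, mul_assoc, hεsq i', mul_one, sub_self]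
    have key2 : ((ε i * ε i') • EuclideanSpace.single i' (1 : ℝ) - EuclideanSpace.single i 1 : E4) = 0 :=
      R.injective (by rw [key, map_zero])
    have h3 := congrArg (fun v : E4 => v i) key2
    simp [hne] at h3
  have hσbij : Function.Bijective σ := Finite.injective_iff_bijective.1 hσinj
  set e : Fin 4 ≃ Fin 4 := Equiv.ofBijective σ hσbij with he
  -- R⁻¹ e_{σ i} = ε_i e_i
  have hsymm : ∀ i, R.symm (EuclideanSpace.single (σ i) 1) = ε i • EuclideanSpace.single i 1 := by
    intro i
    apply R.injective
    rw [LinearIsometryEquiv.apply_symm_apply, map_smul, hεR i, smul_smul, hεsq i, one_smul]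
  -- the coordinates of R x
  have hRx : ∀ i, R x (σ i) = ε i * x i := by
    intro i
    rw [hcoord (R x) (σ i), ← LinearIsometryEquiv.inner_map_map R.symm (R x),
      LinearIsometryEquiv.symm_apply_apply, hsymm i, inner_smul_right, ← hcoord x i]
  calc l1 (R x) = ∑ j, |R x j| := rfl
    _ = ∑ i, |R x (e i)| := (Equiv.sum_comp e (fun j => |R x j|)).symm
    _ = ∑ i, |x i| := by
        refine Finset.sum_congr rfl fun i _ => ?_
        rw [show e i = σ i from rfl, hRx i, abs_mul, hεabs i, one_mul]
    _ = l1 x := rfl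

theorem Kw_signedPerm (R : E4 ≃ₗᵢ[ℝ] E4)
    (hR : ∀ i : Fin 4, ∃ j : Fin 4, R (EuclideanSpace.single i 1) = EuclideanSpace.single j 1 ∨
      R (EuclideanSpace.single i 1) = -EuclideanSpace.single j 1) (x : E4) :
    Kw (R x) = Kw x := by
  rw [Kw, l1_signedPerm R hR, Kw]

theorem T_linActMulti (R : E4 ≃ₗᵢ[ℝ] E4)
    (hR : ∀ i : Fin 4, ∃ j : Fin 4, R (EuclideanSpace.single i 1) = EuclideanSpace.single j 1 ∨
      R (EuclideanSpace.single i 1) = -EuclideanSpace.single j 1)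
    {F : 𝓢((Fin 2 → E4), ℂ)} (hF : IsOffDiagonal F) :
    T (linActMulti R F) = T F := by
  rw [T_eq_integral (isOffDiagonal_linActMulti hF R), T_eq_integral hF,
    ← integral_comp_isometry R (fun x => KC x * linActMulti R F x)]
  refine integral_congr_ae (ae_of_all _ fun x => ?_)
  simp only [linActMulti_apply, KC_apply, LinearIsometryEquiv.symm_apply_apply, ← map_sub,
    Kw_signedPerm R hR]

/-- Swap symmetry (the `n = 2` content of E3). -/
theorem T_permTest_swap {F : 𝓢((Fin 2 → E4), ℂ)} (hF : IsOffDiagonal F) :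
    T (permTest (Equiv.swap 0 1) F) = T F := by
  rw [T_eq_integral (isOffDiagonal_permTest hF _), T_eq_integral hF,
    ← integral_comp_perm (Equiv.swap 0 1) (fun x => KC x * permTest (Equiv.swap 0 1) F x)]
  refine integral_congr_ae (ae_of_all _ fun x => ?_)
  have hswap : (x ∘ Equiv.swap 0 1) ∘ Equiv.swap 0 1 = x := by
    funext i; simp [Function.comp_apply, Equiv.swap_apply_self]
  simp only [permTest_apply, KC_apply, hswap, Function.comp_apply, Equiv.swap_apply_left,
    Equiv.swap_apply_right, ← Kw_neg (x 1 - x 0), neg_sub]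

/-- `θ e₀ = -e₀`. -/
theorem timeReflection_single_zero :
    timeReflection 4 (EuclideanSpace.single 0 (1 : ℝ)) = -EuclideanSpace.single 0 1 := by
  ext j
  by_cases hj : j = 0
  · subst hj; simp [timeReflection_apply]
  · simp [timeReflection_apply, hj]

/-- `θ e_i = e_i` for `i ≠ 0`. -/
theorem timeReflection_single_ne {i : Fin 4} (hi : i ≠ 0) :
    timeReflection 4 (EuclideanSpace.single i (1 : ℝ)) = EuclideanSpace.single i 1 := by
  ext j
  by_cases hj : j = 0
  · subst hj; simp [timeReflection_apply, Ne.symm hi]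
  · simp [timeReflection_apply, hj]

/-- Time reflection is a signed permutation. -/
theorem timeReflection_signedPerm : ∀ i : Fin 4, ∃ j : Fin 4,
    timeReflection 4 (EuclideanSpace.single i 1) = EuclideanSpace.single j 1 ∨
      timeReflection 4 (EuclideanSpace.single i 1) = -EuclideanSpace.single j 1 := by
  intro i
  refine ⟨i, ?_⟩
  by_cases hi : i = 0
  · right; subst hi; exact timeReflection_single_zero
  · left; exact timeReflection_single_ne hi

theorem Kw_timeReflection (w : E4) : Kw (timeReflection 4 w) = Kw w :=
  Kw_signedPerm _ timeReflection_signedPerm w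

theorem comp_rev_eq_comp_swap (x : Fin 2 → E4) :
    (fun i => x (Fin.rev i)) = x ∘ Equiv.swap 0 1 := by
  funext i
  fin_cases i <;> rfl

/-- Hermiticity shadow (E0): `T F = conj T(ΘF*)` on `⁰𝒮` (in particular on time-ordered `F`). -/
theorem T_hermitian {F : 𝓢((Fin 2 → E4), ℂ)} (hF : IsOffDiagonal F) :
    T F = (starRingEnd ℂ) (T (osAdjoint F)) := by
  rw [T_eq_integral (isOffDiagonal_osAdjoint hF), T_eq_integral hF, ← integral_conj]
  have hint : ∀ x : Fin 2 → E4, (starRingEnd ℂ) (KC x * osAdjoint F x) =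
      KC x * F (fun i => timeReflection 4 (x (Fin.rev i))) := by
    intro x
    simp [osAdjoint_apply, KC_apply, Complex.conj_ofReal]
  simp_rw [hint]
  -- step 1: substitute `x ↦ θ ∘ x`
  rw [← integral_comp_isometry (timeReflection 4)
    (fun x : Fin 2 → E4 => KC x * F (fun i => timeReflection 4 (x (Fin.rev i))))]
  have h2 : ∀ x : Fin 2 → E4, KC (fun i => timeReflection 4 (x i)) *
      F (fun i => timeReflection 4 (timeReflection 4 (x (Fin.rev i)))) =
        KC x * F (x ∘ Equiv.swap 0 1) := by
    intro x
    simp only [KC_apply, timeReflection_timeReflection, ← map_sub, Kw_timeReflection,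
      ← comp_rev_eq_comp_swap]
  simp_rw [h2]
  -- step 2: substitute `x ↦ x ∘ swap`
  have h3 := integral_comp_perm (Equiv.swap 0 1)
    (fun x : Fin 2 → E4 => KC (x ∘ Equiv.swap 0 1) * F x)
  have h4 : ∀ x : Fin 2 → E4, (x ∘ Equiv.swap 0 1) ∘ Equiv.swap 0 1 = x := by
    intro x; funext i; simp
  simp only [h4] at h3
  rw [h3]
  refine integral_congr_ae (ae_of_all _ fun x => ?_)
  simp only [KC_apply, Function.comp_apply, Equiv.swap_apply_left, Equiv.swap_apply_right]
  rw [← Kw_neg, neg_sub]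

end Package




/-! ### Reflection positivity of `T`, I: the sum-of-squares representation of `K(θa − b)` -/

section RPKernel

/-- The one-dimensional "square root" `kk λ p s = 1_{s ≤ p} e^{-λ(p−s)}` of the exponential kernel:
`e^{-λ|p−q|} = 2λ ∫ kk λ p s · kk λ q s ds`. -/
def kk (lam p s : ℝ) : ℝ := (Iic p).indicator (fun s => exp (-(lam * (p - s)))) s

theorem kk_nonneg (lam p s : ℝ) : 0 ≤ kk lam p s := by
  unfold kk; exact Set.indicator_nonneg (fun _ _ => (exp_pos _).le) _

theorem kk_mul_kk (lam p q s : ℝ) :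
    kk lam p s * kk lam q s =
      (Iic (min p q)).indicator (fun s => exp (-(lam * (p + q)) + 2 * lam * s)) s := by
  unfold kk
  by_cases hp : s ≤ p <;> by_cases hq : s ≤ q
  · rw [indicator_of_mem (mem_Iic.2 hp), indicator_of_mem (mem_Iic.2 hq),
      indicator_of_mem (mem_Iic.2 (le_min hp hq)), ← Real.exp_add]
    congr 1; ring
  · rw [indicator_of_notMem (fun h => hq (mem_Iic.1 h)), mul_zero,
      indicator_of_notMem (fun h => hq ((mem_Iic.1 h).trans (min_le_right _ _)))]
  · rw [indicator_of_notMem (fun h => hp (mem_Iic.1 h)), zero_mul,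
      indicator_of_notMem (fun h => hp ((mem_Iic.1 h).trans (min_le_left _ _)))]
  · rw [indicator_of_notMem (fun h => hp (mem_Iic.1 h)), zero_mul,
      indicator_of_notMem (fun h => hp ((mem_Iic.1 h).trans (min_le_left _ _)))]

theorem measurable_kk_uncurry (lam : ℝ) : Measurable fun z : ℝ × ℝ => kk lam z.1 z.2 := by
  unfold kk
  have hset : MeasurableSet {z : ℝ × ℝ | z.2 ≤ z.1} :=
    measurableSet_le measurable_snd measurable_fst
  have : (fun z : ℝ × ℝ => (Iic z.1).indicator (fun s => exp (-(lam * (z.1 - s)))) z.2) =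
      {z : ℝ × ℝ | z.2 ≤ z.1}.indicator (fun z => exp (-(lam * (z.1 - z.2)))) := by
    funext z
    by_cases h : z.2 ≤ z.1
    · rw [indicator_of_mem (mem_Iic.2 h), indicator_of_mem (show z ∈ {z : ℝ × ℝ | z.2 ≤ z.1} from h)]
    · rw [indicator_of_notMem (fun h' => h (mem_Iic.1 h')),
        indicator_of_notMem (show z ∉ {z : ℝ × ℝ | z.2 ≤ z.1} from h)]
  rw [this]
  exact Measurable.indicator (by fun_prop) hset

theorem measurable_kk (lam p : ℝ) : Measurable (kk lam p) :=
  (measurable_kk_uncurry lam).comp (measurable_const.prodMk measurable_id)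

/-- `∫ kk λ p · kk λ q = e^{-λ|p−q|} / (2λ)`. -/
theorem integral_kk_mul_kk {lam : ℝ} (hlam : 0 < lam) (p q : ℝ) :
    ∫ s, kk lam p s * kk lam q s = exp (-(lam * |p - q|)) / (2 * lam) := by
  simp_rw [kk_mul_kk]
  rw [integral_indicator measurableSet_Iic]
  have h2 : (0 : ℝ) < 2 * lam := by linarith
  have : ∫ s in Iic (min p q), exp (-(lam * (p + q)) + 2 * lam * s) =
      exp (-(lam * (p + q))) * ∫ s in Iic (min p q), exp (2 * lam * s) := by
    rw [← integral_const_mul]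
    refine setIntegral_congr_fun measurableSet_Iic fun s _ => ?_
    rw [Real.exp_add]
  rw [this, integral_exp_mul_Iic h2, ← mul_div_assoc, ← Real.exp_add]
  congr 1
  rcases le_total p q with h | h
  · rw [min_eq_left h, abs_of_nonpos (by linarith)]; ring_nf
  · rw [min_eq_right h, abs_of_nonneg (by linarith)]; ring_nf

theorem integrable_kk_mul_kk {lam : ℝ} (hlam : 0 < lam) (p q : ℝ) :
    Integrable fun s => kk lam p s * kk lam q s := by
  simp_rw [kk_mul_kk]
  rw [integrable_indicator_iff measurableSet_Iic]
  have h2 : (0 : ℝ) < 2 * lam := by linarith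
  have h3 : IntegrableOn (fun s => exp (-(lam * (p + q))) * exp (2 * lam * s)) (Iic (min p q)) :=
    (integrableOn_exp_mul_Iic h2 (min p q)).const_mul (exp (-(lam * (p + q))))
  exact IntegrableOn.congr_fun h3 (fun s _ => by rw [Real.exp_add]) measurableSet_Iic

/-- The spatial factor `sp λ s a = ∏_{k=1}^{3} kk λ (a_k) (s_{k-1})`. -/
def sp (lam : ℝ) (s : Fin 3 → ℝ) (a : E4) : ℝ := ∏ k : Fin 3, kk lam (a k.succ) (s k)

theorem sp_nonneg (lam : ℝ) (s : Fin 3 → ℝ) (a : E4) : 0 ≤ sp lam s a :=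
  Finset.prod_nonneg fun _ _ => kk_nonneg _ _ _

theorem sp_mul_sp (lam : ℝ) (s : Fin 3 → ℝ) (a b : E4) :
    sp lam s a * sp lam s b = ∏ k : Fin 3, (kk lam (a k.succ) (s k) * kk lam (b k.succ) (s k)) := by
  rw [sp, sp, ← Finset.prod_mul_distrib]

theorem integral_sp_mul_sp {lam : ℝ} (hlam : 0 < lam) (a b : E4) :
    ∫ s : Fin 3 → ℝ, sp lam s a * sp lam s b =
      ∏ k : Fin 3, (exp (-(lam * |a k.succ - b k.succ|)) / (2 * lam)) := by
  simp_rw [sp_mul_sp]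
  rw [integral_fintype_prod_volume_eq_prod
    (fun (k : Fin 3) (t : ℝ) => kk lam (a k.succ) t * kk lam (b k.succ) t)]
  exact Finset.prod_congr rfl fun k _ => integral_kk_mul_kk hlam _ _

theorem integrable_sp_mul_sp {lam : ℝ} (hlam : 0 < lam) (a b : E4) :
    Integrable fun s : Fin 3 → ℝ => sp lam s a * sp lam s b := by
  simp_rw [sp_mul_sp]
  exact Integrable.fintype_prod (f := fun (k : Fin 3) (t : ℝ) => kk lam (a k.succ) t * kk lam (b k.succ) t)
    (fun k => integrable_kk_mul_kk hlam _ _)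

/-- Parameter space `Ω = ℝ × ℝ³` (`λ` and the three spatial square-root variables). -/
abbrev Ω : Type := ℝ × (Fin 3 → ℝ)

/-- The weight `w(λ) = 1_{λ>1} λ⁹ (2λ)³`. -/
def wt' (lam : ℝ) : ℝ := (Ioi (1 : ℝ)).indicator (fun lam => lam ^ 9 * (2 * lam) ^ 3) lam

theorem wt'_nonneg (lam : ℝ) : 0 ≤ wt' lam := by
  unfold wt'
  refine Set.indicator_nonneg (fun t ht => ?_) _
  have : (0 : ℝ) < t := zero_lt_one.trans ht
  positivity

theorem wt'_of_mem {lam : ℝ} (h : 1 < lam) : wt' lam = lam ^ 9 * (2 * lam) ^ 3 := by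
  unfold wt'; rw [indicator_of_mem (mem_Ioi.2 h)]

theorem wt'_of_not_mem {lam : ℝ} (h : ¬ 1 < lam) : wt' lam = 0 := by
  unfold wt'; rw [indicator_of_notMem (fun h' => h (mem_Ioi.1 h'))]

theorem measurable_wt' : Measurable wt' := by
  unfold wt'; exact Measurable.indicator (by fun_prop) measurableSet_Ioi

/-- `ψ_ω(a) = e^{-λ a⁰} sp λ s a`. -/
def psi (ω : Ω) (a : E4) : ℝ := exp (-(ω.1 * a 0)) * sp ω.1 ω.2 a

theorem psi_nonneg (ω : Ω) (a : E4) : 0 ≤ psi ω a := mul_nonneg (exp_pos _).le (sp_nonneg _ _ _)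

/-- `ℓ¹(θa − b) = (a⁰ + b⁰) + Σ_{k≥1} |a_k − b_k|` for `a⁰, b⁰ > 0`. -/
theorem l1_theta_sub {a b : E4} (ha : 0 < a 0) (hb : 0 < b 0) :
    l1 (timeReflection 4 a - b) = (a 0 + b 0) + ∑ k : Fin 3, |a k.succ - b k.succ| := by
  have h0 : (timeReflection 4 a - b) 0 = -a 0 - b 0 := by simp [timeReflection_apply]
  have hk : ∀ k : Fin 3, (timeReflection 4 a - b) k.succ = a k.succ - b k.succ := fun k => by
    simp [timeReflection_apply, Fin.succ_ne_zero]
  rw [l1, Fin.sum_univ_succ, h0, abs_of_nonpos (by linarith)]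
  simp only [hk]
  ring

/-- For `λ > 1` and `a⁰, b⁰ > 0`: `∫_s w(λ) ψ(a) ψ(b) ds = λ⁹ e^{-λ ℓ¹(θa−b)}`. -/
theorem integral_s_wpsi {lam : ℝ} (hlam : 1 < lam) {a b : E4} (ha : 0 < a 0) (hb : 0 < b 0) :
    ∫ s : Fin 3 → ℝ, wt' lam * (psi (lam, s) a * psi (lam, s) b) =
      kint (l1 (timeReflection 4 a - b)) lam := by
  have hlam0 : 0 < lam := zero_lt_one.trans hlam
  have hfun : ∀ s : Fin 3 → ℝ, wt' lam * (psi (lam, s) a * psi (lam, s) b) =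
      (wt' lam * (exp (-(lam * a 0)) * exp (-(lam * b 0)))) * (sp lam s a * sp lam s b) := by
    intro s; simp only [psi]; ring
  simp_rw [hfun]
  rw [integral_const_mul, integral_sp_mul_sp hlam0, wt'_of_mem hlam, l1_theta_sub ha hb, kint]
  have hprod : ∏ k : Fin 3, (exp (-(lam * |a k.succ - b k.succ|)) / (2 * lam)) =
      exp (∑ k : Fin 3, -(lam * |a k.succ - b k.succ|)) / (2 * lam) ^ 3 := by
    rw [Finset.prod_div_distrib, Finset.prod_const, Finset.card_univ, Fintype.card_fin, Real.exp_sum]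
  rw [hprod]
  have h2 : (2 * lam) ^ 3 ≠ 0 := by positivity
  calc lam ^ 9 * (2 * lam) ^ 3 * (exp (-(lam * a 0)) * exp (-(lam * b 0))) *
        (exp (∑ k : Fin 3, -(lam * |a k.succ - b k.succ|)) / (2 * lam) ^ 3)
      = lam ^ 9 * (exp (-(lam * a 0)) * exp (-(lam * b 0)) *
          exp (∑ k : Fin 3, -(lam * |a k.succ - b k.succ|))) * ((2 * lam) ^ 3 / (2 * lam) ^ 3) := by
        ring
    _ = lam ^ 9 * exp (-((a 0 + b 0 + ∑ k : Fin 3, |a k.succ - b k.succ|) * lam)) := by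
        rw [div_self h2, mul_one, ← Real.exp_add, ← Real.exp_add]
        congr 1
        rw [Finset.sum_neg_distrib, ← Finset.mul_sum]
        ring

theorem integrable_s_wpsi {lam : ℝ} (a b : E4) :
    Integrable fun s : Fin 3 → ℝ => wt' lam * (psi (lam, s) a * psi (lam, s) b) := by
  by_cases hlam : 1 < lam
  · have hlam0 : 0 < lam := zero_lt_one.trans hlam
    have hfun : ∀ s : Fin 3 → ℝ, wt' lam * (psi (lam, s) a * psi (lam, s) b) =
        (wt' lam * (exp (-(lam * a 0)) * exp (-(lam * b 0)))) * (sp lam s a * sp lam s b) := by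
      intro s; simp only [psi]; ring
    simp_rw [hfun]
    exact (integrable_sp_mul_sp hlam0 a b).const_mul _
  · simp_rw [wt'_of_not_mem hlam, zero_mul]
    exact integrable_zero _ _ _

theorem measurable_psi_uncurry : Measurable fun z : Ω × E4 => psi z.1 z.2 := by
  unfold psi sp
  refine Measurable.mul (by fun_prop) ?_
  refine Finset.measurable_prod _ fun k _ => ?_
  have h1 : Measurable fun z : Ω × E4 => (z.2 k.succ, z.1.2 k) := by fun_prop
  -- kk lam p s with lam = z.1.1, p = z.2 k.succ, s = z.1.2 k
  have h3 : Measurable fun q : ℝ × (ℝ × ℝ) => kk q.1 q.2.1 q.2.2 := by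
    unfold kk
    have hset : MeasurableSet {q : ℝ × (ℝ × ℝ) | q.2.2 ≤ q.2.1} :=
      measurableSet_le (measurable_snd.comp measurable_snd) (measurable_fst.comp measurable_snd)
    have : (fun q : ℝ × (ℝ × ℝ) => (Iic q.2.1).indicator (fun s => exp (-(q.1 * (q.2.1 - s)))) q.2.2) =
        {q : ℝ × (ℝ × ℝ) | q.2.2 ≤ q.2.1}.indicator (fun q => exp (-(q.1 * (q.2.1 - q.2.2)))) := by
      funext q
      by_cases h : q.2.2 ≤ q.2.1
      · rw [indicator_of_mem (mem_Iic.2 h),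
          indicator_of_mem (show q ∈ {q : ℝ × (ℝ × ℝ) | q.2.2 ≤ q.2.1} from h)]
      · rw [indicator_of_notMem (fun h' => h (mem_Iic.1 h')),
          indicator_of_notMem (show q ∉ {q : ℝ × (ℝ × ℝ) | q.2.2 ≤ q.2.1} from h)]
    rw [this]
    exact Measurable.indicator (by fun_prop) hset
  exact h3.comp (by fun_prop : Measurable fun z : Ω × E4 => (z.1.1, (z.2 k.succ, z.1.2 k)))

theorem measurable_psi_left (a : E4) : Measurable fun ω : Ω => psi ω a :=
  measurable_psi_uncurry.comp (measurable_id.prodMk measurable_const)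

/-- **Sum of squares.** For `a⁰, b⁰ > 0`: `K(θa − b) = ∫_Ω w ψ_ω(a) ψ_ω(b) dω`. -/
theorem integral_w_psi_psi {a b : E4} (ha : 0 < a 0) (hb : 0 < b 0) :
    ∫ ω : Ω, wt' ω.1 * (psi ω a * psi ω b) = Kw (timeReflection 4 a - b) := by
  set L := l1 (timeReflection 4 a - b) with hL
  have hLpos : 0 < L := by
    rw [hL, l1_theta_sub ha hb]
    have : 0 ≤ ∑ k : Fin 3, |a k.succ - b k.succ| := Finset.sum_nonneg fun _ _ => abs_nonneg _
    linarith
  have hint : Integrable (fun ω : Ω => wt' ω.1 * (psi ω a * psi ω b)) (volume.prod volume) := by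
    rw [integrable_prod_iff]
    · refine ⟨ae_of_all _ fun lam => integrable_s_wpsi a b, ?_⟩
      have hnorm : ∀ lam : ℝ, ∫ s : Fin 3 → ℝ, ‖wt' lam * (psi (lam, s) a * psi (lam, s) b)‖ =
          (Ioi (1 : ℝ)).indicator (kint L) lam := by
        intro lam
        have : ∀ s : Fin 3 → ℝ, ‖wt' lam * (psi (lam, s) a * psi (lam, s) b)‖ =
            wt' lam * (psi (lam, s) a * psi (lam, s) b) := fun s =>
          Real.norm_of_nonneg (mul_nonneg (wt'_nonneg _) (mul_nonneg (psi_nonneg _ _) (psi_nonneg _ _)))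
        simp_rw [this]
        by_cases hlam : 1 < lam
        · rw [integral_s_wpsi hlam ha hb, indicator_of_mem (mem_Ioi.2 hlam)]
        · simp_rw [wt'_of_not_mem hlam, zero_mul, integral_zero]
          rw [indicator_of_notMem (fun h => hlam (mem_Ioi.1 h))]
      simp_rw [hnorm]
      exact (integrable_indicator_iff measurableSet_Ioi).2 (integrableOn_kint hLpos)
    · exact ((measurable_wt'.comp measurable_fst).mul
        ((measurable_psi_left a).mul (measurable_psi_left b))).aestronglyMeasurable
  rw [show (volume : Measure Ω) = volume.prod volume from rfl, integral_prod _ hint]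
  have hinner : ∀ lam : ℝ, ∫ s : Fin 3 → ℝ, wt' lam * (psi (lam, s) a * psi (lam, s) b) =
      (Ioi (1 : ℝ)).indicator (kint L) lam := by
    intro lam
    by_cases hlam : 1 < lam
    · rw [integral_s_wpsi hlam ha hb, indicator_of_mem (mem_Ioi.2 hlam)]
    · simp_rw [wt'_of_not_mem hlam, zero_mul, integral_zero]
      rw [indicator_of_notMem (fun h => hlam (mem_Ioi.1 h))]
  simp_rw [show ∀ lam : ℝ, (∫ s : Fin 3 → ℝ, wt' (lam, s).1 * (psi (lam, s) a * psi (lam, s) b)) =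
    (Ioi (1 : ℝ)).indicator (kint L) lam from hinner]
  rw [integral_indicator measurableSet_Ioi]
  rfl

/-- Integrability of `ω ↦ w ψ_ω(a) ψ_ω(b)` for `a⁰, b⁰ > 0`. -/
theorem integrable_w_psi_psi {a b : E4} (ha : 0 < a 0) (hb : 0 < b 0) :
    Integrable (fun ω : Ω => wt' ω.1 * (psi ω a * psi ω b)) := by
  set L := l1 (timeReflection 4 a - b) with hL
  have hLpos : 0 < L := by
    rw [hL, l1_theta_sub ha hb]
    have : 0 ≤ ∑ k : Fin 3, |a k.succ - b k.succ| := Finset.sum_nonneg fun _ _ => abs_nonneg _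
    linarith
  rw [show (volume : Measure Ω) = volume.prod volume from rfl, integrable_prod_iff]
  · refine ⟨ae_of_all _ fun lam => integrable_s_wpsi a b, ?_⟩
    have hnorm : ∀ lam : ℝ, ∫ s : Fin 3 → ℝ, ‖wt' lam * (psi (lam, s) a * psi (lam, s) b)‖ =
        (Ioi (1 : ℝ)).indicator (kint L) lam := by
      intro lam
      have : ∀ s : Fin 3 → ℝ, ‖wt' lam * (psi (lam, s) a * psi (lam, s) b)‖ =
          wt' lam * (psi (lam, s) a * psi (lam, s) b) := fun s =>
        Real.norm_of_nonneg (mul_nonneg (wt'_nonneg _) (mul_nonneg (psi_nonneg _ _) (psi_nonneg _ _)))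
      simp_rw [this]
      by_cases hlam : 1 < lam
      · rw [integral_s_wpsi hlam ha hb, indicator_of_mem (mem_Ioi.2 hlam)]
      · simp_rw [wt'_of_not_mem hlam, zero_mul, integral_zero]
        rw [indicator_of_notMem (fun h => hlam (mem_Ioi.1 h))]
    simp_rw [hnorm]
    exact (integrable_indicator_iff measurableSet_Ioi).2 (integrableOn_kint hLpos)
  · exact ((measurable_wt'.comp measurable_fst).mul
      ((measurable_psi_left a).mul (measurable_psi_left b))).aestronglyMeasurable

end RPKernel


/-! ### Reflection positivity of `T`, II: the OS form is an integral of squares -/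

section RPCore

/-- Change of variables under a coordinatewise family of linear isometries. -/
theorem integral_comp_isometry₂ (R : Fin 2 → (E4 ≃ₗᵢ[ℝ] E4)) (G : (Fin 2 → E4) → ℂ) :
    ∫ x : Fin 2 → E4, G (fun i => R i (x i)) = ∫ x, G x := by
  have h : MeasurePreserving (fun (x : Fin 2 → E4) (i : Fin 2) => R i (x i)) :=
    volume_preserving_pi fun i => (R i).measurePreserving
  let e : (Fin 2 → E4) ≃ᵐ (Fin 2 → E4) :=
    MeasurableEquiv.piCongrRight fun i => (R i).toHomeomorph.toMeasurableEquiv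
  have he : (e : (Fin 2 → E4) → (Fin 2 → E4)) = fun x i => R i (x i) := rfl
  have h' : MeasurePreserving e := by rw [he]; exact h
  exact h'.integral_comp' G

theorem integrable_comp_isometry₂ (R : Fin 2 → (E4 ≃ₗᵢ[ℝ] E4)) {G : (Fin 2 → E4) → ℂ}
    (hG : Integrable G) : Integrable fun x : Fin 2 → E4 => G (fun i => R i (x i)) := by
  have h : MeasurePreserving (fun (x : Fin 2 → E4) (i : Fin 2) => R i (x i)) :=
    volume_preserving_pi fun i => (R i).measurePreserving
  exact (h.integrable_comp hG.aestronglyMeasurable).2 hG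

/-- The reflection acting on the first point only. -/
def Rθ : Fin 2 → (E4 ≃ₗᵢ[ℝ] E4) := ![timeReflection 4, LinearIsometryEquiv.refl ℝ E4]

@[simp] theorem Rθ_zero (a : E4) : Rθ 0 a = timeReflection 4 a := rfl
@[simp] theorem Rθ_one (a : E4) : Rθ 1 a = a := rfl

/-- The joint integrand `Φ(u, ω) = w(λ) (ψ_ω(u₀) conj g(u₀)) (ψ_ω(u₁) g(u₁))`. -/
def Φ (g : 𝓢(E4, ℂ)) (u : Fin 2 → E4) (ω : Ω) : ℂ :=
  (wt' ω.1 : ℂ) * (((psi ω (u 0) : ℂ) * (starRingEnd ℂ) (g (u 0))) * ((psi ω (u 1) : ℂ) * g (u 1)))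

theorem Φ_eq (g : 𝓢(E4, ℂ)) (u : Fin 2 → E4) (ω : Ω) :
    Φ g u ω = ((starRingEnd ℂ) (g (u 0)) * g (u 1)) *
      ((wt' ω.1 * (psi ω (u 0) * psi ω (u 1)) : ℝ) : ℂ) := by
  simp only [Φ]; push_cast; ring

theorem norm_Φ (g : 𝓢(E4, ℂ)) (u : Fin 2 → E4) (ω : Ω) :
    ‖Φ g u ω‖ = (wt' ω.1 * (psi ω (u 0) * psi ω (u 1))) * (‖g (u 0)‖ * ‖g (u 1)‖) := by
  rw [Φ_eq, norm_mul, Complex.norm_real, norm_mul, RCLike.norm_conj,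
    Real.norm_of_nonneg (mul_nonneg (wt'_nonneg _) (mul_nonneg (psi_nonneg _ _) (psi_nonneg _ _)))]
  ring

theorem measurable_Φ_uncurry (g : 𝓢(E4, ℂ)) :
    Measurable (Function.uncurry (Φ g)) := by
  unfold Φ Function.uncurry
  have hw : Measurable fun z : (Fin 2 → E4) × Ω => (wt' z.2.1 : ℂ) :=
    Complex.measurable_ofReal.comp (measurable_wt'.comp (measurable_fst.comp measurable_snd))
  have hpsi : ∀ i : Fin 2, Measurable fun z : (Fin 2 → E4) × Ω => (psi z.2 (z.1 i) : ℂ) := fun i =>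
    Complex.measurable_ofReal.comp (measurable_psi_uncurry.comp
      (measurable_snd.prodMk ((measurable_pi_apply i).comp measurable_fst)))
  have hg : ∀ i : Fin 2, Measurable fun z : (Fin 2 → E4) × Ω => g (z.1 i) := fun i =>
    g.continuous.measurable.comp ((measurable_pi_apply i).comp measurable_fst)
  exact hw.mul (((hpsi 0).mul ((Complex.continuous_conj.measurable).comp (hg 0))).mul
    ((hpsi 1).mul (hg 1)))

/-- The `ω`-integral of `Φ` recovers the kernel integrand. -/
theorem integral_Φ_ω (g : 𝓢(E4, ℂ)) (hg : ∀ u : E4, g u ≠ 0 → 0 < u 0) (u : Fin 2 → E4) :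
    ∫ ω, Φ g u ω =
      (Kw (timeReflection 4 (u 0) - u 1) : ℂ) * ((starRingEnd ℂ) (g (u 0)) * g (u 1)) := by
  by_cases h : g (u 0) = 0 ∨ g (u 1) = 0
  · have h0 : (starRingEnd ℂ) (g (u 0)) * g (u 1) = 0 := by
      rcases h with h | h <;> simp [h]
    simp_rw [Φ_eq, h0, zero_mul, integral_zero, mul_zero]
  · obtain ⟨h1, h2⟩ := not_or.1 h
    have ha : 0 < u 0 0 := hg _ h1
    have hb : 0 < u 1 0 := hg _ h2
    simp_rw [Φ_eq]
    rw [integral_const_mul, integral_complex_ofReal, integral_w_psi_psi ha hb]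
    ring

theorem integrable_Φ_ω (g : 𝓢(E4, ℂ)) (hg : ∀ u : E4, g u ≠ 0 → 0 < u 0) (u : Fin 2 → E4) :
    Integrable (Φ g u) := by
  by_cases h : g (u 0) = 0 ∨ g (u 1) = 0
  · have h0 : (starRingEnd ℂ) (g (u 0)) * g (u 1) = 0 := by
      rcases h with h | h <;> simp [h]
    have : Φ g u = fun _ => 0 := by funext ω; rw [Φ_eq, h0, zero_mul]
    rw [this]; exact integrable_zero _ _ _
  · obtain ⟨h1, h2⟩ := not_or.1 h
    have ha : 0 < u 0 0 := hg _ h1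
    have hb : 0 < u 1 0 := hg _ h2
    have : Φ g u = fun ω => ((starRingEnd ℂ) (g (u 0)) * g (u 1)) *
        ((wt' ω.1 * (psi ω (u 0) * psi ω (u 1)) : ℝ) : ℂ) := funext (Φ_eq g u)
    rw [this]
    exact ((integrable_w_psi_psi ha hb).ofReal).const_mul _

theorem integral_norm_Φ_ω (g : 𝓢(E4, ℂ)) (hg : ∀ u : E4, g u ≠ 0 → 0 < u 0) (u : Fin 2 → E4) :
    ∫ ω, ‖Φ g u ω‖ = Kw (timeReflection 4 (u 0) - u 1) * (‖g (u 0)‖ * ‖g (u 1)‖) := by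
  simp_rw [norm_Φ]
  rw [integral_mul_const]
  by_cases h : g (u 0) = 0 ∨ g (u 1) = 0
  · have h0 : ‖g (u 0)‖ * ‖g (u 1)‖ = 0 := by rcases h with h | h <;> simp [h]
    rw [h0, mul_zero, mul_zero]
  · obtain ⟨h1, h2⟩ := not_or.1 h
    rw [integral_w_psi_psi (hg _ h1) (hg _ h2)]

/-- The `u`-integral of `Φ` is `w(λ) |∫ ψ_ω g|²`. -/
theorem integral_Φ_u (g : 𝓢(E4, ℂ)) (ω : Ω) :
    ∫ u : Fin 2 → E4, Φ g u ω =
      (((wt' ω.1 * ‖∫ a : E4, (psi ω a : ℂ) * g a‖ ^ 2 : ℝ)) : ℂ) := by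
  set z : ℂ := ∫ a : E4, (psi ω a : ℂ) * g a with hz
  have hprod : ∀ u : Fin 2 → E4, Φ g u ω = (wt' ω.1 : ℂ) *
      ∏ i : Fin 2, (![fun a => (psi ω a : ℂ) * (starRingEnd ℂ) (g a), fun a => (psi ω a : ℂ) * g a] i) (u i) := by
    intro u
    rw [Fin.prod_univ_two]
    rfl
  simp_rw [hprod]
  rw [integral_const_mul, integral_fintype_prod_volume_eq_prod, Fin.prod_univ_two]
  simp only [Matrix.cons_val_zero, Matrix.cons_val_one]
  have hconj : ∫ a : E4, (psi ω a : ℂ) * (starRingEnd ℂ) (g a) = (starRingEnd ℂ) z := by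
    rw [hz, ← integral_conj]
    congr 1; funext a
    rw [map_mul, Complex.conj_ofReal]
  rw [hconj, ← hz, Complex.ofReal_mul]
  congr 1
  rw [← Complex.normSq_eq_norm_sq]
  exact Complex.normSq_eq_conj_mul_self.symm

/-- **The OS form of `T`'s kernel on a positive-time function is an integral of squares**:
for `g` vanishing outside `{x⁰ > 0}`, `∫ K(θu₀ − u₁) conj g(u₀) g(u₁) du = ∫_Ω w |∫ ψ_ω g|² ≥ 0`. -/
theorem rp_core (g : 𝓢(E4, ℂ)) (hg : ∀ u : E4, g u ≠ 0 → 0 < u 0)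
    (hint : Integrable fun u : Fin 2 → E4 =>
      (Kw (timeReflection 4 (u 0) - u 1) : ℂ) * ((starRingEnd ℂ) (g (u 0)) * g (u 1))) :
    ∫ u : Fin 2 → E4, (Kw (timeReflection 4 (u 0) - u 1) : ℂ) * ((starRingEnd ℂ) (g (u 0)) * g (u 1)) =
      ((∫ ω : Ω, wt' ω.1 * ‖∫ a : E4, (psi ω a : ℂ) * g a‖ ^ 2 : ℝ) : ℂ) := by
  have hΦ : Integrable (Function.uncurry (Φ g)) (volume.prod volume) := by
    rw [integrable_prod_iff (measurable_Φ_uncurry g).aestronglyMeasurable]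
    refine ⟨ae_of_all _ fun u => integrable_Φ_ω g hg u, ?_⟩
    have : (fun u : Fin 2 → E4 => ∫ ω, ‖Function.uncurry (Φ g) (u, ω)‖) =
        fun u => ‖(Kw (timeReflection 4 (u 0) - u 1) : ℂ) * ((starRingEnd ℂ) (g (u 0)) * g (u 1))‖ := by
      funext u
      simp only [Function.uncurry_apply_pair]
      rw [integral_norm_Φ_ω g hg u, norm_mul, Complex.norm_real, Real.norm_of_nonneg (Kw_nonneg _),
        norm_mul, RCLike.norm_conj]
    rw [this]
    exact hint.norm
  calc ∫ u : Fin 2 → E4, (Kw (timeReflection 4 (u 0) - u 1) : ℂ) * ((starRingEnd ℂ) (g (u 0)) * g (u 1))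
      = ∫ u : Fin 2 → E4, ∫ ω, Φ g u ω := by
        refine integral_congr_ae (ae_of_all _ fun u => ?_)
        exact (integral_Φ_ω g hg u).symm
    _ = ∫ ω, ∫ u : Fin 2 → E4, Φ g u ω := integral_integral_swap hΦ
    _ = ∫ ω : Ω, (((wt' ω.1 * ‖∫ a : E4, (psi ω a : ℂ) * g a‖ ^ 2 : ℝ)) : ℂ) := by
        refine integral_congr_ae (ae_of_all _ fun ω => ?_)
        exact integral_Φ_u g ω
    _ = ((∫ ω : Ω, wt' ω.1 * ‖∫ a : E4, (psi ω a : ℂ) * g a‖ ^ 2 : ℝ) : ℂ) := integral_complex_ofReal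

theorem rp_core_nonneg (g : 𝓢(E4, ℂ)) (hg : ∀ u : E4, g u ≠ 0 → 0 < u 0)
    (hint : Integrable fun u : Fin 2 → E4 =>
      (Kw (timeReflection 4 (u 0) - u 1) : ℂ) * ((starRingEnd ℂ) (g (u 0)) * g (u 1))) :
    let I := ∫ u : Fin 2 → E4, (Kw (timeReflection 4 (u 0) - u 1) : ℂ) * ((starRingEnd ℂ) (g (u 0)) * g (u 1))
    0 ≤ I.re ∧ I.im = 0 := by
  intro I
  have hI : I = ((∫ ω : Ω, wt' ω.1 * ‖∫ a : E4, (psi ω a : ℂ) * g a‖ ^ 2 : ℝ) : ℂ) :=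
    rp_core g hg hint
  rw [hI, Complex.ofReal_re, Complex.ofReal_im]
  exact ⟨integral_nonneg fun ω => mul_nonneg (wt'_nonneg _) (sq_nonneg _), rfl⟩

end RPCore


/-! ### Reflection positivity of `T`, III: the E2 clause on positive-time one-point families -/

section RPFamily

open Summit.QuantumFields.YangMills.Theorems.CurvatureKernel (isOffDiagonal_tensorFin_two)

theorem pos_of_isPositiveTime {f : 𝓢(E4, ℂ)} (hf : IsPositiveTime f) {u : E4} (hu : f u ≠ 0) :
    0 < u 0 :=
  hf (subset_tsupport _ hu)

@[simp] theorem starTheta_apply (f : 𝓢(E4, ℂ)) (x : E4) :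
    starTest (thetaTest 4 f) x = (starRingEnd ℂ) (f (timeReflection 4 x)) := by
  simp

/-- `Θf*` is supported in the open negative half-space when `f` is positive-time. -/
theorem tsupport_starTheta_subset {f : 𝓢(E4, ℂ)} (hf : IsPositiveTime f) :
    tsupport ((starTest (thetaTest 4 f) : 𝓢(E4, ℂ)) : E4 → ℂ) ⊆ {x | x 0 < 0} := by
  have hfun : ((starTest (thetaTest 4 f) : 𝓢(E4, ℂ)) : E4 → ℂ) =
      fun y : E4 => (starRingEnd ℂ) (f (timeReflection 4 y)) := by
    funext y; simp
  rw [hfun]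
  have hcl : tsupport (fun y : E4 => (starRingEnd ℂ) (f (timeReflection 4 y))) ⊆
      (timeReflection 4) ⁻¹' tsupport (f : E4 → ℂ) := by
    refine closure_minimal (fun y hy => ?_) ((isClosed_tsupport _).preimage (timeReflection 4).continuous)
    have hy' : f (timeReflection 4 y) ≠ 0 := by
      intro h0; exact hy (by simp [h0])
    exact subset_tsupport _ hy'
  intro x hx
  have h0 : 0 < (timeReflection 4 x) 0 := hf (hcl hx)
  simp [timeReflection_apply] at h0
  simpa using h0

theorem isOffDiagonal_thetaTensor {f g : 𝓢(E4, ℂ)} (hf : IsPositiveTime f) (hg : IsPositiveTime g) :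
    IsOffDiagonal (SchwartzMap.tensorFin 2 ![starTest (thetaTest 4 f), g]) := by
  refine isOffDiagonal_tensorFin_two (Set.disjoint_left.2 fun x hx hx' => ?_)
  have h1 : x 0 < 0 := tsupport_starTheta_subset hf hx
  have h2 : 0 < x 0 := hg hx'
  linarith

/-- **E2 for `T` (two-point shadow): the OS form on positive-time one-point families is `≥ 0`.** -/
theorem T_reflectionPositive (N : ℕ) (f : Fin N → 𝓢(E4, ℂ)) (hf : ∀ j, IsPositiveTime (f j))
    (H : Fin N → Fin N → 𝓢((Fin 2 → E4), ℂ))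
    (hH : ∀ i j, IsTensorOf (H i j) ![starTest (thetaTest 4 (f i)), f j]) :
    let z := ∑ i, ∑ j, T (H i j); 0 ≤ z.re ∧ z.im = 0 := by
  intro z
  have hEq : ∀ i j, H i j = SchwartzMap.tensorFin 2 ![starTest (thetaTest 4 (f i)), f j] :=
    fun i j => (hH i j).unique (isTensorOf_tensorFin _)
  have hoff : ∀ i j, IsOffDiagonal (H i j) := fun i j => by
    rw [hEq i j]; exact isOffDiagonal_thetaTensor (hf i) (hf j)
  have happ : ∀ i j (x : Fin 2 → E4),
      H i j x = (starRingEnd ℂ) (f i (timeReflection 4 (x 0))) * f j (x 1) := by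
    intro i j x
    rw [hH i j x, Fin.prod_univ_two]
    simp
  -- the summed positive-time function
  set g : 𝓢(E4, ℂ) := ∑ j, f j with hg
  have hgapp : ∀ u : E4, g u = ∑ j, f j u := fun u => by
    rw [hg]; simp
  have hgpos : ∀ u : E4, g u ≠ 0 → 0 < u 0 := by
    intro u hu
    rw [hgapp] at hu
    obtain ⟨j, -, hj⟩ := Finset.exists_ne_zero_of_sum_ne_zero hu
    exact pos_of_isPositiveTime (hf j) hj
  -- the integrands
  set Fij : Fin N → Fin N → (Fin 2 → E4) → ℂ := fun i j x =>
    KC x * ((starRingEnd ℂ) (f i (timeReflection 4 (x 0))) * f j (x 1)) with hFij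
  have hint_ij : ∀ i j, Integrable (Fij i j) := by
    intro i j
    refine (integrable_KC_mul (hoff i j)).congr (ae_of_all _ fun x => ?_)
    show KC x * H i j x = Fij i j x
    rw [happ]
  have hT : ∀ i j, T (H i j) = ∫ x, Fij i j x := by
    intro i j
    rw [T_eq_integral (hoff i j)]
    exact integral_congr_ae (ae_of_all _ fun x => by show KC x * H i j x = Fij i j x; rw [happ])
  set Fg : (Fin 2 → E4) → ℂ := fun x =>
    KC x * ((starRingEnd ℂ) (g (timeReflection 4 (x 0))) * g (x 1)) with hFg
  have hFg_sum : ∀ x, Fg x = ∑ i, ∑ j, Fij i j x := by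
    intro x
    simp only [hFg, hFij, hgapp, map_sum]
    rw [Finset.sum_mul_sum, Finset.mul_sum]
    refine Finset.sum_congr rfl fun i _ => ?_
    rw [Finset.mul_sum]
  have hint_g : Integrable Fg := by
    have : Fg = fun x => ∑ i, ∑ j, Fij i j x := funext hFg_sum
    rw [this]
    exact integrable_finsetSum _ fun i _ => integrable_finsetSum _ fun j _ => hint_ij i j
  have hz : z = ∫ x, Fg x := by
    show ∑ i, ∑ j, T (H i j) = ∫ x, Fg x
    simp_rw [hT, hFg_sum]
    rw [integral_finsetSum _ fun i _ => integrable_finsetSum _ fun j _ => hint_ij i j]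
    refine Finset.sum_congr rfl fun i _ => ?_
    rw [integral_finsetSum _ fun j _ => hint_ij i j]
  -- substitute x = (θ u₀, u₁)
  have hsub := integral_comp_isometry₂ Rθ Fg
  have hsimp : ∀ u : Fin 2 → E4, Fg (fun i => Rθ i (u i)) =
      (Kw (timeReflection 4 (u 0) - u 1) : ℂ) * ((starRingEnd ℂ) (g (u 0)) * g (u 1)) := by
    intro u
    simp [hFg, KC_apply, timeReflection_timeReflection]
  have hint' : Integrable fun u : Fin 2 → E4 =>
      (Kw (timeReflection 4 (u 0) - u 1) : ℂ) * ((starRingEnd ℂ) (g (u 0)) * g (u 1)) := by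
    have := integrable_comp_isometry₂ Rθ hint_g
    exact this.congr (ae_of_all _ fun u => hsimp u)
  have hfinal := rp_core_nonneg g hgpos hint'
  rw [hz, ← hsub]
  simp_rw [hsimp]
  exact hfinal

end RPFamily


/-! ### Exponential clustering of `T` -/

section Cluster

theorem kfun_antitone {r r' : ℝ} (hr : 0 < r) (h : r ≤ r') : kfun r' ≤ kfun r :=
  setIntegral_mono_on (integrableOn_kint (hr.trans_le h)) (integrableOn_kint hr) measurableSet_Ioi
    fun _ ht => kint_antitone h (zero_le_one.trans (le_of_lt ht))

/-- `k₁(r + t) ≤ e · e^{-t} (k₁(1) + k₁(r))` for `r > 0`, `t ≥ 0`. -/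
theorem kfun_add_le {r t : ℝ} (hr : 0 < r) (ht : 0 ≤ t) :
    kfun (r + t) ≤ exp 1 * exp (-t) * (kfun 1 + kfun r) := by
  have hk1 := kfun_nonneg 1
  have hkr := kfun_nonneg r
  have hee : exp 1 * exp (-t) = exp (1 - t) := by rw [← Real.exp_add]; ring_nf
  rw [hee]
  by_cases h1 : 1 ≤ r + t
  · calc kfun (r + t) ≤ exp (1 - (r + t)) * kfun 1 := kfun_le_exp h1
      _ ≤ exp (1 - t) * kfun 1 := by gcongr; linarith
      _ ≤ exp (1 - t) * (kfun 1 + kfun r) := by gcongr; linarith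
  · have hlt : t < 1 := by linarith
    have he1 : 1 ≤ exp (1 - t) := Real.one_le_exp (by linarith)
    calc kfun (r + t) ≤ kfun r := kfun_antitone hr (by linarith)
      _ ≤ exp (1 - t) * kfun r := le_mul_of_one_le_left hkr he1
      _ ≤ exp (1 - t) * (kfun 1 + kfun r) := by gcongr; linarith

/-- `ℓ¹(w − t e₀) = ℓ¹(w) + t` for `w⁰ ≤ 0 ≤ t`. -/
theorem l1_sub_time {w : E4} (hw : w 0 ≤ 0) {t : ℝ} (ht : 0 ≤ t) :
    l1 (w - EuclideanSpace.single 0 t) = l1 w + t := by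
  have h0 : (w - EuclideanSpace.single 0 t : E4) 0 = w 0 - t := by simp
  have hk : ∀ k : Fin 3, (w - EuclideanSpace.single 0 t : E4) k.succ = w k.succ := fun k => by
    simp
  have hsum : ∀ v : E4, l1 v = |v 0| + ∑ k : Fin 3, |v k.succ| := fun v => by
    rw [l1, Fin.sum_univ_succ]
  rw [hsum, hsum, h0, abs_of_nonpos (by linarith), abs_of_nonpos hw]
  simp only [hk]
  ring

/-- Kernel decay in the time direction: `K(w − t e₀) ≤ e e^{-t} (k₁(1) + K(w))` for `w⁰ ≤ 0`, `w ≠ 0`. -/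
theorem Kw_sub_time_le {w : E4} (hw : w 0 ≤ 0) (hw0 : w ≠ 0) {t : ℝ} (ht : 0 ≤ t) :
    Kw (w - EuclideanSpace.single 0 t) ≤ exp 1 * exp (-t) * (kfun 1 + Kw w) := by
  rw [Kw, l1_sub_time hw ht, Kw]
  exact kfun_add_le (l1_pos hw0) ht

/-- Translates stay in the half-space: `tsupport (g(· − a)) ⊆ a + tsupport g`. -/
theorem tsupport_translateTest_subset (a : E4) (g : 𝓢(E4, ℂ)) :
    tsupport ((translateTest a g : 𝓢(E4, ℂ)) : E4 → ℂ) ⊆ (fun x => x - a) ⁻¹' tsupport (g : E4 → ℂ) := by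
  have hfun : ((translateTest a g : 𝓢(E4, ℂ)) : E4 → ℂ) = fun x => g (x - a) := by
    funext x; simp
  rw [hfun]
  refine closure_minimal (fun y hy => subset_tsupport _ hy)
    ((isClosed_tsupport _).preimage (continuous_id.sub continuous_const))

theorem isPositiveTime_translateTest {g : 𝓢(E4, ℂ)} (hg : IsPositiveTime g) {t : ℝ} (ht : 0 ≤ t) :
    IsPositiveTime (translateTest (EuclideanSpace.single 0 t) g) := by
  intro x hx
  have h := hg (tsupport_translateTest_subset _ g hx)
  simp only [mem_setOf_eq, PiLp.sub_apply, PiLp.single_apply, if_pos] at h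
  show 0 < x 0
  simp at h
  linarith

/-- **Exponential clustering (two-point shadow of E4 / `HasMassGap 1`).** -/
theorem T_cluster (f g : 𝓢(E4, ℂ)) (hf : IsPositiveTime f) (hg : IsPositiveTime g) :
    ∃ C : ℝ, ∀ t : ℝ, 0 ≤ t → ∀ H : 𝓢((Fin 2 → E4), ℂ),
      IsTensorOf H ![starTest (thetaTest 4 f), translateTest (EuclideanSpace.single 0 t) g] →
        ‖T H‖ ≤ C * exp (-t) := by
  -- the dominating integrable function
  set F₀ : 𝓢((Fin 2 → E4), ℂ) := SchwartzMap.tensorFin 2 ![starTest (thetaTest 4 f), g] with hF₀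
  have hF₀off : IsOffDiagonal F₀ := isOffDiagonal_thetaTensor hf hg
  have hF₀app : ∀ x : Fin 2 → E4, F₀ x = (starRingEnd ℂ) (f (timeReflection 4 (x 0))) * g (x 1) := by
    intro x; rw [hF₀, SchwartzMap.tensorFin_apply, Fin.prod_univ_two]; simp
  set D : (Fin 2 → E4) → ℝ := fun x => (kfun 1 + Kw (x 0 - x 1)) * ‖F₀ x‖ with hD
  have hDint : Integrable D := by
    have h1 : Integrable (fun x : Fin 2 → E4 => kfun 1 * ‖F₀ x‖) := (F₀.integrable.norm).const_mul _
    have h2 : Integrable (fun x : Fin 2 → E4 => Kw (x 0 - x 1) * ‖F₀ x‖) := by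
      have := (integrable_KC_mul hF₀off).norm
      refine this.congr (ae_of_all _ fun x => ?_)
      show ‖KC x * F₀ x‖ = Kw (x 0 - x 1) * ‖F₀ x‖
      rw [norm_mul, norm_KC]
    exact (h1.add h2).congr (ae_of_all _ fun x => by simp only [hD, Pi.add_apply]; ring)
  refine ⟨exp 1 * ∫ x, D x, fun t ht H hH => ?_⟩
  have hgt := isPositiveTime_translateTest hg ht
  have hEq : H = SchwartzMap.tensorFin 2 ![starTest (thetaTest 4 f),
      translateTest (EuclideanSpace.single 0 t) g] := hH.unique (isTensorOf_tensorFin _)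
  have hHoff : IsOffDiagonal H := by rw [hEq]; exact isOffDiagonal_thetaTensor hf hgt
  have hHapp : ∀ x : Fin 2 → E4, H x = (starRingEnd ℂ) (f (timeReflection 4 (x 0))) *
      g (x 1 - EuclideanSpace.single 0 t) := by
    intro x; rw [hH x, Fin.prod_univ_two]; simp
  rw [T_eq_integral hHoff]
  -- shift the second point by `t e₀`
  set c : Fin 2 → E4 := fun i => if i = 1 then -EuclideanSpace.single 0 t else 0 with hc
  have hshift := integral_sub_right_eq_self (μ := volume)
    (fun x : Fin 2 → E4 => ‖KC x * H x‖) c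
  -- pointwise bound after the shift
  have hpt : ∀ x : Fin 2 → E4, ‖KC (x - c) * H (x - c)‖ ≤
      exp 1 * exp (-t) * ((kfun 1 + Kw (x 0 - x 1)) * ‖F₀ x‖) := by
    intro x
    have hx0 : (x - c) 0 = x 0 := by simp [hc]
    have hx1 : (x - c) 1 = x 1 + EuclideanSpace.single 0 t := by
      simp [hc, sub_neg_eq_add]
    rw [norm_mul, norm_KC, hHapp, hx0, hx1, add_sub_cancel_right, ← hF₀app]
    by_cases hz : F₀ x = 0
    · rw [hz, norm_zero, mul_zero, mul_zero, mul_zero]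
    · -- on the support: x₀⁰ < 0 < x₁⁰
      have hne : (starRingEnd ℂ) (f (timeReflection 4 (x 0))) ≠ 0 ∧ g (x 1) ≠ 0 := by
        rw [hF₀app] at hz
        exact mul_ne_zero_iff.1 hz
      have hf0 : 0 < (timeReflection 4 (x 0)) 0 :=
        pos_of_isPositiveTime hf (by simpa using hne.1)
      have hx00 : x 0 0 < 0 := by simp [timeReflection_apply] at hf0; linarith
      have hx10 : 0 < x 1 0 := pos_of_isPositiveTime hg hne.2
      have hw : (x 0 - x 1) 0 ≤ 0 := by simp; linarith
      have hw0 : x 0 - x 1 ≠ 0 := by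
        intro h; have := congrArg (fun v : E4 => v 0) h; simp at this; linarith
      have hK : Kw (x 0 - (x 1 + EuclideanSpace.single 0 t)) ≤
          exp 1 * exp (-t) * (kfun 1 + Kw (x 0 - x 1)) := by
        rw [← sub_sub]; exact Kw_sub_time_le hw hw0 ht
      calc Kw (x 0 - (x 1 + EuclideanSpace.single 0 t)) * ‖F₀ x‖
          ≤ (exp 1 * exp (-t) * (kfun 1 + Kw (x 0 - x 1))) * ‖F₀ x‖ :=
            mul_le_mul_of_nonneg_right hK (norm_nonneg _)
        _ = exp 1 * exp (-t) * ((kfun 1 + Kw (x 0 - x 1)) * ‖F₀ x‖) := by ring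
  calc ‖∫ x, KC x * H x‖ ≤ ∫ x, ‖KC x * H x‖ := norm_integral_le_integral_norm _
    _ = ∫ x, ‖KC (x - c) * H (x - c)‖ := hshift.symm
    _ ≤ ∫ x, exp 1 * exp (-t) * D x :=
        integral_mono_of_nonneg (ae_of_all _ fun _ => norm_nonneg _) (hDint.const_mul _)
          (ae_of_all _ hpt)
    _ = exp 1 * (∫ x, D x) * exp (-t) := by rw [integral_const_mul]; ring

end Cluster


/-! ### The refuted strengthening: the two-point package + regularity do NOT bound the order -/

section Main

/-- **Two-point shadow of the hypotheses of Stub E (`AxialGrowth`) minus the lattice tie, PLUS the regularity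
conclusions of Stubs A/B.** A two-point functional `T` with: translations and proper signed permutations
on `⁰𝒮` (verbatim from `W₁`), swap symmetry (E3 at `n = 2`), hermiticity (E0 on time-ordered functions), E2 on
positive-time ONE-point families (the `(1,1)`-block of `IsReflectionPositive`), exponential clustering at rate `1`
(the `(1,1)`-block of `HasMassGap 1` with vanishing one-point function), represented on `⁰𝒮` by a kernel `K`
continuous off `0`. -/
structure TwoPointPackage (T : 𝓢((Fin 2 → E4), ℂ) →L[ℂ] ℂ) (K : E4 → ℂ) : Prop where
  translate : ∀ (a : E4) (F : 𝓢((Fin 2 → E4), ℂ)), IsOffDiagonal F → T (translateMulti a F) = T F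
  signedPerm : ∀ R : E4 ≃ₗᵢ[ℝ] E4, LinearMap.det (R.toLinearEquiv : E4 →ₗ[ℝ] E4) = 1 →
      (∀ i : Fin 4, ∃ j : Fin 4, R (EuclideanSpace.single i 1) = EuclideanSpace.single j 1 ∨
        R (EuclideanSpace.single i 1) = -EuclideanSpace.single j 1) →
      ∀ F : 𝓢((Fin 2 → E4), ℂ), IsOffDiagonal F → T (linActMulti R F) = T F
  swap : ∀ F : 𝓢((Fin 2 → E4), ℂ), IsOffDiagonal F → T (permTest (Equiv.swap 0 1) F) = T F
  hermitian : ∀ F : 𝓢((Fin 2 → E4), ℂ), IsTimeOrdered F → T F = (starRingEnd ℂ) (T (osAdjoint F))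
  reflectionPositive : ∀ (N : ℕ) (f : Fin N → 𝓢(E4, ℂ)), (∀ j, IsPositiveTime (f j)) →
      ∀ H : Fin N → Fin N → 𝓢((Fin 2 → E4), ℂ),
        (∀ i j, IsTensorOf (H i j) ![starTest (thetaTest 4 (f i)), f j]) →
          0 ≤ (∑ i, ∑ j, T (H i j)).re ∧ (∑ i, ∑ j, T (H i j)).im = 0
  cluster : ∀ f g : 𝓢(E4, ℂ), IsPositiveTime f → IsPositiveTime g → ∃ C : ℝ, ∀ t : ℝ, 0 ≤ t →
      ∀ H : 𝓢((Fin 2 → E4), ℂ),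
        IsTensorOf H ![starTest (thetaTest 4 f), translateTest (EuclideanSpace.single 0 t) g] →
          ‖T H‖ ≤ C * Real.exp (-t)
  continuousOn : ContinuousOn K {x : E4 | x ≠ 0}
  represents : ∀ F : 𝓢((Fin 2 → E4), ℂ), IsOffDiagonal F →
      Integrable (fun x : Fin 2 → E4 => K (x 0 - x 1) * F x) ∧ T F = ∫ x, K (x 0 - x 1) * F x

/-- **The natural model-blind strengthening of Stub E**: "the two-point package and a continuous representing
kernel imply the axial growth bound `‖K(s e₀)‖ ≤ C s^(η−10)`, `η > 0`, on `(0,1]`". -/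
def AxialGrowthOfTwoPointPackage : Prop :=
  ∀ (T : 𝓢((Fin 2 → E4), ℂ) →L[ℂ] ℂ) (K : E4 → ℂ), TwoPointPackage T K →
    ∃ C η : ℝ, 0 < η ∧ ∀ s : ℝ, 0 < s → s ≤ 1 → ‖K (EuclideanSpace.single 0 s)‖ ≤ C * s ^ (η - 10)

/-- The complexified witness kernel. -/
def KwC (x : E4) : ℂ := (Kw x : ℂ)

/-- **The witness carries the full two-point package.** -/
theorem twoPointPackage_T : TwoPointPackage T KwC where
  translate a _ hF := T_translateMulti a hF
  signedPerm R _ hR _ hF := T_linActMulti R hR hF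
  swap _ hF := T_permTest_swap hF
  hermitian _ hF := T_hermitian hF.isOffDiagonal
  reflectionPositive N f hf H hH := T_reflectionPositive N f hf H hH
  cluster f g hf hg := T_cluster f g hf hg
  continuousOn := Complex.continuous_ofReal.comp_continuousOn continuousOn_Kw
  represents _ hF := ⟨integrable_KC_mul hF, T_eq_integral hF⟩

/-- **ORDER-INSUFFICIENCY WITH REGULARITY.** The two-point consequences of `W₁` minus the lattice clause,
together with a continuous representing kernel (the output of the regularity stubs), do NOT bound the order of
the two-point singularity: the `ℓ¹`-radial axis-RP kernel `K = k₁(‖·‖₁)` has `K(s e₀) ≥ e⁻² s⁻¹⁰`. Any proof of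
`AxialGrowth` must use the lattice tie (or structure beyond the two-point level). -/
theorem not_axialGrowthOfTwoPointPackage : ¬ AxialGrowthOfTwoPointPackage := by
  intro h
  obtain ⟨C, η, hη, hb⟩ := h T KwC twoPointPackage_T
  -- `e⁻² ≤ C s^η` on `(0,1]`
  have key : ∀ s : ℝ, 0 < s → s ≤ 1 → exp (-2) ≤ C * s ^ η := by
    intro s hs hs1
    have h1 := Kw_axis_ge hs hs1
    have h2 := hb s hs hs1
    rw [KwC, Complex.norm_real, Real.norm_of_nonneg (Kw_nonneg _)] at h2
    have hpow : C * s ^ (η - 10) = C * s ^ η * s⁻¹ ^ 10 := by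
      rw [Real.rpow_sub hs, show (10 : ℝ) = ((10 : ℕ) : ℝ) by norm_num, Real.rpow_natCast,
        div_eq_mul_inv, inv_pow, mul_assoc]
    rw [hpow] at h2
    have hs10 : 0 < s⁻¹ ^ 10 := by positivity
    exact le_of_mul_le_mul_right (h1.trans h2) hs10
  -- but `C s^η → 0` as `s → 0⁺`
  have hlim : Tendsto (fun s : ℝ => C * s ^ η) (𝓝[>] 0) (𝓝 0) := by
    have hc : ContinuousAt (fun s : ℝ => s ^ η) 0 := Real.continuousAt_rpow_const 0 η (Or.inr hη.le)
    have hc' : ContinuousAt (fun s : ℝ => C * s ^ η) 0 :=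
      (continuousAt_const (y := C)).mul hc
    have h1 : Tendsto (fun s : ℝ => C * s ^ η) (𝓝 0) (𝓝 (C * (0 : ℝ) ^ η)) := hc'.tendsto
    rw [Real.zero_rpow hη.ne', mul_zero] at h1
    exact h1.mono_left nhdsWithin_le_nhds
  have hev : ∀ᶠ s in 𝓝[>] (0 : ℝ), C * s ^ η < exp (-2) ∧ s ∈ Ioo (0 : ℝ) 1 := by
    refine (hlim.eventually (gt_mem_nhds (exp_pos _))).and ?_
    exact Ioo_mem_nhdsGT one_pos
  obtain ⟨s, hs1, hs2⟩ := hev.exists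
  have := key s hs2.1 hs2.2.le
  linarith

/-! Extra kernel-level facts about the witness (it passes every conclusion of Stub B `AxisEnvelope`). -/

/-- The witness kernel is real and non-negative. -/
theorem KwC_real_nonneg (x : E4) : (KwC x).im = 0 ∧ 0 ≤ (KwC x).re := by
  simp [KwC, Kw_nonneg]

/-- The witness kernel is even. -/
theorem KwC_even (x : E4) : KwC (-x) = KwC x := by simp [KwC, Kw_neg]

/-- The witness kernel is invariant under every signed permutation of the coordinates (`W(B₄)`). -/
theorem KwC_signedPerm (R : E4 ≃ₗᵢ[ℝ] E4)
    (hR : ∀ i : Fin 4, ∃ j : Fin 4, R (EuclideanSpace.single i 1) = EuclideanSpace.single j 1 ∨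
      R (EuclideanSpace.single i 1) = -EuclideanSpace.single j 1) (x : E4) :
    KwC (R x) = KwC x := by simp [KwC, Kw_signedPerm R hR]

/-- Polynomial a-priori bound `‖K x‖ ≤ 9! ‖x‖⁻¹⁰` and exponential decay `‖K x‖ ≤ e^{1-‖x‖} k₁(1)`. -/
theorem KwC_bounds (x : E4) (hx : x ≠ 0) :
    ‖KwC x‖ ≤ Nat.factorial 9 * ‖x‖⁻¹ ^ 10 ∧ (1 ≤ ‖x‖ → ‖KwC x‖ ≤ exp (1 - ‖x‖) * kfun 1) := by
  rw [KwC, Complex.norm_real, Real.norm_of_nonneg (Kw_nonneg _)]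
  exact ⟨Kw_le hx, fun h1 => Kw_le_exp h1⟩

/-- **Order exactly ten on the axis**: `e⁻² s⁻¹⁰ ≤ ‖K(s e₀)‖` for `0 < s ≤ 1` (the forbidden `η = 0`). -/
theorem KwC_axis_ge {s : ℝ} (hs : 0 < s) (hs1 : s ≤ 1) :
    exp (-2) * s⁻¹ ^ 10 ≤ ‖KwC (EuclideanSpace.single 0 s)‖ := by
  rw [KwC, Complex.norm_real, Real.norm_of_nonneg (Kw_nonneg _)]
  exact Kw_axis_ge hs hs1


/-- **The witness passes every conclusion of Stub B `AxisEnvelope`**: on the axis `K` is real and `≥ 0`, the axial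
profile `s ↦ K(s e₀)` is non-increasing on `(0, ∞)`, and the envelope `‖K x‖ ≤ K((‖x‖/2) e₀)` holds off `0`
(indeed `‖x‖/2 ≤ ‖x‖ ≤ ‖x‖₁` and `k₁` is antitone) — so B cannot be strengthened into E either. -/
theorem KwC_axisEnvelope :
    (∀ s : ℝ, 0 < s → (KwC (EuclideanSpace.single 0 s)).im = 0 ∧ 0 ≤ (KwC (EuclideanSpace.single 0 s)).re) ∧
    AntitoneOn (fun s : ℝ => (KwC (EuclideanSpace.single 0 s)).re) (Set.Ioi 0) ∧
    (∀ x : E4, x ≠ 0 → ‖KwC x‖ ≤ (KwC (EuclideanSpace.single 0 (‖x‖ / 2))).re) := by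
  refine ⟨fun s _ => KwC_real_nonneg _, ?_, ?_⟩
  · intro s hs s' hs' hss'
    simp only [KwC, Complex.ofReal_re, Kw, l1_single]
    rw [abs_of_pos (mem_Ioi.1 hs), abs_of_pos (mem_Ioi.1 hs')]
    exact kfun_antitone (mem_Ioi.1 hs) hss'
  · intro x hx
    rw [KwC, Complex.norm_real, Real.norm_of_nonneg (Kw_nonneg _), KwC, Complex.ofReal_re, Kw, Kw,
      l1_single, abs_of_pos (half_pos (norm_pos_iff.2 hx))]
    exact kfun_antitone (half_pos (norm_pos_iff.2 hx))
      ((half_le_self (norm_nonneg x)).trans (norm_le_l1 x))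

end Main

end L1Witness


/-- Two-point functionals. -/
abbrev TwoPointCLM : Type := 𝓢((Fin 2 → E4), ℂ) →L[ℂ] ℂ

/-! ## §F Free-field UV calibration in `d = 4` (support for §D and for provers' Gaussian checks):
`e^{-m‖x‖}/(4π²‖x‖²) ≤ G_m(x) ≤ 1/(4π²‖x‖²)` for the tree's free propagator kernel
`G_m(x) = ∫₀^∞ e^{-m²t} p_t(x) dt`, hence `s² G_m(s w) → (4π²‖w‖²)⁻¹` uniformly on annuli. -/

namespace FreeKernel

open Real Literature.Analysis.UnboundedOperators

theorem finrank_E4 : Module.finrank ℝ E4 = 4 := by simp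

/-- The subordination integrand in `d = 4`: `φ_r(t) = (4πt)⁻² e^{-r²/(4t)}`. -/
def φ (r t : ℝ) : ℝ := ((4 * π * t) ^ 2)⁻¹ * Real.exp (-r ^ 2 / (4 * t))

/-- Its primitive `Φ_r(t) = e^{-r²/(4t)}/(4π²r²)` for `t > 0`, extended by `0`. -/
def Φ (r t : ℝ) : ℝ := if t ≤ 0 then 0 else Real.exp (-r ^ 2 / (4 * t)) / (4 * π ^ 2 * r ^ 2)

theorem Φ_of_pos (r : ℝ) {t : ℝ} (ht : 0 < t) :
    Φ r t = Real.exp (-r ^ 2 / (4 * t)) / (4 * π ^ 2 * r ^ 2) := by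
  simp [Φ, not_le.2 ht]

theorem Φ_zero (r : ℝ) : Φ r 0 = 0 := by simp [Φ]

/-- The heat kernel on `ℝ⁴`: `p_t(x) = (4πt)⁻² e^{-‖x‖²/(4t)}`. -/
theorem heatKernel_E4 {t : ℝ} (ht : 0 < t) (x : E4) : heatKernel t x = φ ‖x‖ t := by
  unfold heatKernel φ
  rw [finrank_E4]
  congr 1
  have h4 : (0 : ℝ) ≤ 4 * π * t := by positivity
  rw [show (-((4 : ℕ) : ℝ) / 2) = -(2 : ℝ) by norm_num, Real.rpow_neg h4, Real.rpow_two]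

theorem φ_nonneg (r t : ℝ) : 0 ≤ φ r t := by unfold φ; positivity

theorem hasDerivAt_Φ {r t : ℝ} (hr : r ≠ 0) (ht : 0 < t) : HasDerivAt (Φ r) (φ r t) t := by
  have hΦ : (Φ r) =ᶠ[𝓝 t] fun s => Real.exp (-r ^ 2 / (4 * s)) / (4 * π ^ 2 * r ^ 2) := by
    filter_upwards [Ioi_mem_nhds ht] with s hs
    exact Φ_of_pos r hs
  refine HasDerivAt.congr_of_eventuallyEq ?_ hΦ
  -- derivative of the explicit formula
  have h1 : HasDerivAt (fun s : ℝ => -r ^ 2 / (4 * s)) (r ^ 2 / (4 * t ^ 2)) t := by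
    have h := ((hasDerivAt_inv ht.ne').const_mul (-r ^ 2 / 4))
    have heq : (fun s : ℝ => -r ^ 2 / (4 * s)) = fun y => -r ^ 2 / 4 * y⁻¹ := by
      funext s; ring
    rw [heq]
    refine h.congr_deriv ?_
    field_simp
  have h2 := (h1.exp).div_const (4 * π ^ 2 * r ^ 2)
  refine h2.congr_deriv ?_
  unfold φ
  field_simp

theorem tendsto_exp_neg_div_nhdsGT (r : ℝ) (hr : r ≠ 0) :
    Tendsto (fun t : ℝ => Real.exp (-r ^ 2 / (4 * t))) (𝓝[>] 0) (𝓝 0) := by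
  have hc : 0 < r ^ 2 / 4 := by positivity
  have h1 : Tendsto (fun t : ℝ => r ^ 2 / 4 * t⁻¹) (𝓝[>] 0) atTop :=
    tendsto_inv_nhdsGT_zero.const_mul_atTop hc
  have h2 : Tendsto (fun t : ℝ => -(r ^ 2 / 4 * t⁻¹)) (𝓝[>] 0) atBot :=
    tendsto_neg_atTop_atBot.comp h1
  have h3 := Real.tendsto_exp_atBot.comp h2
  refine h3.congr' ?_
  filter_upwards [self_mem_nhdsWithin] with t ht
  simp only [Function.comp_apply]
  congr 1
  rw [mem_Ioi] at ht
  field_simp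

theorem continuousWithinAt_Φ_zero (r : ℝ) (hr : r ≠ 0) : ContinuousWithinAt (Φ r) (Ici 0) 0 := by
  rw [← Ioi_insert, continuousWithinAt_insert_self]
  show Tendsto (Φ r) (𝓝[>] 0) (𝓝 (Φ r 0))
  rw [Φ_zero]
  have h := (tendsto_exp_neg_div_nhdsGT r hr).div_const (4 * π ^ 2 * r ^ 2)
  rw [zero_div] at h
  refine h.congr' ?_
  filter_upwards [self_mem_nhdsWithin] with t ht
  exact (Φ_of_pos r ht).symm

theorem continuousWithinAt_Φ {r a : ℝ} (hr : r ≠ 0) (ha : 0 ≤ a) :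
    ContinuousWithinAt (Φ r) (Ici a) a := by
  rcases ha.eq_or_lt with rfl | ha'
  · exact continuousWithinAt_Φ_zero r hr
  · exact (hasDerivAt_Φ hr ha').continuousAt.continuousWithinAt

theorem tendsto_Φ_atTop (r : ℝ) (hr : r ≠ 0) :
    Tendsto (Φ r) atTop (𝓝 (1 / (4 * π ^ 2 * r ^ 2))) := by
  have h1 : Tendsto (fun t : ℝ => -r ^ 2 / 4 * t⁻¹) atTop (𝓝 (-r ^ 2 / 4 * 0)) :=
    tendsto_inv_atTop_zero.const_mul _
  rw [mul_zero] at h1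
  have h2 : Tendsto (fun t : ℝ => Real.exp (-r ^ 2 / 4 * t⁻¹)) atTop (𝓝 1) := by
    simpa [Function.comp_def] using (Real.continuous_exp.tendsto 0).comp h1
  have h3 := h2.div_const (4 * π ^ 2 * r ^ 2)
  refine h3.congr' ?_
  filter_upwards [eventually_gt_atTop 0] with t ht
  rw [Φ_of_pos r ht]
  congr 2
  field_simp

/-- `∫_a^∞ φ_r = 1/(4π²r²) − Φ_r(a)` for `a ≥ 0`, and `φ_r` is integrable there. -/
theorem integral_φ_Ioi {r a : ℝ} (hr : r ≠ 0) (ha : 0 ≤ a) :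
    ∫ t in Ioi a, φ r t = 1 / (4 * π ^ 2 * r ^ 2) - Φ r a :=
  integral_Ioi_of_hasDerivAt_of_nonneg (continuousWithinAt_Φ hr ha)
    (fun _ ht => hasDerivAt_Φ hr (ha.trans_lt ht)) (fun t _ => φ_nonneg r t) (tendsto_Φ_atTop r hr)

theorem integrableOn_φ_Ioi {r a : ℝ} (hr : r ≠ 0) (ha : 0 ≤ a) :
    IntegrableOn (φ r) (Ioi a) :=
  integrableOn_Ioi_deriv_of_nonneg (continuousWithinAt_Φ hr ha)
    (fun _ ht => hasDerivAt_Φ hr (ha.trans_lt ht)) (fun t _ => φ_nonneg r t) (tendsto_Φ_atTop r hr)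

/-- `∫₀^T φ_r = Φ_r(T)`. -/
theorem integral_φ_Ioc {r T : ℝ} (hr : r ≠ 0) (hT : 0 < T) :
    ∫ t in Ioc 0 T, φ r t = Φ r T := by
  have hu : Ioc 0 T ∪ Ioi T = Ioi 0 := Ioc_union_Ioi_eq_Ioi hT.le
  have hdisj : Disjoint (Ioc 0 T) (Ioi T) := fun s h1 h2 x hx => by
    have a := h1 hx; have b := h2 hx
    exact absurd (mem_Ioc.1 a).2 (not_le.2 (mem_Ioi.1 b))
  have hint := integrableOn_φ_Ioi hr le_rfl (a := 0)
  have h := setIntegral_union hdisj measurableSet_Ioi (hint.mono_set (by rw [← hu]; exact subset_union_left))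
    (hint.mono_set (by rw [← hu]; exact subset_union_right))
  rw [hu, integral_φ_Ioi hr le_rfl, integral_φ_Ioi hr hT.le, Φ_zero] at h
  linarith

/-- The free propagator kernel of mass `m` on `ℝ⁴` (tree convention, written out). -/
def G (m : ℝ) (x : E4) : ℝ := ∫ t in Ioi (0 : ℝ), Real.exp (-m ^ 2 * t) * heatKernel t x

theorem G_eq (m : ℝ) (x : E4) : G m x = ∫ t in Ioi (0 : ℝ), Real.exp (-m ^ 2 * t) * φ ‖x‖ t :=
  setIntegral_congr_fun measurableSet_Ioi fun t ht => by rw [heatKernel_E4 (mem_Ioi.1 ht)]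

/-- **Upper bound** `G_m(x) ≤ 1/(4π²‖x‖²)` (`x ≠ 0`). -/
theorem G_le {m : ℝ} {x : E4} (hx : x ≠ 0) : G m x ≤ 1 / (4 * π ^ 2 * ‖x‖ ^ 2) := by
  have hr : ‖x‖ ≠ 0 := norm_ne_zero_iff.2 hx
  have h : ∫ t in Ioi 0, φ ‖x‖ t = 1 / (4 * π ^ 2 * ‖x‖ ^ 2) := by
    rw [integral_φ_Ioi hr le_rfl, Φ_zero, sub_zero]
  rw [G_eq, ← h]
  refine setIntegral_mono_on ?_ (integrableOn_φ_Ioi hr le_rfl) measurableSet_Ioi fun t ht => ?_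
  · refine (integrableOn_φ_Ioi hr le_rfl).mono' ?_ ?_
    · exact ((Real.continuous_exp.comp (continuous_const.mul continuous_id)).aestronglyMeasurable).mul
        (integrableOn_φ_Ioi hr le_rfl).aestronglyMeasurable
    · refine (ae_restrict_iff' measurableSet_Ioi).2 (ae_of_all _ fun t ht => ?_)
      rw [Real.norm_eq_abs, abs_mul, abs_of_nonneg (Real.exp_pos _).le, abs_of_nonneg (φ_nonneg _ _)]
      refine mul_le_of_le_one_left (φ_nonneg _ _) ?_
      rw [Real.exp_le_one_iff]
      nlinarith [mem_Ioi.1 ht, sq_nonneg m]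
  · refine mul_le_of_le_one_left (φ_nonneg _ _) ?_
    rw [Real.exp_le_one_iff]
    nlinarith [mem_Ioi.1 ht, sq_nonneg m]

/-- **Lower bound** `e^{-m‖x‖}/(4π²‖x‖²) ≤ G_m(x)` (`0 < m`, `x ≠ 0`). -/
theorem G_ge {m : ℝ} (hm : 0 < m) {x : E4} (hx : x ≠ 0) :
    Real.exp (-(m * ‖x‖)) / (4 * π ^ 2 * ‖x‖ ^ 2) ≤ G m x := by
  set r := ‖x‖ with hrdef
  have hr0 : 0 < r := norm_pos_iff.2 hx
  have hr : r ≠ 0 := hr0.ne'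
  set T := r / (2 * m) with hT
  have hT0 : 0 < T := by positivity
  -- restrict to (0, T]
  have hint : IntegrableOn (fun t => Real.exp (-m ^ 2 * t) * φ r t) (Ioi 0) := by
    refine (integrableOn_φ_Ioi hr le_rfl).mono' ?_ ?_
    · exact ((Real.continuous_exp.comp (continuous_const.mul continuous_id)).aestronglyMeasurable).mul
        (integrableOn_φ_Ioi hr le_rfl).aestronglyMeasurable
    · refine (ae_restrict_iff' measurableSet_Ioi).2 (ae_of_all _ fun t ht => ?_)
      rw [Real.norm_eq_abs, abs_mul, abs_of_nonneg (Real.exp_pos _).le, abs_of_nonneg (φ_nonneg _ _)]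
      refine mul_le_of_le_one_left (φ_nonneg _ _) ?_
      rw [Real.exp_le_one_iff]
      nlinarith [mem_Ioi.1 ht, sq_nonneg m]
  have step1 : ∫ t in Ioc 0 T, Real.exp (-m ^ 2 * t) * φ r t ≤ G m x := by
    rw [G_eq]
    exact setIntegral_mono_set hint
      (Eventually.of_forall fun t => mul_nonneg (Real.exp_pos _).le (φ_nonneg _ _))
      Ioc_subset_Ioi_self.eventuallyLE
  have step2 : Real.exp (-m ^ 2 * T) * Φ r T ≤ ∫ t in Ioc 0 T, Real.exp (-m ^ 2 * t) * φ r t := by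
    rw [← integral_φ_Ioc hr hT0, ← integral_const_mul]  -- ∫ e^{-m²T} φ
    refine setIntegral_mono_on ?_ (hint.mono_set Ioc_subset_Ioi_self) measurableSet_Ioc fun t ht => ?_
    · exact ((integrableOn_φ_Ioi hr le_rfl).mono_set Ioc_subset_Ioi_self).const_mul _
    · refine mul_le_mul_of_nonneg_right ?_ (φ_nonneg _ _)
      exact Real.exp_le_exp.2 (by nlinarith [(mem_Ioc.1 ht).2, sq_nonneg m])
  have step3 : Real.exp (-m ^ 2 * T) * Φ r T = Real.exp (-(m * r)) / (4 * π ^ 2 * r ^ 2) := by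
    rw [Φ_of_pos r hT0, mul_div_assoc', ← Real.exp_add]
    congr 2
    rw [hT]; field_simp; ring
  linarith [step1, step2, step3.symm.le, step3.le]


/-- **Uniform free-field asymptotics on annuli**: `|s² G_m(s w) − 1/(4π²‖w‖²)| ≤ m s/(4π²‖w‖)`
(`0 < m`, `w ≠ 0`, `0 < s`): `s² G_m(s·)` converges to the massless kernel `(4π²‖w‖²)⁻¹`
uniformly on `{‖w‖ ≥ δ}` at rate `O(s)`. -/
theorem abs_sq_mul_G_smul_sub_le {m : ℝ} (hm : 0 < m) {w : E4} (hw : w ≠ 0) {s : ℝ} (hs : 0 < s) :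
    |s ^ 2 * G m (s • w) - 1 / (4 * π ^ 2 * ‖w‖ ^ 2)| ≤ m * s / (4 * π ^ 2 * ‖w‖) := by
  have hsw : s • w ≠ 0 := smul_ne_zero hs.ne' hw
  have h1 := G_le (m := m) hsw
  have h2 := G_ge hm hsw
  rw [norm_smul, Real.norm_of_nonneg hs.le] at h1 h2
  have hr : 0 < ‖w‖ := norm_pos_iff.2 hw
  have key_up : s ^ 2 * G m (s • w) ≤ 1 / (4 * π ^ 2 * ‖w‖ ^ 2) := by
    calc s ^ 2 * G m (s • w) ≤ s ^ 2 * (1 / (4 * π ^ 2 * (s * ‖w‖) ^ 2)) := by gcongr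
      _ = 1 / (4 * π ^ 2 * ‖w‖ ^ 2) := by field_simp
  have key_lo : Real.exp (-(m * (s * ‖w‖))) / (4 * π ^ 2 * ‖w‖ ^ 2) ≤ s ^ 2 * G m (s • w) := by
    calc Real.exp (-(m * (s * ‖w‖))) / (4 * π ^ 2 * ‖w‖ ^ 2)
        = s ^ 2 * (Real.exp (-(m * (s * ‖w‖))) / (4 * π ^ 2 * (s * ‖w‖) ^ 2)) := by
          field_simp
      _ ≤ s ^ 2 * G m (s • w) := by gcongr
  have hexp : 1 - Real.exp (-(m * (s * ‖w‖))) ≤ m * (s * ‖w‖) := by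
    have := Real.add_one_le_exp (-(m * (s * ‖w‖)))
    linarith
  rw [abs_sub_le_iff]
  constructor
  · have : 0 ≤ m * s / (4 * π ^ 2 * ‖w‖) := by positivity
    linarith
  · calc 1 / (4 * π ^ 2 * ‖w‖ ^ 2) - s ^ 2 * G m (s • w)
        ≤ 1 / (4 * π ^ 2 * ‖w‖ ^ 2) - Real.exp (-(m * (s * ‖w‖))) / (4 * π ^ 2 * ‖w‖ ^ 2) := by
          linarith
      _ = (1 - Real.exp (-(m * (s * ‖w‖)))) / (4 * π ^ 2 * ‖w‖ ^ 2) := by ring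
      _ ≤ m * (s * ‖w‖) / (4 * π ^ 2 * ‖w‖ ^ 2) := by gcongr
      _ = m * s / (4 * π ^ 2 * ‖w‖) := by field_simp


end FreeKernel

/-- `G_m ≥ 0`. -/
theorem FreeKernel.G_nonneg (m : ℝ) (x : E4) : 0 ≤ FreeKernel.G m x :=
  setIntegral_nonneg measurableSet_Ioi fun _ ht =>
    mul_nonneg (Real.exp_pos _).le (Literature.Analysis.UnboundedOperators.heatKernel_pos (mem_Ioi.1 ht) x).le

/-- `G_m` is strongly measurable. -/
theorem FreeKernel.stronglyMeasurable_G (m : ℝ) : StronglyMeasurable (FreeKernel.G m) := by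
  have hmeas : Measurable fun p : E4 × ℝ =>
      Real.exp (-m ^ 2 * p.2) * Literature.Analysis.UnboundedOperators.heatKernel p.2 p.1 := by
    unfold Literature.Analysis.UnboundedOperators.heatKernel; fun_prop
  exact hmeas.stronglyMeasurable.integral_prod_right' (ν := volume.restrict (Ioi (0 : ℝ)))


section T0

open Real

/-- `u ↦ G_m(u₀-u₁) (1+‖u₁‖)⁻⁵` is integrable on `(ℝ⁴)²` (`‖G_m‖₁ < ∞`, `5 > 4`). -/
theorem integrable_G_mul_weight {m : ℝ} (hm : m ≠ 0) :
    Integrable (fun u : Fin 2 → E4 => FreeKernel.G m (u 0 - u 1) * (1 + ‖u 1‖) ^ (-(5 : ℝ))) := by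
  have hG : Integrable (FreeKernel.G m) := by
    unfold FreeKernel.G
    exact Literature.MathematicalPhysics.QuantumFieldTheory.integrable_freeKernel hm
  set f : E4 × E4 → ℝ := fun p => FreeKernel.G m (p.1 - p.2) * (1 + ‖p.2‖) ^ (-(5 : ℝ)) with hfdef
  have hmeasf : AEStronglyMeasurable f (volume.prod volume) := by
    refine (Measurable.aestronglyMeasurable ?_)
    have h1 : Measurable fun p : E4 × E4 => FreeKernel.G m (p.1 - p.2) :=
      (FreeKernel.stronglyMeasurable_G m).measurable.comp (measurable_fst.sub measurable_snd)
    have h2 : Measurable fun p : E4 × E4 => (1 + ‖p.2‖) ^ (-(5 : ℝ)) := by fun_prop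
    exact h1.mul h2
  have hprod : Integrable f (volume.prod volume) := by
    rw [integrable_prod_iff' hmeasf]
    constructor
    · refine Eventually.of_forall fun y => ?_
      show Integrable (fun x : E4 => FreeKernel.G m (x - y) * (1 + ‖y‖) ^ (-(5 : ℝ)))
      exact (hG.comp_sub_right y).mul_const _
    · have heq : (fun y : E4 => ∫ x, ‖f (x, y)‖) =
          fun y => (∫ x, FreeKernel.G m x) * (1 + ‖y‖) ^ (-(5 : ℝ)) := by
        funext y
        have hw : 0 ≤ (1 + ‖y‖) ^ (-(5 : ℝ)) := rpow_nonneg (by positivity) _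
        have h1 : (fun x => ‖f (x, y)‖) = fun x => FreeKernel.G m (x - y) * (1 + ‖y‖) ^ (-(5 : ℝ)) := by
          funext x
          rw [hfdef]
          simp only [norm_mul, Real.norm_of_nonneg (FreeKernel.G_nonneg m _), Real.norm_of_nonneg hw]
        rw [h1, integral_mul_const, integral_sub_right_eq_self (FreeKernel.G m) y]
      rw [heq]
      have h5 : (Module.finrank ℝ E4 : ℝ) < 5 := by rw [FreeKernel.finrank_E4]; norm_num
      exact (integrable_one_add_norm h5).const_mul _
  have hmp := MeasureTheory.volume_preserving_finTwoArrow E4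
  have hcomp : (fun u : Fin 2 → E4 => FreeKernel.G m (u 0 - u 1) * (1 + ‖u 1‖) ^ (-(5 : ℝ))) =
      f ∘ MeasurableEquiv.finTwoArrow := by
    funext u; rfl
  rw [hcomp]
  exact (hmp.integrable_comp_emb (MeasurableEquiv.finTwoArrow).measurableEmbedding).2 hprod

/-- The `L¹`-type constant of the free two-point functional. -/
def T0const (m : ℝ) : ℝ :=
  2 ^ 5 * ∫ u : Fin 2 → E4, FreeKernel.G m (u 0 - u 1) * (1 + ‖u 1‖) ^ (-(5 : ℝ))

theorem T0const_nonneg (m : ℝ) : 0 ≤ T0const m := by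
  unfold T0const
  refine mul_nonneg (by norm_num) (integral_nonneg fun u => ?_)
  exact mul_nonneg (FreeKernel.G_nonneg _ _) (rpow_nonneg (by positivity) _)

/-- The controlling Schwartz seminorm (decay of order `5`, no derivatives). -/
def semi5 : Seminorm ℂ 𝓢((Fin 2 → E4), ℂ) :=
  (Finset.Iic ((5 : ℕ), (0 : ℕ))).sup (schwartzSeminormFamily ℂ (Fin 2 → E4) ℂ)

theorem norm_le_semi5 (F : 𝓢((Fin 2 → E4), ℂ)) (u : Fin 2 → E4) :
    (1 + ‖u‖) ^ 5 * ‖F u‖ ≤ 2 ^ 5 * semi5 F := by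
  have h := SchwartzMap.one_add_le_sup_seminorm_apply (𝕜 := ℂ) (m := ((5 : ℕ), (0 : ℕ)))
    (k := 5) (n := 0) le_rfl le_rfl F u
  rw [norm_iteratedFDeriv_zero] at h
  exact h

/-- Schwartz decay in the second variable, controlled by `semi5`. -/
theorem norm_schwartz_le_weight (F : 𝓢((Fin 2 → E4), ℂ)) (u : Fin 2 → E4) :
    ‖F u‖ ≤ 2 ^ 5 * semi5 F * (1 + ‖u 1‖) ^ (-(5 : ℝ)) := by
  have h := norm_le_semi5 F u
  have hS0 : 0 ≤ semi5 F := apply_nonneg _ _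
  have hpos1 : 0 < 1 + ‖u 1‖ := by positivity
  have hpos : 0 < 1 + ‖u‖ := by positivity
  have hle : 1 + ‖u 1‖ ≤ 1 + ‖u‖ := by linarith [norm_le_pi_norm u 1]
  have hrpow : (1 + ‖u 1‖) ^ (-(5 : ℝ)) = ((1 + ‖u 1‖) ^ 5)⁻¹ := by
    rw [Real.rpow_neg hpos1.le, show (5 : ℝ) = ((5 : ℕ) : ℝ) by norm_num, Real.rpow_natCast]
  rw [hrpow]
  have h1 : ‖F u‖ ≤ 2 ^ 5 * semi5 F * ((1 + ‖u‖) ^ 5)⁻¹ := by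
    rw [← div_eq_mul_inv, le_div_iff₀ (by positivity)]
    linarith [h]
  refine h1.trans (mul_le_mul_of_nonneg_left ?_ (by positivity))
  apply inv_anti₀ (by positivity)
  exact pow_le_pow_left₀ hpos1.le hle 5

theorem aestronglyMeasurable_G_mul_schwartz (m : ℝ) (F : 𝓢((Fin 2 → E4), ℂ)) :
    AEStronglyMeasurable (fun u : Fin 2 → E4 => (FreeKernel.G m (u 0 - u 1) : ℂ) * F u) volume := by
  have h1 : Measurable fun u : Fin 2 → E4 => u 0 - u 1 := by fun_prop
  exact ((Complex.continuous_ofReal.measurable.comp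
    ((FreeKernel.stronglyMeasurable_G m).measurable.comp h1)).aestronglyMeasurable).mul
    F.continuous.aestronglyMeasurable

theorem norm_G_mul_schwartz_le (m : ℝ) (F : 𝓢((Fin 2 → E4), ℂ)) (u : Fin 2 → E4) :
    ‖(FreeKernel.G m (u 0 - u 1) : ℂ) * F u‖ ≤
      2 ^ 5 * semi5 F * (FreeKernel.G m (u 0 - u 1) * (1 + ‖u 1‖) ^ (-(5 : ℝ))) := by
  rw [norm_mul, Complex.norm_real, Real.norm_of_nonneg (FreeKernel.G_nonneg _ _)]
  have := mul_le_mul_of_nonneg_left (norm_schwartz_le_weight F u) (FreeKernel.G_nonneg m (u 0 - u 1))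
  linarith [this]

/-- Integrability of `u ↦ G_m(u₀-u₁) F(u)`. -/
theorem integrable_G_mul_schwartz {m : ℝ} (hm : m ≠ 0) (F : 𝓢((Fin 2 → E4), ℂ)) :
    Integrable (fun u : Fin 2 → E4 => (FreeKernel.G m (u 0 - u 1) : ℂ) * F u) :=
  Integrable.mono' ((integrable_G_mul_weight hm).const_mul _) (aestronglyMeasurable_G_mul_schwartz m F)
    (Eventually.of_forall (norm_G_mul_schwartz_le m F))

/-- The seminorm bound of `F ↦ ∫ G_m(u₀-u₁) F(u) du`. -/
theorem norm_integral_G_mul_schwartz_le {m : ℝ} (hm : m ≠ 0) (F : 𝓢((Fin 2 → E4), ℂ)) :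
    ‖∫ u, (FreeKernel.G m (u 0 - u 1) : ℂ) * F u‖ ≤ T0const m * semi5 F := by
  have hmaj : Integrable (fun u : Fin 2 → E4 =>
      2 ^ 5 * semi5 F * (FreeKernel.G m (u 0 - u 1) * (1 + ‖u 1‖) ^ (-(5 : ℝ)))) :=
    (integrable_G_mul_weight hm).const_mul _
  have h1 : ‖∫ u, (FreeKernel.G m (u 0 - u 1) : ℂ) * F u‖ ≤
      ∫ u : Fin 2 → E4, 2 ^ 5 * semi5 F * (FreeKernel.G m (u 0 - u 1) * (1 + ‖u 1‖) ^ (-(5 : ℝ))) :=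
    (norm_integral_le_integral_norm _).trans
      (integral_mono_of_nonneg (Eventually.of_forall fun _ => norm_nonneg _) hmaj
        (Eventually.of_forall (norm_G_mul_schwartz_le m F)))
  rw [integral_const_mul] at h1
  calc ‖∫ u, (FreeKernel.G m (u 0 - u 1) : ℂ) * F u‖
      ≤ 2 ^ 5 * semi5 F *
          ∫ (u : Fin 2 → E4), FreeKernel.G m (u 0 - u 1) * (1 + ‖u 1‖) ^ (-(5 : ℝ)) := h1
    _ = T0const m * semi5 F := by unfold T0const; ring

/-- **The free two-point functional** `T₀ F = ∫ G_m(u₀-u₁) F(u) du` as a continuous linear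
functional on two-point Schwartz space (`m ≠ 0`). -/
def T0 {m : ℝ} (hm : m ≠ 0) : TwoPointCLM :=
  SchwartzMap.mkCLMtoNormedSpace (𝕜 := ℂ) (σ := RingHom.id ℂ)
    (fun F => ∫ u, (FreeKernel.G m (u 0 - u 1) : ℂ) * F u)
    (fun F F' => by
      simp only [add_apply, mul_add]
      exact integral_add (integrable_G_mul_schwartz hm F) (integrable_G_mul_schwartz hm F'))
    (fun a F => by
      simp only [smul_apply, smul_eq_mul, RingHom.id_apply]
      rw [← integral_const_mul]
      congr 1; funext u; ring)
    ⟨Finset.Iic ((5 : ℕ), (0 : ℕ)), T0const m, T0const_nonneg m,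
      fun F => norm_integral_G_mul_schwartz_le hm F⟩

@[simp] theorem T0_apply {m : ℝ} (hm : m ≠ 0) (F : 𝓢((Fin 2 → E4), ℂ)) :
    T0 hm F = ∫ u, (FreeKernel.G m (u 0 - u 1) : ℂ) * F u := rfl


end T0

namespace GFF

open FreeKernel Literature.Analysis.UnboundedOperators

/-- Exponential upper bound for the free kernel: `G_m(x) ≤ e^{-m‖x‖/2} / (2π²‖x‖²)` (`x ≠ 0`; any real `m`),
from `m²t + ‖x‖²/(8t) ≥ m‖x‖/2` (AM–GM) under the subordination integral. -/
theorem G_le_exp (m : ℝ) {x : E4} (hx : x ≠ 0) :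
    G m x ≤ Real.exp (-(m * ‖x‖ / 2)) * (1 / (2 * π ^ 2 * ‖x‖ ^ 2)) := by
  set r := ‖x‖ with hr
  have hr0 : 0 < r := norm_pos_iff.2 hx
  have hr' : r / Real.sqrt 2 ≠ 0 := by positivity
  -- pointwise: e^{-m²t} φ_r(t) ≤ e^{-mr/2} φ_{r/√2}(t)
  have hpt : ∀ t ∈ Ioi (0 : ℝ), Real.exp (-m ^ 2 * t) * φ r t ≤
      Real.exp (-(m * r / 2)) * φ (r / Real.sqrt 2) t := by
    intro t ht
    have ht0 : 0 < t := mem_Ioi.1 ht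
    unfold φ
    have hsq : (r / Real.sqrt 2) ^ 2 = r ^ 2 / 2 := by
      rw [div_pow, Real.sq_sqrt (by norm_num : (0:ℝ) ≤ 2)]
    rw [hsq]
    have key : -m ^ 2 * t + -r ^ 2 / (4 * t) ≤ -(m * r / 2) + -(r ^ 2 / 2) / (4 * t) := by
      -- m²t + r²/(8t) ≥ m r / 2
      have h8 : m * r / 2 ≤ m ^ 2 * t + r ^ 2 / (8 * t) := by
        rw [← sub_nonneg]
        have : m ^ 2 * t + r ^ 2 / (8 * t) - m * r / 2 =
            (8 * m ^ 2 * t ^ 2 + r ^ 2 - 4 * m * r * t) / (8 * t) := by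
          field_simp
          ring
        rw [this]
        exact div_nonneg (by nlinarith [sq_nonneg (2 * m * t - r / 2)]) (by positivity)
      have e1 : -(r ^ 2 / 2) / (4 * t) = -(r ^ 2 / (8 * t)) := by
        field_simp
        ring
      have e2 : -r ^ 2 / (4 * t) = -(r ^ 2 / (8 * t)) - r ^ 2 / (8 * t) := by
        field_simp
        ring
      rw [e1, e2]
      linarith
    calc Real.exp (-m ^ 2 * t) * (((4 * π * t) ^ 2)⁻¹ * Real.exp (-r ^ 2 / (4 * t)))
        = ((4 * π * t) ^ 2)⁻¹ * Real.exp (-m ^ 2 * t + -r ^ 2 / (4 * t)) := by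
          rw [Real.exp_add]; ring
      _ ≤ ((4 * π * t) ^ 2)⁻¹ * Real.exp (-(m * r / 2) + -(r ^ 2 / 2) / (4 * t)) := by
          gcongr
      _ = Real.exp (-(m * r / 2)) * (((4 * π * t) ^ 2)⁻¹ * Real.exp (-(r ^ 2 / 2) / (4 * t))) := by
          rw [Real.exp_add]; ring
  have hint : IntegrableOn (fun t => Real.exp (-(m * r / 2)) * φ (r / Real.sqrt 2) t) (Ioi 0) :=
    (integrableOn_φ_Ioi hr' le_rfl).const_mul _
  calc G m x = ∫ t in Ioi (0 : ℝ), Real.exp (-m ^ 2 * t) * φ r t := G_eq m x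
    _ ≤ ∫ t in Ioi (0 : ℝ), Real.exp (-(m * r / 2)) * φ (r / Real.sqrt 2) t := by
        refine setIntegral_mono_on ?_ hint measurableSet_Ioi hpt
        refine hint.mono' ?_ ?_
        · exact ((Real.continuous_exp.comp (continuous_const.mul continuous_id)).aestronglyMeasurable).mul
            (integrableOn_φ_Ioi hr0.ne' le_rfl).aestronglyMeasurable
        · refine (ae_restrict_iff' measurableSet_Ioi).2 (ae_of_all _ fun t ht => ?_)
          rw [Real.norm_of_nonneg (mul_nonneg (Real.exp_pos _).le (φ_nonneg _ _))]
          exact hpt t ht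
    _ = Real.exp (-(m * r / 2)) * (1 / (4 * π ^ 2 * (r / Real.sqrt 2) ^ 2)) := by
        rw [integral_const_mul, integral_φ_Ioi hr' le_rfl, Φ_zero, sub_zero]
    _ = Real.exp (-(m * r / 2)) * (1 / (2 * π ^ 2 * r ^ 2)) := by
        rw [div_pow, Real.sq_sqrt (by norm_num : (0:ℝ) ≤ 2)]
        congr 1
        field_simp
        ring


/-! ### Generic Euler integrals `eul n a r = ∫_{t>a} tⁿ e^{-rt} dt` -/

/-- `tⁿ e^{-rt}`. -/
def eint (n : ℕ) (r t : ℝ) : ℝ := t ^ n * Real.exp (-(r * t))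

/-- `eul n a r = ∫_{t>a} tⁿ e^{-rt} dt`. -/
def eul (n : ℕ) (a r : ℝ) : ℝ := ∫ t in Ioi a, eint n r t

theorem eint_nonneg (n : ℕ) (r : ℝ) {t : ℝ} (ht : 0 ≤ t) : 0 ≤ eint n r t :=
  mul_nonneg (pow_nonneg ht n) (Real.exp_pos _).le

theorem eint_eq_rpow (n : ℕ) (r t : ℝ) :
    eint n r t = t ^ (((n + 1 : ℕ) : ℝ) - 1) * Real.exp (-(r * t)) := by
  rw [eint, ← Real.rpow_natCast t n]
  push_cast
  ring_nf

theorem continuous_eint_uncurry (n : ℕ) : Continuous fun p : ℝ × ℝ => eint n p.1 p.2 := by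
  unfold eint; fun_prop

theorem continuous_eint (n : ℕ) (r : ℝ) : Continuous (eint n r) := by
  unfold eint; fun_prop

theorem integrableOn_eint_Ioi_zero (n : ℕ) {r : ℝ} (hr : 0 < r) : IntegrableOn (eint n r) (Ioi 0) := by
  have hn : (0 : ℝ) < ((n + 1 : ℕ) : ℝ) := by positivity
  have h : IntegrableOn (fun t : ℝ => t ^ (((n + 1 : ℕ) : ℝ) - 1) * Real.exp (-(r * t))) (Ioi 0) := by
    refine Integrable.of_integral_ne_zero ?_
    rw [Real.integral_rpow_mul_exp_neg_mul_Ioi hn hr]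
    exact (mul_pos (by positivity) (Real.Gamma_pos_of_pos hn)).ne'
  exact h.congr_fun (fun t _ => (eint_eq_rpow n r t).symm) measurableSet_Ioi

theorem integrableOn_eint (n : ℕ) {a r : ℝ} (ha : 0 ≤ a) (hr : 0 < r) : IntegrableOn (eint n r) (Ioi a) :=
  (integrableOn_eint_Ioi_zero n hr).mono_set (Ioi_subset_Ioi ha)

theorem eul_nonneg (n : ℕ) {a : ℝ} (ha : 0 ≤ a) (r : ℝ) : 0 ≤ eul n a r :=
  setIntegral_nonneg measurableSet_Ioi fun _ ht => eint_nonneg n r (ha.trans (le_of_lt ht))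

/-- `eul n a r ≤ n! / r^{n+1}` (the full Euler integral). -/
theorem eul_le (n : ℕ) {a r : ℝ} (ha : 0 ≤ a) (hr : 0 < r) :
    eul n a r ≤ Nat.factorial n * r⁻¹ ^ (n + 1) := by
  have hn : (0 : ℝ) < ((n + 1 : ℕ) : ℝ) := by positivity
  calc eul n a r ≤ ∫ t in Ioi (0 : ℝ), eint n r t :=
        setIntegral_mono_set (integrableOn_eint_Ioi_zero n hr)
          (ae_restrict_of_forall_mem measurableSet_Ioi fun t ht => eint_nonneg n r (le_of_lt ht))
          (Eventually.of_forall (Ioi_subset_Ioi ha))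
    _ = ∫ t in Ioi (0 : ℝ), t ^ (((n + 1 : ℕ) : ℝ) - 1) * Real.exp (-(r * t)) :=
        setIntegral_congr_fun measurableSet_Ioi fun t _ => eint_eq_rpow n r t
    _ = (1 / r) ^ (((n + 1 : ℕ) : ℝ)) * Real.Gamma ((n + 1 : ℕ) : ℝ) :=
        Real.integral_rpow_mul_exp_neg_mul_Ioi hn hr
    _ = Nat.factorial n * r⁻¹ ^ (n + 1) := by
        rw [Real.rpow_natCast, show (((n + 1 : ℕ) : ℝ)) = (n : ℝ) + 1 by push_cast; ring,
          Real.Gamma_nat_eq_factorial, one_div]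
        ring

/-- `e⁻² / r^{n+1} ≤ eul n a r` for `0 < r` and `a ≤ 1/r` (the window `t ∈ (1/r, 2/r]`). -/
theorem eul_ge (n : ℕ) {a r : ℝ} (ha : 0 ≤ a) (hr : 0 < r) (har : a ≤ r⁻¹) :
    Real.exp (-2) * r⁻¹ ^ (n + 1) ≤ eul n a r := by
  have hsub : Ioc r⁻¹ (2 * r⁻¹) ⊆ Ioi a := fun t ht => mem_Ioi.2 (lt_of_le_of_lt har (mem_Ioc.1 ht).1)
  have hconst : ∀ t ∈ Ioc r⁻¹ (2 * r⁻¹), Real.exp (-2) * r⁻¹ ^ n ≤ eint n r t := by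
    intro t ht
    have ht1 : r⁻¹ ≤ t := (mem_Ioc.1 ht).1.le
    have ht0 : 0 ≤ t := le_trans (by positivity) ht1
    have hrt : r * t ≤ 2 := by
      have := mul_le_mul_of_nonneg_left (mem_Ioc.1 ht).2 hr.le
      rwa [show r * (2 * r⁻¹) = 2 by field_simp] at this
    calc Real.exp (-2) * r⁻¹ ^ n = r⁻¹ ^ n * Real.exp (-2) := mul_comm _ _
      _ ≤ t ^ n * Real.exp (-(r * t)) :=
          mul_le_mul (pow_le_pow_left₀ (by positivity) ht1 n) (Real.exp_le_exp.2 (by linarith))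
            (Real.exp_pos _).le (pow_nonneg ht0 n)
  calc Real.exp (-2) * r⁻¹ ^ (n + 1) = (Real.exp (-2) * r⁻¹ ^ n) * (2 * r⁻¹ - r⁻¹) := by ring
    _ = ∫ _ in Ioc r⁻¹ (2 * r⁻¹), Real.exp (-2) * r⁻¹ ^ n := by
        rw [setIntegral_const, Real.volume_real_Ioc_of_le (by linarith [inv_pos.2 hr]), smul_eq_mul]
        ring
    _ ≤ ∫ t in Ioc r⁻¹ (2 * r⁻¹), eint n r t :=
        setIntegral_mono_on (integrableOn_const (by simp [Real.volume_Ioc]))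
          ((integrableOn_eint n ha hr).mono_set hsub) measurableSet_Ioc hconst
    _ ≤ eul n a r :=
        setIntegral_mono_set (integrableOn_eint n ha hr)
          (ae_restrict_of_forall_mem measurableSet_Ioi fun t ht =>
            eint_nonneg n r (ha.trans (le_of_lt ht)))
          (Eventually.of_forall hsub)

/-- `eul n a r ≤ e^{a(1-r)} · eul n a 1` for `r ≥ 1`, `a ≥ 0` (`rt ≥ t + a(r − 1)` for `t ≥ a`). -/
theorem eul_le_exp (n : ℕ) {a r : ℝ} (ha : 0 ≤ a) (hr : 1 ≤ r) :
    eul n a r ≤ Real.exp (a * (1 - r)) * eul n a 1 := by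
  have hpt : ∀ t ∈ Ioi a, eint n r t ≤ Real.exp (a * (1 - r)) * eint n 1 t := by
    intro t ht
    have hta : a ≤ t := le_of_lt ht
    have ht0 : 0 ≤ t := ha.trans hta
    unfold eint
    rw [mul_left_comm, ← Real.exp_add]
    gcongr
    nlinarith
  calc eul n a r ≤ ∫ t in Ioi a, Real.exp (a * (1 - r)) * eint n 1 t :=
        setIntegral_mono_on (integrableOn_eint n ha (by linarith)) ((integrableOn_eint n ha one_pos).const_mul _)
          measurableSet_Ioi hpt
    _ = Real.exp (a * (1 - r)) * eul n a 1 := by rw [integral_const_mul]; rfl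

theorem eint_antitone (n : ℕ) {r r' : ℝ} (h : r ≤ r') {t : ℝ} (ht : 0 ≤ t) : eint n r' t ≤ eint n r t := by
  unfold eint; gcongr

theorem eul_antitone (n : ℕ) {a r r' : ℝ} (ha : 0 ≤ a) (hr : 0 < r) (h : r ≤ r') : eul n a r' ≤ eul n a r :=
  setIntegral_mono_on (integrableOn_eint n ha (hr.trans_le h)) (integrableOn_eint n ha hr) measurableSet_Ioi
    fun _ ht => eint_antitone n h (ha.trans (le_of_lt ht))


/-! ### The free kernel: radiality, monotonicity, continuity off `0`, measurability -/

theorem G_eq_of_norm_eq {m : ℝ} {x y : E4} (h : ‖x‖ = ‖y‖) : G m x = G m y := by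
  rw [G_eq, G_eq, h]

theorem G_isometry (m : ℝ) (R : E4 ≃ₗᵢ[ℝ] E4) (x : E4) : G m (R x) = G m x :=
  G_eq_of_norm_eq (R.norm_map x)

theorem G_neg (m : ℝ) (x : E4) : G m (-x) = G m x := G_eq_of_norm_eq (norm_neg x)

theorem φ_antitone {r r' : ℝ} (hr : 0 ≤ r) (h : r ≤ r') {t : ℝ} (ht : 0 < t) : φ r' t ≤ φ r t := by
  unfold φ
  gcongr

theorem integrableOn_expφ {m r : ℝ} (hr : r ≠ 0) :
    IntegrableOn (fun t => Real.exp (-m ^ 2 * t) * φ r t) (Ioi 0) := by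
  refine (integrableOn_φ_Ioi hr le_rfl).mono' ?_ ?_
  · exact ((Real.continuous_exp.comp (continuous_const.mul continuous_id)).aestronglyMeasurable).mul
      (integrableOn_φ_Ioi hr le_rfl).aestronglyMeasurable
  · refine (ae_restrict_iff' measurableSet_Ioi).2 (ae_of_all _ fun t ht => ?_)
    rw [Real.norm_eq_abs, abs_mul, abs_of_nonneg (Real.exp_pos _).le, abs_of_nonneg (φ_nonneg _ _)]
    refine mul_le_of_le_one_left (φ_nonneg _ _) ?_
    rw [Real.exp_le_one_iff]
    nlinarith [mem_Ioi.1 ht, sq_nonneg m]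

/-- `G_m` is radially non-increasing. -/
theorem G_antitone (m : ℝ) {x y : E4} (hx : x ≠ 0) (h : ‖x‖ ≤ ‖y‖) : G m y ≤ G m x := by
  have hy : y ≠ 0 := by
    intro h0; rw [h0, norm_zero] at h; exact hx (norm_eq_zero.1 (le_antisymm h (norm_nonneg _)))
  rw [G_eq, G_eq]
  refine setIntegral_mono_on (integrableOn_expφ (norm_ne_zero_iff.2 hy)) (integrableOn_expφ (norm_ne_zero_iff.2 hx))
    measurableSet_Ioi fun t ht => ?_
  exact mul_le_mul_of_nonneg_left (φ_antitone (norm_nonneg _) h (mem_Ioi.1 ht)) (Real.exp_pos _).le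

/-- `G_m` is continuous off the origin (dominated convergence under the subordination integral). -/
theorem continuousOn_G (m : ℝ) : ContinuousOn (G m) {x : E4 | x ≠ 0} := by
  intro x₀ hx₀
  have hρ : 0 < ‖x₀‖ / 2 := half_pos (norm_pos_iff.2 hx₀)
  set ρ := ‖x₀‖ / 2 with hρdef
  set U : Set E4 := {x | ρ < ‖x‖} with hU
  have hUopen : IsOpen U := isOpen_lt continuous_const continuous_norm
  have hx₀U : x₀ ∈ U := by show ρ < ‖x₀‖; rw [hρdef]; linarith [norm_pos_iff.2 hx₀]
  have hcont : ContinuousOn (G m) U := by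
    have hGU : ∀ x ∈ U, G m x = ∫ t in Ioi (0 : ℝ), Real.exp (-m ^ 2 * t) * φ ‖x‖ t := fun x _ => G_eq m x
    refine ContinuousOn.congr ?_ hGU
    refine continuousOn_of_dominated (F := fun x t => Real.exp (-m ^ 2 * t) * φ ‖x‖ t)
      (bound := fun t => φ ρ t) (μ := volume.restrict (Ioi (0 : ℝ))) ?_ ?_ ?_ ?_
    · intro x _
      exact (Measurable.mul (by fun_prop) (by unfold φ; fun_prop : Measurable fun t => φ ‖x‖ t)).aestronglyMeasurable
    · intro x hx
      refine ae_restrict_of_forall_mem measurableSet_Ioi fun t ht => ?_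
      rw [Real.norm_of_nonneg (mul_nonneg (Real.exp_pos _).le (φ_nonneg _ _))]
      calc Real.exp (-m ^ 2 * t) * φ ‖x‖ t ≤ 1 * φ ‖x‖ t := by
            refine mul_le_mul_of_nonneg_right ?_ (φ_nonneg _ _)
            rw [Real.exp_le_one_iff]; nlinarith [mem_Ioi.1 ht, sq_nonneg m]
        _ = φ ‖x‖ t := one_mul _
        _ ≤ φ ρ t := φ_antitone hρ.le (le_of_lt hx) (mem_Ioi.1 ht)
    · exact integrableOn_φ_Ioi hρ.ne' le_rfl
    · refine ae_restrict_of_forall_mem measurableSet_Ioi fun t ht => ?_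
      have ht0 : (4 * π * t) ^ 2 ≠ 0 := by have := mem_Ioi.1 ht; positivity
      have : Continuous fun x : E4 => Real.exp (-m ^ 2 * t) * φ ‖x‖ t := by
        unfold φ
        exact continuous_const.mul ((continuous_const).mul (Real.continuous_exp.comp
          ((continuous_norm.pow 2).neg.div_const _)))
      exact this.continuousOn
  exact (hcont.continuousAt (hUopen.mem_nhds hx₀U)).continuousWithinAt

/-- Joint measurability of `(m, x) ↦ G_m(x)`. -/
theorem measurable_G_uncurry : Measurable fun p : ℝ × E4 => G p.1 p.2 := by
  have hmeas : Measurable fun q : (ℝ × E4) × ℝ =>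
      Real.exp (-q.1.1 ^ 2 * q.2) * heatKernel q.2 q.1.2 := by
    unfold heatKernel; fun_prop
  exact (hmeas.stronglyMeasurable.integral_prod_right' (ν := volume.restrict (Ioi (0 : ℝ)))).measurable

/-! ### The dimension-5 generalised free field kernel `K₅(w) = ∫_{μ>2} μ⁷ G_μ(w) dμ` -/

/-- The Källén–Lehmann integrand `μ⁷ G_μ(w)` (spectral weight `ρ(μ²) dμ² ∝ μ⁷ dμ`, dimension `5`). -/
def K5int (w : E4) (μ : ℝ) : ℝ := μ ^ 7 * G μ w

/-- **The witness kernel** `K₅(w) = ∫_{μ>2} μ⁷ G_μ(w) dμ`: a positive combination of free propagators of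
masses `μ > 2` — `O(4)`-invariant, reflection positive in EVERY frame, exponentially decaying, of order ten. -/
def K5 (w : E4) : ℝ := ∫ μ in Ioi (2 : ℝ), K5int w μ

theorem K5int_nonneg (w : E4) {μ : ℝ} (hμ : 0 ≤ μ) : 0 ≤ K5int w μ :=
  mul_nonneg (pow_nonneg hμ 7) (FreeKernel.G_nonneg μ w)

theorem K5_nonneg (w : E4) : 0 ≤ K5 w :=
  setIntegral_nonneg measurableSet_Ioi fun _ hμ => K5int_nonneg w ((zero_le_two).trans (le_of_lt hμ))

theorem measurable_K5int_uncurry : Measurable fun p : E4 × ℝ => K5int p.1 p.2 := by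
  unfold K5int
  exact (measurable_snd.pow_const 7).mul (measurable_G_uncurry.comp (measurable_snd.prodMk measurable_fst))

theorem measurable_K5 : Measurable K5 :=
  (measurable_K5int_uncurry.stronglyMeasurable.integral_prod_right'
    (ν := volume.restrict (Ioi (2 : ℝ)))).measurable

/-- Upper bound of the integrand: `μ⁷ G_μ(w) ≤ (2π²‖w‖²)⁻¹ · μ⁷ e^{-μ‖w‖/2}`. -/
theorem K5int_le {w : E4} (hw : w ≠ 0) (μ : ℝ) (hμ : 0 ≤ μ) :
    K5int w μ ≤ (1 / (2 * π ^ 2 * ‖w‖ ^ 2)) * eint 7 (‖w‖ / 2) μ := by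
  unfold K5int eint
  have h := G_le_exp μ hw
  calc μ ^ 7 * G μ w ≤ μ ^ 7 * (Real.exp (-(μ * ‖w‖ / 2)) * (1 / (2 * π ^ 2 * ‖w‖ ^ 2))) :=
        mul_le_mul_of_nonneg_left h (pow_nonneg hμ 7)
    _ = (1 / (2 * π ^ 2 * ‖w‖ ^ 2)) * (μ ^ 7 * Real.exp (-(‖w‖ / 2 * μ))) := by ring_nf

/-- Lower bound of the integrand: `(4π²‖w‖²)⁻¹ · μ⁷ e^{-μ‖w‖} ≤ μ⁷ G_μ(w)` (`μ > 0`). -/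
theorem K5int_ge {w : E4} (hw : w ≠ 0) {μ : ℝ} (hμ : 0 < μ) :
    (1 / (4 * π ^ 2 * ‖w‖ ^ 2)) * eint 7 ‖w‖ μ ≤ K5int w μ := by
  unfold K5int eint
  have h := G_ge hμ hw
  calc (1 / (4 * π ^ 2 * ‖w‖ ^ 2)) * (μ ^ 7 * Real.exp (-(‖w‖ * μ)))
      = μ ^ 7 * (Real.exp (-(μ * ‖w‖)) / (4 * π ^ 2 * ‖w‖ ^ 2)) := by ring_nf
    _ ≤ μ ^ 7 * G μ w := mul_le_mul_of_nonneg_left h (pow_nonneg hμ.le 7)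

theorem integrableOn_K5int {w : E4} (hw : w ≠ 0) : IntegrableOn (K5int w) (Ioi 2) := by
  have hr : 0 < ‖w‖ / 2 := half_pos (norm_pos_iff.2 hw)
  refine ((integrableOn_eint 7 zero_le_two hr).const_mul (1 / (2 * π ^ 2 * ‖w‖ ^ 2))).mono' ?_ ?_
  · exact (measurable_K5int_uncurry.comp (measurable_const.prodMk measurable_id)).aestronglyMeasurable
  · refine ae_restrict_of_forall_mem measurableSet_Ioi fun μ hμ => ?_
    have hμ0 : 0 ≤ μ := zero_le_two.trans (le_of_lt hμ)
    rw [Real.norm_of_nonneg (K5int_nonneg w hμ0)]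
    exact K5int_le hw μ hμ0

/-- The order-ten constant `A₅ = 7!·2⁸/(2π²)`. -/
def A5 : ℝ := Nat.factorial 7 * 2 ^ 8 / (2 * π ^ 2)

theorem A5_pos : 0 < A5 := by unfold A5; positivity

/-- **Upper bound** `K₅(w) ≤ A₅ ‖w‖⁻¹⁰`. -/
theorem K5_le {w : E4} (hw : w ≠ 0) : K5 w ≤ A5 * ‖w‖⁻¹ ^ 10 := by
  have hr0 : 0 < ‖w‖ := norm_pos_iff.2 hw
  have hr : 0 < ‖w‖ / 2 := half_pos hr0
  calc K5 w ≤ ∫ μ in Ioi (2 : ℝ), (1 / (2 * π ^ 2 * ‖w‖ ^ 2)) * eint 7 (‖w‖ / 2) μ :=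
        setIntegral_mono_on (integrableOn_K5int hw)
          ((integrableOn_eint 7 zero_le_two hr).const_mul _) measurableSet_Ioi
          fun μ hμ => K5int_le hw μ (zero_le_two.trans (le_of_lt hμ))
    _ = (1 / (2 * π ^ 2 * ‖w‖ ^ 2)) * eul 7 2 (‖w‖ / 2) := by rw [integral_const_mul]; rfl
    _ ≤ (1 / (2 * π ^ 2 * ‖w‖ ^ 2)) * (Nat.factorial 7 * (‖w‖ / 2)⁻¹ ^ 8) :=
        mul_le_mul_of_nonneg_left (eul_le 7 zero_le_two hr) (by positivity)
    _ = A5 * ‖w‖⁻¹ ^ 10 := by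
        have e : (‖w‖ / 2)⁻¹ ^ 8 = 2 ^ 8 * ‖w‖⁻¹ ^ 8 := by rw [inv_div, div_eq_mul_inv, mul_pow]
        rw [e]
        unfold A5
        field_simp

/-- **Order ten**: `e⁻²/(4π²) · ‖w‖⁻¹⁰ ≤ K₅(w)` for `0 < ‖w‖ ≤ 1/2`. -/
theorem K5_ge {w : E4} (hw : w ≠ 0) (hw2 : ‖w‖ ≤ 1 / 2) :
    Real.exp (-2) / (4 * π ^ 2) * ‖w‖⁻¹ ^ 10 ≤ K5 w := by
  have hr0 : 0 < ‖w‖ := norm_pos_iff.2 hw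
  have har : (2 : ℝ) ≤ ‖w‖⁻¹ := by
    rw [le_inv_comm₀ two_pos hr0]; linarith
  calc Real.exp (-2) / (4 * π ^ 2) * ‖w‖⁻¹ ^ 10
      = (1 / (4 * π ^ 2 * ‖w‖ ^ 2)) * (Real.exp (-2) * ‖w‖⁻¹ ^ 8) := by
        field_simp
    _ ≤ (1 / (4 * π ^ 2 * ‖w‖ ^ 2)) * eul 7 2 ‖w‖ :=
        mul_le_mul_of_nonneg_left (eul_ge 7 zero_le_two hr0 har) (by positivity)
    _ = ∫ μ in Ioi (2 : ℝ), (1 / (4 * π ^ 2 * ‖w‖ ^ 2)) * eint 7 ‖w‖ μ := by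
        rw [integral_const_mul]; rfl
    _ ≤ K5 w :=
        setIntegral_mono_on ((integrableOn_eint 7 zero_le_two hr0).const_mul _) (integrableOn_K5int hw)
          measurableSet_Ioi fun μ hμ => K5int_ge hw (two_pos.trans (mem_Ioi.1 hμ))

/-- **Exponential decay**: `K₅(w) ≤ (e² eul 7 2 1 / (2π²)) · e^{-‖w‖}` for `‖w‖ ≥ 2`. -/
theorem K5_le_exp {w : E4} (hw : 2 ≤ ‖w‖) :
    K5 w ≤ (Real.exp 2 * eul 7 2 1 / (2 * π ^ 2)) * Real.exp (-‖w‖) := by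
  have hr0 : 0 < ‖w‖ := two_pos.trans_le hw
  have hw0 : w ≠ 0 := norm_pos_iff.1 hr0
  have hr : 0 < ‖w‖ / 2 := half_pos hr0
  have h1 : 1 ≤ ‖w‖ / 2 := by linarith
  calc K5 w ≤ (1 / (2 * π ^ 2 * ‖w‖ ^ 2)) * eul 7 2 (‖w‖ / 2) := by
        calc K5 w ≤ ∫ μ in Ioi (2 : ℝ), (1 / (2 * π ^ 2 * ‖w‖ ^ 2)) * eint 7 (‖w‖ / 2) μ :=
              setIntegral_mono_on (integrableOn_K5int hw0)
                ((integrableOn_eint 7 zero_le_two hr).const_mul _) measurableSet_Ioi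
                fun μ hμ => K5int_le hw0 μ (zero_le_two.trans (le_of_lt hμ))
          _ = (1 / (2 * π ^ 2 * ‖w‖ ^ 2)) * eul 7 2 (‖w‖ / 2) := by rw [integral_const_mul]; rfl
    _ ≤ (1 / (2 * π ^ 2 * 1)) * (Real.exp (2 * (1 - ‖w‖ / 2)) * eul 7 2 1) := by
        gcongr
        · exact eul_nonneg 7 zero_le_two _
        · nlinarith
        · exact eul_le_exp 7 zero_le_two h1
    _ = (Real.exp 2 * eul 7 2 1 / (2 * π ^ 2)) * Real.exp (-‖w‖) := by
        rw [show 2 * (1 - ‖w‖ / 2) = 2 + -‖w‖ by ring, Real.exp_add]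
        ring

/-- `K₅` is `O(4)`-invariant. -/
theorem K5_isometry (R : E4 ≃ₗᵢ[ℝ] E4) (w : E4) : K5 (R w) = K5 w := by
  unfold K5 K5int
  simp_rw [G_isometry]

theorem K5_neg (w : E4) : K5 (-w) = K5 w := by
  unfold K5 K5int
  simp_rw [G_neg]

/-- `K₅` is radially non-increasing. -/
theorem K5_antitone {x y : E4} (hx : x ≠ 0) (h : ‖x‖ ≤ ‖y‖) : K5 y ≤ K5 x := by
  have hy : y ≠ 0 := by
    intro h0; rw [h0, norm_zero] at h; exact hx (norm_eq_zero.1 (le_antisymm h (norm_nonneg _)))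
  refine setIntegral_mono_on (integrableOn_K5int hy) (integrableOn_K5int hx) measurableSet_Ioi fun μ hμ => ?_
  unfold K5int
  exact mul_le_mul_of_nonneg_left (G_antitone μ hx h) (pow_nonneg (zero_le_two.trans (le_of_lt hμ)) 7)

/-- `K₅` is continuous off the origin. -/
theorem continuousOn_K5 : ContinuousOn K5 {w : E4 | w ≠ 0} := by
  intro x₀ hx₀
  have hρ : 0 < ‖x₀‖ / 2 := half_pos (norm_pos_iff.2 hx₀)
  set ρ := ‖x₀‖ / 2 with hρdef
  set U : Set E4 := {x | ρ < ‖x‖} with hU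
  have hUopen : IsOpen U := isOpen_lt continuous_const continuous_norm
  have hx₀U : x₀ ∈ U := by show ρ < ‖x₀‖; rw [hρdef]; linarith [norm_pos_iff.2 hx₀]
  have hUne : ∀ x ∈ U, x ≠ 0 := fun x hx h0 => by
    rw [h0] at hx; simp [hU] at hx; linarith
  have hcont : ContinuousOn K5 U := by
    refine continuousOn_of_dominated (F := fun x μ => K5int x μ)
      (bound := fun μ => (1 / (2 * π ^ 2 * ρ ^ 2)) * eint 7 (ρ / 2) μ)
      (μ := volume.restrict (Ioi (2 : ℝ))) ?_ ?_ ?_ ?_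
    · intro x _
      exact (measurable_K5int_uncurry.comp (measurable_const.prodMk measurable_id)).aestronglyMeasurable
    · intro x hx
      refine ae_restrict_of_forall_mem measurableSet_Ioi fun μ hμ => ?_
      have hμ0 : 0 ≤ μ := zero_le_two.trans (le_of_lt hμ)
      rw [Real.norm_of_nonneg (K5int_nonneg x hμ0)]
      have hxρ : ρ ≤ ‖x‖ := le_of_lt hx
      calc K5int x μ ≤ (1 / (2 * π ^ 2 * ‖x‖ ^ 2)) * eint 7 (‖x‖ / 2) μ := K5int_le (hUne x hx) μ hμ0
        _ ≤ (1 / (2 * π ^ 2 * ρ ^ 2)) * eint 7 (ρ / 2) μ := by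
            gcongr
            · exact eint_nonneg 7 _ hμ0
            · exact eint_antitone 7 (by linarith) hμ0
    · exact (integrableOn_eint 7 zero_le_two (half_pos hρ)).const_mul _
    · refine ae_restrict_of_forall_mem measurableSet_Ioi fun μ _ => ?_
      unfold K5int
      exact (continuousOn_const.mul ((continuousOn_G μ).mono fun x hx => hUne x hx))
  exact (hcont.continuousAt (hUopen.mem_nhds hx₀U)).continuousWithinAt

/-- **Time decay** `K₅(w − t e₀) ≤ e²(1 + eul 7 2 1)·e^{-t}·(1 + K₅(w))` for `w⁰ ≤ 0`, `w ≠ 0`, `t ≥ 0`. -/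
theorem K5_sub_time_le {w : E4} (hw : w 0 ≤ 0) (hw0 : w ≠ 0) {t : ℝ} (ht : 0 ≤ t) :
    K5 (w - EuclideanSpace.single 0 t) ≤
      Real.exp 2 * (1 + eul 7 2 1) * Real.exp (-t) * (1 + K5 w) := by
  have hE : 0 ≤ eul 7 2 1 := eul_nonneg 7 zero_le_two 1
  have hK : 0 ≤ K5 w := K5_nonneg w
  -- ‖w − t e₀‖ ≥ ‖w‖ and ≥ t
  have hnorm_sq : ‖w - EuclideanSpace.single 0 t‖ ^ 2 = ‖w‖ ^ 2 - 2 * t * w 0 + t ^ 2 := by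
    have hsum : ∀ v : E4, ‖v‖ ^ 2 = v 0 ^ 2 + ∑ k : Fin 3, v k.succ ^ 2 := fun v => by
      rw [EuclideanSpace.real_norm_sq_eq, Fin.sum_univ_succ]
    have h0 : (w - EuclideanSpace.single 0 t : E4) 0 = w 0 - t := by simp
    have hk : ∀ k : Fin 3, (w - EuclideanSpace.single 0 t : E4) k.succ = w k.succ := fun k => by simp
    rw [hsum, hsum, h0]
    simp only [hk]
    ring
  have hge1 : ‖w‖ ≤ ‖w - EuclideanSpace.single 0 t‖ := by
    apply le_of_sq_le_sq _ (norm_nonneg _)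
    rw [hnorm_sq]; nlinarith
  have hge2 : t ≤ ‖w - EuclideanSpace.single 0 t‖ := by
    apply le_of_sq_le_sq _ (norm_nonneg _)
    rw [hnorm_sq]; nlinarith [sq_nonneg ‖w‖]
  by_cases h2 : 2 ≤ t
  · -- large t: exponential decay of K₅ at radius ≥ t
    have hv0 : w - EuclideanSpace.single 0 t ≠ 0 := by
      intro h0; rw [h0, norm_zero] at hge2; linarith
    calc K5 (w - EuclideanSpace.single 0 t)
        ≤ (Real.exp 2 * eul 7 2 1 / (2 * π ^ 2)) * Real.exp (-‖w - EuclideanSpace.single 0 t‖) :=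
          K5_le_exp (h2.trans hge2)
      _ ≤ (Real.exp 2 * eul 7 2 1 / (2 * π ^ 2)) * Real.exp (-t) := by
          gcongr
      _ ≤ Real.exp 2 * (1 + eul 7 2 1) * Real.exp (-t) * (1 + K5 w) := by
          have hπ : 1 ≤ 2 * π ^ 2 := by nlinarith [Real.pi_gt_three]
          have : Real.exp 2 * eul 7 2 1 / (2 * π ^ 2) ≤ Real.exp 2 * (1 + eul 7 2 1) := by
            rw [div_le_iff₀ (by positivity)]
            nlinarith [Real.exp_pos 2, mul_nonneg (Real.exp_pos 2).le hE]
          calc (Real.exp 2 * eul 7 2 1 / (2 * π ^ 2)) * Real.exp (-t)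
              ≤ Real.exp 2 * (1 + eul 7 2 1) * Real.exp (-t) :=
                mul_le_mul_of_nonneg_right this (Real.exp_pos _).le
            _ ≤ Real.exp 2 * (1 + eul 7 2 1) * Real.exp (-t) * (1 + K5 w) :=
                le_mul_of_one_le_right (by positivity) (by linarith)
  · -- small t: monotonicity, `e^{2-t} ≥ 1`
    have hlt : t < 2 := lt_of_not_ge h2
    calc K5 (w - EuclideanSpace.single 0 t) ≤ K5 w := K5_antitone hw0 hge1
      _ ≤ Real.exp 2 * Real.exp (-t) * K5 w := by
          refine le_mul_of_one_le_left hK ?_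
          rw [← Real.exp_add]; exact Real.one_le_exp (by linarith)
      _ ≤ Real.exp 2 * Real.exp (-t) * (1 + K5 w) := by
          nlinarith [mul_pos (Real.exp_pos 2) (Real.exp_pos (-t))]
      _ = Real.exp 2 * Real.exp (-t) * (1 + K5 w) * 1 := by ring
      _ ≤ Real.exp 2 * Real.exp (-t) * (1 + K5 w) * (1 + eul 7 2 1) :=
          mul_le_mul_of_nonneg_left (by linarith) (by positivity)
      _ = Real.exp 2 * (1 + eul 7 2 1) * Real.exp (-t) * (1 + K5 w) := by ring

end GFF

namespace KernelWitness

open L1Witness (SN SN_nonneg norm_le_SN SN_mono_right norm_le_flat_of_isOffDiagonal wt wt_nonneg integrable_wt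
  offDiag mem_offDiag real_smul_eq seminormFamily_eq SN_le_sup isOffDiagonal_translateMulti isOffDiagonal_linActMulti
  isOffDiagonal_permTest isOffDiagonal_osAdjoint integral_comp_isometry integral_comp_perm integral_comp_isometry₂
  integrable_comp_isometry₂ Rθ Rθ_zero Rθ_one comp_rev_eq_comp_swap pos_of_isPositiveTime starTheta_apply
  tsupport_starTheta_subset isOffDiagonal_thetaTensor tsupport_translateTest_subset isPositiveTime_translateTest)

/-- **Admissible kernels**: the hypotheses under which the Hahn–Banach two-point functional of `K(x₀ − x₁)` exists
and carries the translation / swap / hermiticity / clustering clauses of the two-point package: measurable, non-negative,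
continuous off `0`, even, invariant under time reflection, `K ≤ A‖·‖⁻¹⁰` off `0`, and the time-decay inequality
`K(w − t e₀) ≤ B e^{-t} (1 + K(w))` for `w⁰ ≤ 0`, `w ≠ 0`, `t ≥ 0`. -/
structure AdmissibleKernel (K : E4 → ℝ) where
  measurable : Measurable K
  nonneg : ∀ w, 0 ≤ K w
  continuousOn : ContinuousOn K {w : E4 | w ≠ 0}
  even : ∀ w, K (-w) = K w
  theta : ∀ w, K (timeReflection 4 w) = K w
  A : ℝ
  A_nonneg : 0 ≤ A
  le : ∀ w : E4, w ≠ 0 → K w ≤ A * ‖w‖⁻¹ ^ 10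
  B : ℝ
  B_nonneg : 0 ≤ B
  timeDecay : ∀ w : E4, w 0 ≤ 0 → w ≠ 0 → ∀ t : ℝ, 0 ≤ t →
    K (w - EuclideanSpace.single 0 t) ≤ B * Real.exp (-t) * (1 + K w)

variable {K : E4 → ℝ}

/-! ### The two-point integrand `K(x₀−x₁) F(x)`: domination, integrability, seminorm bound -/

section Integrand

/-- The kernel on configurations, complex-valued: `KC K x = K(x₀ − x₁)`. -/
def KC (K : E4 → ℝ) (x : Fin 2 → E4) : ℂ := (K (x 0 - x 1) : ℂ)

theorem KC_apply (K : E4 → ℝ) (x : Fin 2 → E4) : KC K x = (K (x 0 - x 1) : ℂ) := rfl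

theorem measurable_KC (hK : AdmissibleKernel K) : Measurable (KC K) :=
  Complex.measurable_ofReal.comp (hK.measurable.comp ((measurable_pi_apply 0).sub (measurable_pi_apply 1)))

theorem norm_KC (hK : AdmissibleKernel K) (x : Fin 2 → E4) : ‖KC K x‖ = K (x 0 - x 1) := by
  rw [KC, Complex.norm_real, Real.norm_of_nonneg (hK.nonneg _)]

/-- The domination constant `A · 3⁹`. -/
def Cdom (hK : AdmissibleKernel K) : ℝ := hK.A * 3 ^ 9

theorem Cdom_nonneg (hK : AdmissibleKernel K) : 0 ≤ Cdom hK := by unfold Cdom; exact mul_nonneg hK.A_nonneg (by positivity)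

/-- **Domination**: for an off-diagonal `F`, `‖K(x₀−x₁) F(x)‖ ≤ 9!·3⁹ (1+‖x‖)⁻⁹ SN 9 10 F`
(near the diagonal the `‖x₀−x₁‖⁻¹⁰` of the kernel is paid by ten orders of flatness). -/
theorem norm_KC_mul_le (hK : AdmissibleKernel K) {F : 𝓢((Fin 2 → E4), ℂ)} (hF : IsOffDiagonal F)
    (x : Fin 2 → E4) : ‖KC K x * F x‖ ≤ Cdom hK * wt x * SN 9 10 F := by
  have hA := hK.A_nonneg
  have hrhs : 0 ≤ Cdom hK * wt x * SN 9 10 F :=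
    mul_nonneg (mul_nonneg (Cdom_nonneg hK) (wt_nonneg x)) (SN_nonneg _ _ _)
  by_cases hw : x 0 - x 1 = 0
  · have hx : x ∈ coincidenceLocus 2 E4 := ⟨0, 1, by decide, sub_eq_zero.1 hw⟩
    rw [hF.apply_eq_zero hx, mul_zero, norm_zero]
    exact hrhs
  rw [norm_mul, norm_KC hK]
  have hKle := hK.le _ hw
  have hwpos : 0 < ‖x 0 - x 1‖ := norm_pos_iff.2 hw
  by_cases h1 : ‖x 0 - x 1‖ ≤ 1
  · have hFx := norm_le_flat_of_isOffDiagonal hF 9 10 x h1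
    have hprod : ‖x 0 - x 1‖⁻¹ ^ 10 * (‖x 0 - x 1‖ / 2) ^ 10 = (1 / 2) ^ 10 := by
      rw [← mul_pow]; congr 1; field_simp
    calc K (x 0 - x 1) * ‖F x‖
        ≤ (hK.A * ‖x 0 - x 1‖⁻¹ ^ 10) *
            (3 ^ 9 * (‖x 0 - x 1‖ / 2) ^ 10 * (1 + ‖x‖)⁻¹ ^ 9 * SN 9 10 F) :=
          mul_le_mul hKle hFx (norm_nonneg _) (by positivity)
      _ = hK.A * 3 ^ 9 * (‖x 0 - x 1‖⁻¹ ^ 10 * (‖x 0 - x 1‖ / 2) ^ 10) *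
            (1 + ‖x‖)⁻¹ ^ 9 * SN 9 10 F := by ring
      _ = hK.A * 3 ^ 9 * (1 / 2) ^ 10 * (1 + ‖x‖)⁻¹ ^ 9 * SN 9 10 F := by rw [hprod]
      _ ≤ hK.A * 3 ^ 9 * 1 * (1 + ‖x‖)⁻¹ ^ 9 * SN 9 10 F := by
          gcongr; norm_num
      _ = Cdom hK * wt x * SN 9 10 F := by rw [Cdom, wt]; ring
  · have h1' : 1 < ‖x 0 - x 1‖ := lt_of_not_ge h1
    have hinv : ‖x 0 - x 1‖⁻¹ ^ 10 ≤ 1 := pow_le_one₀ (by positivity) (inv_le_one_of_one_le₀ h1'.le)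
    have hK' : K (x 0 - x 1) ≤ hK.A := by
      calc K (x 0 - x 1) ≤ hK.A * ‖x 0 - x 1‖⁻¹ ^ 10 := hKle
        _ ≤ hK.A * 1 := by gcongr
        _ = hK.A := mul_one _
    have hFx : ‖F x‖ ≤ 2 ^ 9 * (1 + ‖x‖)⁻¹ ^ 9 * SN 9 10 F :=
      (norm_le_SN F 9 x).trans (by
        gcongr
        exact SN_mono_right (Nat.zero_le 10) F)
    calc K (x 0 - x 1) * ‖F x‖ ≤ hK.A * (2 ^ 9 * (1 + ‖x‖)⁻¹ ^ 9 * SN 9 10 F) :=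
          mul_le_mul hK' hFx (norm_nonneg _) (by positivity)
      _ ≤ hK.A * (3 ^ 9 * (1 + ‖x‖)⁻¹ ^ 9 * SN 9 10 F) := by
          gcongr; norm_num
      _ = Cdom hK * wt x * SN 9 10 F := by rw [Cdom, wt]; ring

theorem aestronglyMeasurable_KC_mul (hK : AdmissibleKernel K) (F : 𝓢((Fin 2 → E4), ℂ)) :
    AEStronglyMeasurable (fun x => KC K x * F x) volume :=
  ((measurable_KC hK).aestronglyMeasurable).mul F.continuous.aestronglyMeasurable

/-- **Integrability** of `K(x₀−x₁) F(x)` for off-diagonal `F`. -/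
theorem integrable_KC_mul (hK : AdmissibleKernel K) {F : 𝓢((Fin 2 → E4), ℂ)} (hF : IsOffDiagonal F) :
    Integrable (fun x => KC K x * F x) :=
  Integrable.mono' ((integrable_wt.const_mul (Cdom hK)).mul_const (SN 9 10 F))
    (aestronglyMeasurable_KC_mul hK F) (ae_of_all _ (norm_KC_mul_le hK hF))

/-- The constant of the seminorm bound. -/
def Cbd (hK : AdmissibleKernel K) : ℝ := Cdom hK * ∫ x, wt x

theorem Cbd_nonneg (hK : AdmissibleKernel K) : 0 ≤ Cbd hK :=
  mul_nonneg (Cdom_nonneg hK) (integral_nonneg wt_nonneg)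

/-- **Seminorm bound** `‖∫ K F‖ ≤ Cbd · SN 9 10 F` on `⁰𝒮`. -/
theorem norm_integral_KC_mul_le (hK : AdmissibleKernel K) {F : 𝓢((Fin 2 → E4), ℂ)} (hF : IsOffDiagonal F) :
    ‖∫ x, KC K x * F x‖ ≤ Cbd hK * SN 9 10 F := by
  calc ‖∫ x, KC K x * F x‖ ≤ ∫ x, Cdom hK * wt x * SN 9 10 F :=
        norm_integral_le_of_norm_le ((integrable_wt.const_mul (Cdom hK)).mul_const (SN 9 10 F))
          (ae_of_all _ (norm_KC_mul_le hK hF))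
    _ = Cbd hK * SN 9 10 F := by
        rw [integral_mul_const, integral_const_mul, Cbd]

end Integrand

/-! ### `⁰𝒮` as a subspace, the functional `ℓ F = ∫ K F`, and a continuous extension `T` -/

section Extension

/-- The functional `ℓ F = ∫ K(x₀−x₁) F(x) dx` (meaningful on `⁰𝒮`). -/
def ell (K : E4 → ℝ) (F : 𝓢((Fin 2 → E4), ℂ)) : ℂ := ∫ x, KC K x * F x

theorem ell_add (hK : AdmissibleKernel K) {F G : 𝓢((Fin 2 → E4), ℂ)} (hF : IsOffDiagonal F)
    (hG : IsOffDiagonal G) : ell K (F + G) = ell K F + ell K G := by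
  have h : ∀ x, (F + G) x = F x + G x := fun _ => rfl
  simp only [ell, h, mul_add]
  exact integral_add (integrable_KC_mul hK hF) (integrable_KC_mul hK hG)

theorem ell_smul (K : E4 → ℝ) (c : ℂ) (F : 𝓢((Fin 2 → E4), ℂ)) : ell K (c • F) = c * ell K F := by
  have h : ∀ x, (c • F) x = c * F x := fun _ => rfl
  simp only [ell, h, ← integral_const_mul]
  congr 1; funext x; ring

theorem norm_ell_le (hK : AdmissibleKernel K) {F : 𝓢((Fin 2 → E4), ℂ)} (hF : IsOffDiagonal F) :
    ‖ell K F‖ ≤ Cbd hK * SN 9 10 F :=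
  norm_integral_KC_mul_le hK hF

/-- The dominating seminorm `N F = Cbd · SN 9 10 F`. -/
def Nsem (hK : AdmissibleKernel K) (F : 𝓢((Fin 2 → E4), ℂ)) : ℝ := Cbd hK * SN 9 10 F

theorem Nsem_smul (hK : AdmissibleKernel K) (c : ℂ) (F : 𝓢((Fin 2 → E4), ℂ)) :
    Nsem hK (c • F) = ‖c‖ * Nsem hK F := by
  simp only [Nsem, SN, map_smul_eq_mul]; ring

theorem Nsem_add (hK : AdmissibleKernel K) (F G : 𝓢((Fin 2 → E4), ℂ)) :
    Nsem hK (F + G) ≤ Nsem hK F + Nsem hK G := by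
  simp only [Nsem, SN]
  rw [← mul_add]
  exact mul_le_mul_of_nonneg_left (map_add_le_add _ F G) (Cbd_nonneg hK)

/-- The real part of `ℓ` on `⁰𝒮` as a partially defined `ℝ`-linear functional. -/
def ellR (hK : AdmissibleKernel K) : 𝓢((Fin 2 → E4), ℂ) →ₗ.[ℝ] ℝ where
  domain := offDiag.restrictScalars ℝ
  toFun :=
    { toFun := fun F => (ell K F.1).re
      map_add' := fun F G => by
        have hF : IsOffDiagonal F.1 := F.2
        have hG : IsOffDiagonal G.1 := G.2
        simp only [Submodule.coe_add, ell_add hK hF hG, Complex.add_re]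
      map_smul' := fun c F => by
        simp only [Submodule.coe_smul_of_tower, RingHom.id_apply, smul_eq_mul]
        rw [real_smul_eq, ell_smul, Complex.re_ofReal_mul] }

theorem ellR_apply (hK : AdmissibleKernel K) (F : (ellR hK).domain) : ellR hK F = (ell K F.1).re := rfl

/-- A real-linear extension of `re ∘ ℓ` to the whole Schwartz space, dominated by `N`. -/
theorem exists_extension (hK : AdmissibleKernel K) : ∃ g : 𝓢((Fin 2 → E4), ℂ) →ₗ[ℝ] ℝ,
    (∀ F : 𝓢((Fin 2 → E4), ℂ), IsOffDiagonal F → g F = (ell K F).re) ∧ ∀ F, g F ≤ Nsem hK F := by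
  obtain ⟨g, hg1, hg2⟩ := exists_extension_of_le_sublinear (ellR hK) (Nsem hK)
    (fun c hc F => by rw [real_smul_eq, Nsem_smul, Complex.norm_real, Real.norm_of_nonneg hc.le])
    (Nsem_add hK) (fun F => by
      rw [ellR_apply]
      exact (Complex.re_le_norm _).trans (norm_ell_le hK F.2))
  exact ⟨g, fun F hF => hg1 ⟨F, hF⟩, hg2⟩

/-- The chosen real extension. -/
def gR (hK : AdmissibleKernel K) : 𝓢((Fin 2 → E4), ℂ) →ₗ[ℝ] ℝ := (exists_extension hK).choose

theorem gR_eq (hK : AdmissibleKernel K) {F : 𝓢((Fin 2 → E4), ℂ)} (hF : IsOffDiagonal F) :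
    gR hK F = (ell K F).re :=
  (exists_extension hK).choose_spec.1 F hF

theorem gR_le (hK : AdmissibleKernel K) (F : 𝓢((Fin 2 → E4), ℂ)) : gR hK F ≤ Nsem hK F :=
  (exists_extension hK).choose_spec.2 F

theorem Nsem_neg (hK : AdmissibleKernel K) (F : 𝓢((Fin 2 → E4), ℂ)) : Nsem hK (-F) = Nsem hK F := by
  rw [← neg_one_smul ℂ F, Nsem_smul]; simp

/-- The complex-linear extension (algebraic). -/
def Tlin (hK : AdmissibleKernel K) : 𝓢((Fin 2 → E4), ℂ) →ₗ[ℂ] ℂ := Module.Dual.extendRCLike (𝕜 := ℂ) (gR hK)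

theorem norm_Tlin_le (hK : AdmissibleKernel K) (F : 𝓢((Fin 2 → E4), ℂ)) : ‖Tlin hK F‖ ≤ Nsem hK F := by
  have hsq := Module.Dual.norm_extendRCLike_apply_sq (𝕜 := ℂ) (gR hK) F
  have h1 : ‖Tlin hK F‖ ^ 2 ≤ ‖Tlin hK F‖ * Nsem hK F := by
    calc ‖Tlin hK F‖ ^ 2 = gR hK ((starRingEnd ℂ) (Tlin hK F) • F) := hsq
      _ ≤ Nsem hK ((starRingEnd ℂ) (Tlin hK F) • F) := gR_le hK _
      _ = ‖Tlin hK F‖ * Nsem hK F := by rw [Nsem_smul, RCLike.norm_conj]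
  by_cases h0 : ‖Tlin hK F‖ = 0
  · rw [h0]; exact mul_nonneg (Cbd_nonneg hK) (SN_nonneg _ _ _)
  · have hpos : 0 < ‖Tlin hK F‖ := lt_of_le_of_ne (norm_nonneg _) (Ne.symm h0)
    rw [sq] at h1
    exact le_of_mul_le_mul_left h1 hpos

theorem Tlin_eq (hK : AdmissibleKernel K) {F : 𝓢((Fin 2 → E4), ℂ)} (hF : IsOffDiagonal F) :
    Tlin hK F = ell K F := by
  have hIF : IsOffDiagonal ((RCLike.I : ℂ) • F) := hF.smul _
  rw [Tlin, Module.Dual.extendRCLike_apply, gR_eq hK hF, gR_eq hK hIF, ell_smul]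
  have hI : (RCLike.I : ℂ) = Complex.I := rfl
  rw [hI]
  apply Complex.ext
  · simp
  · simp

set_option maxRecDepth 20000 in
/-- **The two-point functional** of an admissible kernel: a continuous linear functional on `𝓢((ℝ⁴)², ℂ)`
which on `⁰𝒮` is integration against `K(x₀ − x₁)` (Hahn–Banach extension). -/
def T (hK : AdmissibleKernel K) : 𝓢((Fin 2 → E4), ℂ) →L[ℂ] ℂ :=
  SchwartzMap.mkCLMtoNormedSpace (𝕜 := ℂ) (σ := RingHom.id ℂ) (Tlin hK) (fun F G => map_add (Tlin hK) F G)
    (fun c F => by rw [map_smul]; rfl)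
    ⟨_, Cbd hK, Cbd_nonneg hK, fun F =>
      (norm_Tlin_le hK F).trans (mul_le_mul_of_nonneg_left (SN_le_sup F) (Cbd_nonneg hK))⟩

theorem T_apply (hK : AdmissibleKernel K) (F : 𝓢((Fin 2 → E4), ℂ)) : T hK F = Tlin hK F := rfl

/-- **Representation on `⁰𝒮`.** -/
theorem T_eq_integral (hK : AdmissibleKernel K) {F : 𝓢((Fin 2 → E4), ℂ)} (hF : IsOffDiagonal F) :
    T hK F = ∫ x, KC K x * F x := by
  rw [T_apply, Tlin_eq hK hF, ell]

end Extension


/-! ### The package of `T` on `⁰𝒮`: translations, kernel symmetries, swap symmetry, hermiticity -/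

section Package

theorem T_translateMulti (hK : AdmissibleKernel K) (a : E4) {F : 𝓢((Fin 2 → E4), ℂ)} (hF : IsOffDiagonal F) :
    T hK (translateMulti a F) = T hK F := by
  rw [T_eq_integral hK (isOffDiagonal_translateMulti hF a), T_eq_integral hK hF]
  have h := integral_sub_right_eq_self (μ := volume) (fun x : Fin 2 → E4 => KC K x * F x) (fun _ => a)
  refine Eq.trans (integral_congr_ae (ae_of_all _ fun x => ?_)) h
  simp only [translateMulti_apply, KC_apply, Pi.sub_apply, sub_sub_sub_cancel_right]
  rfl

/-- Invariance under every linear isometry preserving the kernel. -/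
theorem T_linActMulti (hK : AdmissibleKernel K) (R : E4 ≃ₗᵢ[ℝ] E4) (hR : ∀ w, K (R w) = K w)
    {F : 𝓢((Fin 2 → E4), ℂ)} (hF : IsOffDiagonal F) :
    T hK (linActMulti R F) = T hK F := by
  rw [T_eq_integral hK (isOffDiagonal_linActMulti hF R), T_eq_integral hK hF,
    ← integral_comp_isometry R (fun x => KC K x * linActMulti R F x)]
  refine integral_congr_ae (ae_of_all _ fun x => ?_)
  simp only [linActMulti_apply, KC_apply, LinearIsometryEquiv.symm_apply_apply, ← map_sub, hR]

/-- Swap symmetry (the `n = 2` content of E3). -/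
theorem T_permTest_swap (hK : AdmissibleKernel K) {F : 𝓢((Fin 2 → E4), ℂ)} (hF : IsOffDiagonal F) :
    T hK (permTest (Equiv.swap 0 1) F) = T hK F := by
  rw [T_eq_integral hK (isOffDiagonal_permTest hF _), T_eq_integral hK hF,
    ← integral_comp_perm (Equiv.swap 0 1) (fun x => KC K x * permTest (Equiv.swap 0 1) F x)]
  refine integral_congr_ae (ae_of_all _ fun x => ?_)
  have hswap : (x ∘ Equiv.swap 0 1) ∘ Equiv.swap 0 1 = x := by
    funext i; simp [Function.comp_apply, Equiv.swap_apply_self]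
  simp only [permTest_apply, KC_apply, hswap, Function.comp_apply, Equiv.swap_apply_left,
    Equiv.swap_apply_right, ← hK.even (x 1 - x 0), neg_sub]

/-- Hermiticity shadow (E0): `T F = conj T(ΘF*)` on `⁰𝒮`. -/
theorem T_hermitian (hK : AdmissibleKernel K) {F : 𝓢((Fin 2 → E4), ℂ)} (hF : IsOffDiagonal F) :
    T hK F = (starRingEnd ℂ) (T hK (osAdjoint F)) := by
  rw [T_eq_integral hK (isOffDiagonal_osAdjoint hF), T_eq_integral hK hF, ← integral_conj]
  have hint : ∀ x : Fin 2 → E4, (starRingEnd ℂ) (KC K x * osAdjoint F x) =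
      KC K x * F (fun i => timeReflection 4 (x (Fin.rev i))) := by
    intro x
    simp [osAdjoint_apply, KC_apply, Complex.conj_ofReal]
  simp_rw [hint]
  rw [← integral_comp_isometry (timeReflection 4)
    (fun x : Fin 2 → E4 => KC K x * F (fun i => timeReflection 4 (x (Fin.rev i))))]
  have h2 : ∀ x : Fin 2 → E4, KC K (fun i => timeReflection 4 (x i)) *
      F (fun i => timeReflection 4 (timeReflection 4 (x (Fin.rev i)))) =
        KC K x * F (x ∘ Equiv.swap 0 1) := by
    intro x
    simp only [KC_apply, timeReflection_timeReflection, ← map_sub, hK.theta,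
      ← comp_rev_eq_comp_swap]
  simp_rw [h2]
  have h3 := integral_comp_perm (Equiv.swap 0 1)
    (fun x : Fin 2 → E4 => KC K (x ∘ Equiv.swap 0 1) * F x)
  have h4 : ∀ x : Fin 2 → E4, (x ∘ Equiv.swap 0 1) ∘ Equiv.swap 0 1 = x := by
    intro x; funext i; simp
  simp only [h4] at h3
  rw [h3]
  refine integral_congr_ae (ae_of_all _ fun x => ?_)
  simp only [KC_apply, Function.comp_apply, Equiv.swap_apply_left, Equiv.swap_apply_right]
  rw [← hK.even, neg_sub]

end Package

/-! ### Reflection positivity from a one-function core -/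

section RPFamily

/-- **E2 for `T` from a core inequality.** If for every `g` vanishing outside `{x⁰ > 0}` the OS form
`∫ K(θu₀ − u₁) conj g(u₀) g(u₁) du` is a non-negative real, then `T` satisfies the E2 clause on positive-time
one-point families. -/
theorem T_reflectionPositive_of_core (hK : AdmissibleKernel K)
    (core : ∀ g : 𝓢(E4, ℂ), IsPositiveTime g →
      Integrable (fun u : Fin 2 → E4 =>
        (K (timeReflection 4 (u 0) - u 1) : ℂ) * ((starRingEnd ℂ) (g (u 0)) * g (u 1))) →
      let I := ∫ u : Fin 2 → E4, (K (timeReflection 4 (u 0) - u 1) : ℂ) * ((starRingEnd ℂ) (g (u 0)) * g (u 1))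
      0 ≤ I.re ∧ I.im = 0)
    (N : ℕ) (f : Fin N → 𝓢(E4, ℂ)) (hf : ∀ j, IsPositiveTime (f j))
    (H : Fin N → Fin N → 𝓢((Fin 2 → E4), ℂ))
    (hH : ∀ i j, IsTensorOf (H i j) ![starTest (thetaTest 4 (f i)), f j]) :
    let z := ∑ i, ∑ j, T hK (H i j); 0 ≤ z.re ∧ z.im = 0 := by
  intro z
  have hEq : ∀ i j, H i j = SchwartzMap.tensorFin 2 ![starTest (thetaTest 4 (f i)), f j] :=
    fun i j => (hH i j).unique (isTensorOf_tensorFin _)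
  have hoff : ∀ i j, IsOffDiagonal (H i j) := fun i j => by
    rw [hEq i j]; exact isOffDiagonal_thetaTensor (hf i) (hf j)
  have happ : ∀ i j (x : Fin 2 → E4),
      H i j x = (starRingEnd ℂ) (f i (timeReflection 4 (x 0))) * f j (x 1) := by
    intro i j x
    rw [hH i j x, Fin.prod_univ_two]
    simp
  set g : 𝓢(E4, ℂ) := ∑ j, f j with hg
  have hgapp : ∀ u : E4, g u = ∑ j, f j u := fun u => by
    rw [hg]; simp
  have hgpos : IsPositiveTime g := by
    rw [hg]
    exact (positiveTimeSubmodule ℂ 4).sum_mem fun j _ => hf j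
  set Fij : Fin N → Fin N → (Fin 2 → E4) → ℂ := fun i j x =>
    KC K x * ((starRingEnd ℂ) (f i (timeReflection 4 (x 0))) * f j (x 1)) with hFij
  have hint_ij : ∀ i j, Integrable (Fij i j) := by
    intro i j
    refine (integrable_KC_mul hK (hoff i j)).congr (ae_of_all _ fun x => ?_)
    show KC K x * H i j x = Fij i j x
    rw [happ]
  have hT : ∀ i j, T hK (H i j) = ∫ x, Fij i j x := by
    intro i j
    rw [T_eq_integral hK (hoff i j)]
    exact integral_congr_ae (ae_of_all _ fun x => by show KC K x * H i j x = Fij i j x; rw [happ])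
  set Fg : (Fin 2 → E4) → ℂ := fun x =>
    KC K x * ((starRingEnd ℂ) (g (timeReflection 4 (x 0))) * g (x 1)) with hFg
  have hFg_sum : ∀ x, Fg x = ∑ i, ∑ j, Fij i j x := by
    intro x
    simp only [hFg, hFij, hgapp, map_sum]
    rw [Finset.sum_mul_sum, Finset.mul_sum]
    refine Finset.sum_congr rfl fun i _ => ?_
    rw [Finset.mul_sum]
  have hint_g : Integrable Fg := by
    have : Fg = fun x => ∑ i, ∑ j, Fij i j x := funext hFg_sum
    rw [this]
    exact integrable_finsetSum _ fun i _ => integrable_finsetSum _ fun j _ => hint_ij i j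
  have hz : z = ∫ x, Fg x := by
    show ∑ i, ∑ j, T hK (H i j) = ∫ x, Fg x
    simp_rw [hT, hFg_sum]
    rw [integral_finsetSum _ fun i _ => integrable_finsetSum _ fun j _ => hint_ij i j]
    refine Finset.sum_congr rfl fun i _ => ?_
    rw [integral_finsetSum _ fun j _ => hint_ij i j]
  have hsub := integral_comp_isometry₂ Rθ Fg
  have hsimp : ∀ u : Fin 2 → E4, Fg (fun i => Rθ i (u i)) =
      (K (timeReflection 4 (u 0) - u 1) : ℂ) * ((starRingEnd ℂ) (g (u 0)) * g (u 1)) := by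
    intro u
    simp [hFg, KC_apply, timeReflection_timeReflection]
  have hint' : Integrable fun u : Fin 2 → E4 =>
      (K (timeReflection 4 (u 0) - u 1) : ℂ) * ((starRingEnd ℂ) (g (u 0)) * g (u 1)) := by
    have := integrable_comp_isometry₂ Rθ hint_g
    exact this.congr (ae_of_all _ fun u => hsimp u)
  have hfinal := core g hgpos hint'
  rw [hz, ← hsub]
  simp_rw [hsimp]
  exact hfinal

end RPFamily

/-! ### Exponential clustering of `T` from the time decay of the kernel -/

section Cluster

/-- **Exponential clustering (two-point shadow of E4 / `HasMassGap 1`).** -/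
theorem T_cluster (hK : AdmissibleKernel K) (f g : 𝓢(E4, ℂ)) (hf : IsPositiveTime f) (hg : IsPositiveTime g) :
    ∃ C : ℝ, ∀ t : ℝ, 0 ≤ t → ∀ H : 𝓢((Fin 2 → E4), ℂ),
      IsTensorOf H ![starTest (thetaTest 4 f), translateTest (EuclideanSpace.single 0 t) g] →
        ‖T hK H‖ ≤ C * exp (-t) := by
  set F₀ : 𝓢((Fin 2 → E4), ℂ) := SchwartzMap.tensorFin 2 ![starTest (thetaTest 4 f), g] with hF₀
  have hF₀off : IsOffDiagonal F₀ := isOffDiagonal_thetaTensor hf hg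
  have hF₀app : ∀ x : Fin 2 → E4, F₀ x = (starRingEnd ℂ) (f (timeReflection 4 (x 0))) * g (x 1) := by
    intro x; rw [hF₀, SchwartzMap.tensorFin_apply, Fin.prod_univ_two]; simp
  set D : (Fin 2 → E4) → ℝ := fun x => (1 + K (x 0 - x 1)) * ‖F₀ x‖ with hD
  have hDint : Integrable D := by
    have h1 : Integrable (fun x : Fin 2 → E4 => (1 : ℝ) * ‖F₀ x‖) := (F₀.integrable.norm).const_mul _
    have h2 : Integrable (fun x : Fin 2 → E4 => K (x 0 - x 1) * ‖F₀ x‖) := by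
      have := (integrable_KC_mul hK hF₀off).norm
      refine this.congr (ae_of_all _ fun x => ?_)
      show ‖KC K x * F₀ x‖ = K (x 0 - x 1) * ‖F₀ x‖
      rw [norm_mul, norm_KC hK]
    exact (h1.add h2).congr (ae_of_all _ fun x => by simp only [hD, Pi.add_apply]; ring)
  refine ⟨hK.B * ∫ x, D x, fun t ht H hH => ?_⟩
  have hgt := isPositiveTime_translateTest hg ht
  have hEq : H = SchwartzMap.tensorFin 2 ![starTest (thetaTest 4 f),
      translateTest (EuclideanSpace.single 0 t) g] := hH.unique (isTensorOf_tensorFin _)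
  have hHoff : IsOffDiagonal H := by rw [hEq]; exact isOffDiagonal_thetaTensor hf hgt
  have hHapp : ∀ x : Fin 2 → E4, H x = (starRingEnd ℂ) (f (timeReflection 4 (x 0))) *
      g (x 1 - EuclideanSpace.single 0 t) := by
    intro x; rw [hH x, Fin.prod_univ_two]; simp
  rw [T_eq_integral hK hHoff]
  set c : Fin 2 → E4 := fun i => if i = 1 then -EuclideanSpace.single 0 t else 0 with hc
  have hshift := integral_sub_right_eq_self (μ := volume)
    (fun x : Fin 2 → E4 => ‖KC K x * H x‖) c
  have hpt : ∀ x : Fin 2 → E4, ‖KC K (x - c) * H (x - c)‖ ≤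
      hK.B * exp (-t) * ((1 + K (x 0 - x 1)) * ‖F₀ x‖) := by
    intro x
    have hx0 : (x - c) 0 = x 0 := by simp [hc]
    have hx1 : (x - c) 1 = x 1 + EuclideanSpace.single 0 t := by
      simp [hc, sub_neg_eq_add]
    rw [norm_mul, norm_KC hK, hHapp, hx0, hx1, add_sub_cancel_right, ← hF₀app]
    by_cases hz : F₀ x = 0
    · rw [hz, norm_zero, mul_zero, mul_zero, mul_zero]
    · have hne : (starRingEnd ℂ) (f (timeReflection 4 (x 0))) ≠ 0 ∧ g (x 1) ≠ 0 := by
        rw [hF₀app] at hz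
        exact mul_ne_zero_iff.1 hz
      have hf0 : 0 < (timeReflection 4 (x 0)) 0 :=
        pos_of_isPositiveTime hf (by simpa using hne.1)
      have hx00 : x 0 0 < 0 := by simp [timeReflection_apply] at hf0; linarith
      have hx10 : 0 < x 1 0 := pos_of_isPositiveTime hg hne.2
      have hw : (x 0 - x 1) 0 ≤ 0 := by simp; linarith
      have hw0 : x 0 - x 1 ≠ 0 := by
        intro h; have := congrArg (fun v : E4 => v 0) h; simp at this; linarith
      have hKd : K (x 0 - (x 1 + EuclideanSpace.single 0 t)) ≤
          hK.B * exp (-t) * (1 + K (x 0 - x 1)) := by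
        rw [← sub_sub]; exact hK.timeDecay _ hw hw0 t ht
      calc K (x 0 - (x 1 + EuclideanSpace.single 0 t)) * ‖F₀ x‖
          ≤ (hK.B * exp (-t) * (1 + K (x 0 - x 1))) * ‖F₀ x‖ :=
            mul_le_mul_of_nonneg_right hKd (norm_nonneg _)
        _ = hK.B * exp (-t) * ((1 + K (x 0 - x 1)) * ‖F₀ x‖) := by ring
  calc ‖∫ x, KC K x * H x‖ ≤ ∫ x, ‖KC K x * H x‖ := norm_integral_le_integral_norm _
    _ = ∫ x, ‖KC K (x - c) * H (x - c)‖ := hshift.symm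
    _ ≤ ∫ x, hK.B * exp (-t) * D x :=
        integral_mono_of_nonneg (ae_of_all _ fun _ => norm_nonneg _) (hDint.const_mul _)
          (ae_of_all _ hpt)
    _ = hK.B * (∫ x, D x) * exp (-t) := by rw [integral_const_mul]; ring

end Cluster


end KernelWitness

namespace GFF

open FreeKernel Literature.Analysis.UnboundedOperators KernelWitness
open Literature.MathematicalPhysics.QuantumFieldTheory (freeCovarianceOp_apply_eq_integral_freeKernel)

/-! ### `K₅` is admissible -/

/-- The admissibility data of `K₅` (`A = A₅`, `B = e²(1 + eul 7 2 1)`). -/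
def admissible : AdmissibleKernel K5 where
  measurable := measurable_K5
  nonneg := K5_nonneg
  continuousOn := continuousOn_K5
  even := K5_neg
  theta := K5_isometry (timeReflection 4)
  A := A5
  A_nonneg := A5_pos.le
  le w hw := K5_le hw
  B := Real.exp 2 * (1 + eul 7 2 1)
  B_nonneg := by have := eul_nonneg 7 zero_le_two 1; positivity
  timeDecay w hw hw0 t ht := K5_sub_time_le hw hw0 ht

/-! ### Reflection positivity of `K₅` from the reflection positivity of the free covariances -/

/-- Iterated form of an integral over two-point configurations. -/
theorem integral_fin_two_eq_iterated (H : E4 → E4 → ℂ)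
    (hH : Integrable (fun u : Fin 2 → E4 => H (u 0) (u 1))) :
    ∫ u : Fin 2 → E4, H (u 0) (u 1) = ∫ a : E4, ∫ b : E4, H a b := by
  have hmp := MeasureTheory.volume_preserving_finTwoArrow E4
  have hcomp : (fun u : Fin 2 → E4 => H (u 0) (u 1)) =
      (fun p : E4 × E4 => H p.1 p.2) ∘ MeasurableEquiv.finTwoArrow := by
    funext u; rfl
  have hprod : Integrable (fun p : E4 × E4 => H p.1 p.2) (volume.prod volume) :=
    (hmp.integrable_comp_emb (MeasurableEquiv.finTwoArrow).measurableEmbedding).1 (by rw [← hcomp]; exact hH)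
  have h1 : ∫ u : Fin 2 → E4, H (u 0) (u 1) = ∫ p : E4 × E4, H p.1 p.2 := by
    simpa using hmp.integral_comp' (fun p : E4 × E4 => H p.1 p.2)
  rw [h1]
  exact integral_prod (fun p : E4 × E4 => H p.1 p.2) hprod

/-- The free two-point OS form as a configuration integral:
`∫ G_μ(x₀−x₁) conj g(θx₀) g(x₁) dx = C_μ(θg, g)`. -/
theorem integral_G_eq_freeCovariance {μ : ℝ} (hμ : μ ≠ 0) (g : 𝓢(E4, ℂ)) :
    ∫ x : Fin 2 → E4, (G μ (x 0 - x 1) : ℂ) * ((starRingEnd ℂ) (g (timeReflection 4 (x 0))) * g (x 1)) =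
      freeCovariance μ (thetaTest 4 g) g := by
  set F₀ : 𝓢((Fin 2 → E4), ℂ) := SchwartzMap.tensorFin 2 ![starTest (thetaTest 4 g), g] with hF₀
  have hF₀app : ∀ x : Fin 2 → E4, F₀ x = (starRingEnd ℂ) (g (timeReflection 4 (x 0))) * g (x 1) := by
    intro x; rw [hF₀, SchwartzMap.tensorFin_apply, Fin.prod_univ_two]; simp
  have hint : Integrable (fun u : Fin 2 → E4 =>
      (G μ (u 0 - u 1) : ℂ) * ((starRingEnd ℂ) (g (timeReflection 4 (u 0))) * g (u 1))) := by
    have := integrable_G_mul_schwartz hμ F₀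
    exact this.congr (ae_of_all _ fun u => by simp only [hF₀app])
  rw [integral_fin_two_eq_iterated
    (fun a b => (G μ (a - b) : ℂ) * ((starRingEnd ℂ) (g (timeReflection 4 a)) * g b)) hint,
    freeCovariance_eq_integral_mul_op hμ]
  refine integral_congr_ae (ae_of_all _ fun a => ?_)
  show ∫ b, (G μ (a - b) : ℂ) * ((starRingEnd ℂ) (g (timeReflection 4 a)) * g b) =
    (starRingEnd ℂ) (thetaTest 4 g a) * freeCovarianceOp μ g a
  rw [freeCovarianceOp_apply_eq_integral_freeKernel hμ g a, thetaTest_apply, ← integral_const_mul]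
  refine integral_congr_ae (ae_of_all _ fun b => ?_)
  show (G μ (a - b) : ℂ) * ((starRingEnd ℂ) (g (timeReflection 4 a)) * g b) =
    (starRingEnd ℂ) (g (timeReflection 4 a)) *
      ((((∫ t in Ioi (0 : ℝ), Real.exp (-μ ^ 2 * t) * heatKernel t (a - b) : ℝ)) : ℂ) * g b)
  rw [show (∫ t in Ioi (0 : ℝ), Real.exp (-μ ^ 2 * t) * heatKernel t (a - b)) = G μ (a - b) from rfl]
  ring

/-- The kernel integrand of the OS form in the original variables. -/
def Fg5 (g : 𝓢(E4, ℂ)) (x : Fin 2 → E4) : ℂ :=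
  (K5 (x 0 - x 1) : ℂ) * ((starRingEnd ℂ) (g (timeReflection 4 (x 0))) * g (x 1))

/-- The joint integrand on configurations × masses. -/
def Φ5 (g : 𝓢(E4, ℂ)) (x : Fin 2 → E4) (μ : ℝ) : ℂ :=
  (K5int (x 0 - x 1) μ : ℂ) * ((starRingEnd ℂ) (g (timeReflection 4 (x 0))) * g (x 1))

theorem integral_Φ5_μ (g : 𝓢(E4, ℂ)) (x : Fin 2 → E4) : ∫ μ in Ioi (2 : ℝ), Φ5 g x μ = Fg5 g x := by
  unfold Φ5 Fg5 K5
  rw [integral_mul_const, integral_complex_ofReal]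

attribute [local irreducible] K5int K5 in
theorem measurable_Φ5 (g : 𝓢(E4, ℂ)) : Measurable (Function.uncurry (Φ5 g)) := by
  have hf : Measurable fun z : (Fin 2 → E4) × ℝ => (z.1 0 - z.1 1, z.2) := by fun_prop
  have hK : Measurable fun z : (Fin 2 → E4) × ℝ => K5int (z.1 0 - z.1 1) z.2 :=
    measurable_K5int_uncurry.comp (f := fun z : (Fin 2 → E4) × ℝ => (z.1 0 - z.1 1, z.2)) hf
  have hg0 : Measurable fun z : (Fin 2 → E4) × ℝ => g (timeReflection 4 (z.1 0)) :=
    g.continuous.measurable.comp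
      ((timeReflection 4).continuous.measurable.comp ((measurable_pi_apply 0).comp measurable_fst))
  have hg1 : Measurable fun z : (Fin 2 → E4) × ℝ => g (z.1 1) :=
    g.continuous.measurable.comp ((measurable_pi_apply 1).comp measurable_fst)
  have : Function.uncurry (Φ5 g) = fun z : (Fin 2 → E4) × ℝ =>
      (K5int (z.1 0 - z.1 1) z.2 : ℂ) * ((starRingEnd ℂ) (g (timeReflection 4 (z.1 0))) * g (z.1 1)) := by
    funext z; rfl
  rw [this]
  exact (Complex.measurable_ofReal.comp hK).mul ((Complex.continuous_conj.measurable.comp hg0).mul hg1)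

/-- Support information: on the support of `conj g(θx₀) g(x₁)` (positive-time `g`) the difference is non-zero. -/
theorem sub_ne_zero_of_support {g : 𝓢(E4, ℂ)} (hg : IsPositiveTime g) (x : Fin 2 → E4)
    (hx : (starRingEnd ℂ) (g (timeReflection 4 (x 0))) * g (x 1) ≠ 0) : x 0 - x 1 ≠ 0 := by
  intro h0
  obtain ⟨h1, h2⟩ := mul_ne_zero_iff.1 hx
  have ha : 0 < (timeReflection 4 (x 0)) 0 := L1Witness.pos_of_isPositiveTime hg (by simpa using h1)
  have hb : 0 < x 1 0 := L1Witness.pos_of_isPositiveTime hg h2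
  have : x 0 = x 1 := sub_eq_zero.1 h0
  simp [timeReflection_apply] at ha
  rw [this] at ha; linarith

theorem integrable_Φ5 {g : 𝓢(E4, ℂ)} (hg : IsPositiveTime g) (hFg : Integrable (Fg5 g)) :
    Integrable (Function.uncurry (Φ5 g)) (volume.prod (volume.restrict (Ioi (2 : ℝ)))) := by
  rw [integrable_prod_iff (measurable_Φ5 g).aestronglyMeasurable]
  constructor
  · refine ae_of_all _ fun x => ?_
    by_cases hz : (starRingEnd ℂ) (g (timeReflection 4 (x 0))) * g (x 1) = 0
    · have : (fun μ => Function.uncurry (Φ5 g) (x, μ)) = fun _ => 0 := by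
        funext μ; simp [Φ5, hz]
      rw [this]; exact integrable_zero _ _ _
    · have hw := sub_ne_zero_of_support hg x hz
      have : (fun μ => Function.uncurry (Φ5 g) (x, μ)) =
          fun μ => ((starRingEnd ℂ) (g (timeReflection 4 (x 0))) * g (x 1)) * (K5int (x 0 - x 1) μ : ℂ) := by
        funext μ; simp only [Function.uncurry_apply_pair, Φ5]; ring
      rw [this]
      exact ((integrableOn_K5int hw).ofReal).const_mul _
  · have hnorm : ∀ x : Fin 2 → E4, ∫ μ in Ioi (2 : ℝ), ‖Function.uncurry (Φ5 g) (x, μ)‖ = ‖Fg5 g x‖ := by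
      intro x
      have h1 : ∀ μ ∈ Ioi (2 : ℝ), ‖Function.uncurry (Φ5 g) (x, μ)‖ =
          K5int (x 0 - x 1) μ * ‖(starRingEnd ℂ) (g (timeReflection 4 (x 0))) * g (x 1)‖ := by
        intro μ hμ
        simp only [Function.uncurry_apply_pair, Φ5, norm_mul, Complex.norm_real,
          Real.norm_of_nonneg (K5int_nonneg _ (zero_le_two.trans (le_of_lt hμ)))]
      rw [setIntegral_congr_fun measurableSet_Ioi h1, integral_mul_const]
      simp only [Fg5, norm_mul, Complex.norm_real, Real.norm_of_nonneg (K5_nonneg _)]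
      rfl
    simp_rw [hnorm]
    exact hFg.norm

theorem integral_Φ5_x {g : 𝓢(E4, ℂ)} (hg : IsPositiveTime g) {μ : ℝ} (hμ : μ ∈ Ioi (2 : ℝ)) :
    ∫ x, Φ5 g x μ = ((μ ^ 7 * (freeCovariance μ (thetaTest 4 g) g).re : ℝ) : ℂ) := by
  have hμ0 : μ ≠ 0 := (two_pos.trans (mem_Ioi.1 hμ)).ne'
  have hC := freeCovariance_reflectionPositive_holds hμ0 hg
  have hCeq : freeCovariance μ (thetaTest 4 g) g = (((freeCovariance μ (thetaTest 4 g) g).re : ℝ) : ℂ) :=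
    Complex.ext (by simp) (by simp [hC.2])
  have : (fun x => Φ5 g x μ) = fun x => (μ ^ 7 : ℂ) *
      ((G μ (x 0 - x 1) : ℂ) * ((starRingEnd ℂ) (g (timeReflection 4 (x 0))) * g (x 1))) := by
    funext x; simp only [Φ5, K5int]; push_cast; ring
  rw [this, integral_const_mul, integral_G_eq_freeCovariance hμ0 g]
  conv_lhs => rw [hCeq]
  push_cast
  ring

/-- **RP core for `K₅`.** For positive-time `g`, the OS form `∫ K₅(θu₀ − u₁) conj g(u₀) g(u₁) du` equals
`∫_{μ>2} μ⁷ C_μ(θg, g) dμ`, a non-negative real. -/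
theorem rp_core (g : 𝓢(E4, ℂ)) (hg : IsPositiveTime g)
    (hint : Integrable (fun u : Fin 2 → E4 =>
      (K5 (timeReflection 4 (u 0) - u 1) : ℂ) * ((starRingEnd ℂ) (g (u 0)) * g (u 1)))) :
    let I := ∫ u : Fin 2 → E4, (K5 (timeReflection 4 (u 0) - u 1) : ℂ) * ((starRingEnd ℂ) (g (u 0)) * g (u 1))
    0 ≤ I.re ∧ I.im = 0 := by
  intro I
  have hsub := L1Witness.integral_comp_isometry₂ L1Witness.Rθ (Fg5 g)
  have hsimp : ∀ u : Fin 2 → E4, Fg5 g (fun i => L1Witness.Rθ i (u i)) =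
      (K5 (timeReflection 4 (u 0) - u 1) : ℂ) * ((starRingEnd ℂ) (g (u 0)) * g (u 1)) := by
    intro u; simp [Fg5, timeReflection_timeReflection]
  have hI : I = ∫ x, Fg5 g x := by
    show (∫ u : Fin 2 → E4, (K5 (timeReflection 4 (u 0) - u 1) : ℂ) *
      ((starRingEnd ℂ) (g (u 0)) * g (u 1))) = _
    rw [← hsub]
    exact integral_congr_ae (ae_of_all _ fun u => (hsimp u).symm)
  have hFg_int : Integrable (Fg5 g) := by
    have := L1Witness.integrable_comp_isometry₂ L1Witness.Rθ hint
    refine this.congr (ae_of_all _ fun x => ?_)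
    simp [Fg5, timeReflection_timeReflection]
  have hswap : ∫ x, Fg5 g x = ∫ μ in Ioi (2 : ℝ), ∫ x, Φ5 g x μ := by
    simp_rw [← integral_Φ5_μ]
    exact integral_integral_swap (integrable_Φ5 hg hFg_int)
  rw [hI, hswap, setIntegral_congr_fun measurableSet_Ioi (fun μ hμ => integral_Φ5_x hg hμ),
    integral_complex_ofReal, Complex.ofReal_re, Complex.ofReal_im]
  refine ⟨setIntegral_nonneg measurableSet_Ioi fun μ hμ => ?_, rfl⟩
  have hμ0 : μ ≠ 0 := (two_pos.trans (mem_Ioi.1 hμ)).ne'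
  exact mul_nonneg (pow_nonneg (zero_le_two.trans (le_of_lt hμ)) 7)
    (freeCovariance_reflectionPositive_holds hμ0 hg).1

/-! ### The Euclidean two-point package and the refuted strengthening -/

/-- **Euclidean two-point package**: the two-point package of `L1Witness.TwoPointPackage` (translations, proper
signed permutations, swap, hermiticity, E2 along `e₀`, clustering, continuous representing kernel) PLUS invariance
under EVERY linear isometry of `ℝ⁴` on `⁰𝒮` (full E1) and E2 in EVERY frame `R` (in particular across the four
diagonal mirrors of `DiagonalMirrorRPR`). -/
structure EuclideanTwoPointPackage (T : 𝓢((Fin 2 → E4), ℂ) →L[ℂ] ℂ) (K : E4 → ℂ) : Prop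
    extends L1Witness.TwoPointPackage T K where
  isometry : ∀ (R : E4 ≃ₗᵢ[ℝ] E4) (F : 𝓢((Fin 2 → E4), ℂ)), IsOffDiagonal F → T (linActMulti R F) = T F
  reflectionPositiveAllFrames : ∀ (R : E4 ≃ₗᵢ[ℝ] E4) (N : ℕ) (f : Fin N → 𝓢(E4, ℂ)),
    (∀ j, IsPositiveTime (f j)) → ∀ H : Fin N → Fin N → 𝓢((Fin 2 → E4), ℂ),
      (∀ i j, IsTensorOf (H i j) ![starTest (thetaTest 4 (f i)), f j]) →
        0 ≤ (∑ i, ∑ j, T (linActMulti R (H i j))).re ∧ (∑ i, ∑ j, T (linActMulti R (H i j))).im = 0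

/-- **The Euclidean strengthening of Stub E**: "the Euclidean two-point package and a continuous representing kernel
imply the axial growth bound". -/
def AxialGrowthOfEuclideanPackage : Prop :=
  ∀ (T : 𝓢((Fin 2 → E4), ℂ) →L[ℂ] ℂ) (K : E4 → ℂ), EuclideanTwoPointPackage T K →
    ∃ C η : ℝ, 0 < η ∧ ∀ s : ℝ, 0 < s → s ≤ 1 → ‖K (EuclideanSpace.single 0 s)‖ ≤ C * s ^ (η - 10)

/-- The complexified witness kernel. -/
def K5C (x : E4) : ℂ := (K5 x : ℂ)

/-- The witness functional. -/
def T5 : 𝓢((Fin 2 → E4), ℂ) →L[ℂ] ℂ := KernelWitness.T admissible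

/-- **The dimension-5 generalised free field carries the Euclidean two-point package.** -/
theorem euclideanTwoPointPackage_T5 : EuclideanTwoPointPackage T5 K5C where
  translate a _ hF := T_translateMulti admissible a hF
  signedPerm R _ _ _ hF := T_linActMulti admissible R (K5_isometry R) hF
  swap _ hF := T_permTest_swap admissible hF
  hermitian _ hF := T_hermitian admissible hF.isOffDiagonal
  reflectionPositive N f hf H hH := T_reflectionPositive_of_core admissible rp_core N f hf H hH
  cluster f g hf hg := T_cluster admissible f g hf hg
  continuousOn := Complex.continuous_ofReal.comp_continuousOn continuousOn_K5
  represents _ hF := ⟨integrable_KC_mul admissible hF, T_eq_integral admissible hF⟩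
  isometry R _ hF := T_linActMulti admissible R (K5_isometry R) hF
  reflectionPositiveAllFrames R N f hf H hH := by
    have hoff : ∀ i j, IsOffDiagonal (H i j) := fun i j => by
      rw [(hH i j).unique (isTensorOf_tensorFin _)]
      exact L1Witness.isOffDiagonal_thetaTensor (hf i) (hf j)
    have hinv : ∀ i j, T5 (linActMulti R (H i j)) = T5 (H i j) := fun i j =>
      T_linActMulti admissible R (K5_isometry R) (hoff i j)
    simp_rw [hinv]
    exact T_reflectionPositive_of_core admissible rp_core N f hf H hH

/-- **ORDER-INSUFFICIENCY WITH FULL EUCLIDEAN STRUCTURE.** Even with invariance under every linear isometry of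
`ℝ⁴` and reflection positivity in EVERY frame (all sixteen lattice mirrors and more), plus a continuous representing
kernel, the two-point level does NOT bound the order of the singularity: the dimension-5 generalised free field
`K₅ = ∫_{μ>2} μ⁷ G_μ dμ` (`e⁻²/(4π²) s⁻¹⁰ ≤ K₅(s e₀)` for `s ≤ 1/2`) is the witness. The order of the `tr F²`
two-point function is pure UV input (the lattice tie / asymptotic freedom), unreachable by any model-blind argument
from the OS package, `W(B₄)` or even full `O(4)` symmetry, and mirror positivity. -/
theorem not_axialGrowthOfEuclideanPackage : ¬ AxialGrowthOfEuclideanPackage := by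
  intro h
  obtain ⟨C, η, hη, hb⟩ := h T5 K5C euclideanTwoPointPackage_T5
  have key : ∀ s : ℝ, 0 < s → s ≤ 1 / 2 → Real.exp (-2) / (4 * π ^ 2) ≤ C * s ^ η := by
    intro s hs hs2
    have hx : (EuclideanSpace.single (0 : Fin 4) s : E4) ≠ 0 := by
      intro h0; have := congrArg (fun v : E4 => v 0) h0; simp at this; exact hs.ne' this
    have hn : ‖(EuclideanSpace.single (0 : Fin 4) s : E4)‖ = s := by
      rw [PiLp.norm_single, Real.norm_of_nonneg hs.le]
    have h1 := K5_ge hx (by rw [hn]; exact hs2)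
    rw [hn] at h1
    have h2 := hb s hs (by linarith)
    rw [K5C, Complex.norm_real, Real.norm_of_nonneg (K5_nonneg _)] at h2
    have hpow : C * s ^ (η - 10) = C * s ^ η * s⁻¹ ^ 10 := by
      rw [Real.rpow_sub hs, show (10 : ℝ) = ((10 : ℕ) : ℝ) by norm_num, Real.rpow_natCast,
        div_eq_mul_inv, inv_pow, mul_assoc]
    rw [hpow] at h2
    have hs10 : 0 < s⁻¹ ^ 10 := by positivity
    exact le_of_mul_le_mul_right (h1.trans h2) hs10
  have hlim : Tendsto (fun s : ℝ => C * s ^ η) (𝓝[>] 0) (𝓝 0) := by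
    have hc : ContinuousAt (fun s : ℝ => s ^ η) 0 := Real.continuousAt_rpow_const 0 η (Or.inr hη.le)
    have hc' : ContinuousAt (fun s : ℝ => C * s ^ η) 0 := (continuousAt_const (y := C)).mul hc
    have h1 : Tendsto (fun s : ℝ => C * s ^ η) (𝓝 0) (𝓝 (C * (0 : ℝ) ^ η)) := hc'.tendsto
    rw [Real.zero_rpow hη.ne', mul_zero] at h1
    exact h1.mono_left nhdsWithin_le_nhds
  have hpos : 0 < Real.exp (-2) / (4 * π ^ 2) := by positivity
  have hev : ∀ᶠ s in 𝓝[>] (0 : ℝ), C * s ^ η < Real.exp (-2) / (4 * π ^ 2) ∧ s ∈ Ioo (0 : ℝ) (1 / 2) := by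
    refine (hlim.eventually (gt_mem_nhds hpos)).and ?_
    exact Ioo_mem_nhdsGT (by norm_num)
  obtain ⟨s, hs1, hs2⟩ := hev.exists
  have := key s hs2.1 hs2.2.le
  linarith

end GFF


end Summit.QuantumFields.YangMills.Cruxes.CurvatureKernelBound.DisproofIII
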